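import Mathlib
import Literature.NumberTheory.Sieve.ShnirelmanGoldbachFlatten
import Literature.NumberTheory.LFunctions.ChebyshevSylvesterPsi
import HarnessLib

/-!
# An explicit Shnirel'man–Goldbach theorem, continued (II): every integer `> 1` is a sum of at most `59` primes (`77` → `65` → `63` → `61` → `59`)

Topic `Literature/NumberTheory/Sieve`; namespace `Literature.NumberTheory.Sieve.ShnirelmanGoldbachExplicit` (continued —
these are §16–§19 of the story of `ShnirelmanGoldbachExplicit.lean` (§1–§12, best constant there `501`) and
`ShnirelmanGoldbachFlatten.lean` (§13–§15, best constant there `77`), kept in their own module because both files are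
near the gate's size cap).  Cell `parity-ideate` seat p5, ROUND-31 «BONFERRONI» and ROUND-32 «DISCARD»
(`round23/SchnirelmannExplicit.lean` sha16 23f308d81e206371, l.5899–6656 and l.6658–7071), ROUND-33 «SEVEN
SHIFTS» (`round23/SchnirelmannExplicit.lean` sha16 3dc9ed7259fc9e95, l.7083–7966) and ROUND-34 «SYLVESTER»
(`round34/SchnirelmannExplicit_R34_31d5700760cbceb1.lean`, l.7982–8391), landed with statements and
proofs verbatim (helpers `private`, one-line docstrings added where the source had none; the `private` helpers of
§1–§15 they call are re-proved here as verbatim `private` copies).  No named facts; the only definitions are the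
shifted prime image `shiftImg` and the pair-intersection bookkeeping `pairInterSum` (no instances, no notation).  New tree input relative to §1–§15: the explicit PAIR sieve
`TwoResidueSelbergExplicit.pairCount_le_kappa` (`#{p ≤ N : p, p + d prime} ≤ 17.75·f(d)·N/log²N`, `N ≥ e^41`) and,
from §19 on, Sylvester's Chebyshev bound `ChebyshevSylvesterPsi.sylvester_le_psi` (`ψ(x) ≥ 0.9392x − 9√x`, zero facts).

## References
* [Nathanson1996] M. B. Nathanson, *Additive Number Theory: The Classical Bases*, GTM 164 (1996), §7.3 Lemma 7.6,
  Lemma 7.7, Theorem 7.8, Theorem 7.9 (Goldbach–Shnirel'man).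
* [RosserSchoenfeld1962] J. B. Rosser, L. Schoenfeld, Illinois J. Math. 6 (1962), Theorem 2, eq. (3.3).
* [BatemanDiamond2004] P. T. Bateman, H. G. Diamond, *Analytic Number Theory: An Introductory Course* (2004), §13.4
  (13.13)–(13.14), Theorem 13.8: the explicit large-sieve/Selberg step behind `explicit_of_largeSieve_kappa` and
  `pairCount_le_kappa`.
* [Sylvester1892] J. J. Sylvester, *On arithmetical series*, Messenger of Math. 21 (1892), 1–19, 87–120 (the Chebyshev
  bound `ψ(x) ≥ 0.9392x − O(√x)`; here via the tree's `ChebyshevSylvesterPsi.sylvester_le_psi`).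

## Content

* §16 four shifts: the sets `S_q(y) = {(p+q)/2 : p odd prime ≤ 2y − q}`, `q ∈ {3,5,7,11}`, lie in `(0,y] ∩ B` and avoid
  `1, 2 ∈ B`; `#S_q = π(2y−q) − 1`, and `S_q ∩ S_{q'}` is counted by the prime pairs `(p, p + (q'−q))`, `p ≤ 2y`, which
  the tree's explicit pair sieve bounds (`TwoResidueSelbergExplicit.pairCount_le_kappa`: `17.75·f(d)·N/log²N`, `N ≥ e^41`;
  `d = 2,4,8,2,6,4`, `Σ f(d) = 7`); two-term Bonferroni (`four_shift_count`) gives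
  `B(y) ≥ (7.3696·y − 24)/L − 2 − 248.5·y/L²` (`L = log 2y`), `≥ y/h` while `L² + h ≤ h·(7.3696L − 248.5)`
  (`half_count_ge_allN_bonf`; under (3.3) `L² + h ≤ h·(8L − 248.5)`, `half_count_ge_allN_bonf_RS`): for `h = 32` up to
  `L = 194`, so the count threshold moves to `e^192`, the sieve threshold to `e^114` (`A = 14.6`) and §15's generic
  Hölder count gives `x/64` (`goldbach_even_count_ge_64_exp192`), `σ(B) ≥ 1/32` and
  `schnirelmann_goldbach_le_65`: every `N ≥ 2` is a sum of at most `65` primes (conditional column `55`: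
  `h = 27`, `e^106`, `A = 14.72`, `e^176`, `x/54`, `σ(B) ≥ 1/27`).
* §17 the discard: in the Hölder count the `N < e^{Λs}` are discarded with `m(N) ≤ ℓ_200²·e^{−ℓ_200}`; §14/§15
  evaluated this decreasing function at `ℓ = 49.5` (`2Λs ≤ Λ₀ + 36.5`), §17 evaluates it at the actual bottom level
  `ℓ_200 ≥ Λ₀ − 2` (`sq_le_sq_mul_exp`): discarded mass `≤ 1.0001²·(Λ₀−2)²·e^{2Λs+2−2Λ₀}·x ≤ 0.0025x` for
  `Λs + 10 ≤ Λ₀ ≤ 400` (`goldbach_even_count_ge_holder_gap10`); so `h = 31`, `Λ₀ = 187` (four-shift glue on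
  `[57.1144, 187]`), `Λs = 177`, `A = 14.08`, `x/62` (`goldbach_even_count_ge_62_exp187`), `σ(B) ≥ 1/31` and the file's
  best unconditional constant **`schnirelmann_goldbach_le_63`**: every `N ≥ 2` is a sum of at most `63` primes
  (conditional column `53`: `h = 26`, `e^159`, `A = 14.18`, `e^169`, `x/52`, `σ(B) ≥ 1/26`; the RS four-shift glue
  needs only `h ≥ 18`).
* §18 seven shifts: a subtraction-free two-term Bonferroni inequality for a LIST of finsets (`bonferroni_list`,
  `Σ #Sᵢ ≤ #(⋃ Sᵢ) + Σ_{i<j} #(Sᵢ ∩ Sⱼ)`) gives `seven_shift_count` for `q ∈ {3,5,7,11,13,17,19}` (21 pair terms,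
  differences `2⁴ 4³ 6⁴ 8³ 10² 12² 14² 16¹`, `f(10) = 4/3`, `f(12) = 2`, `f(14) = 6/5`, `f(16) = 1`, `Σ f = 28.0667`):
  `B(y) ≥ (12.8968y − 69.09)/L − 5 − 996.37y/L²`, `≥ y/h` while `L² + h ≤ h·(12.8968L − 996.37)` — at `h = 30` on
  `[106.8, 280.1]`, overlapping the four-shift window `[41.7, 179.4]`; the three-regime glue `half_count_ge_allN_bonf7`
  (switch points `e^55.272`, `e^150`) reaches `Λ₀ = 279`, §17's count runs at `Λs = 269` (`A = 13.77`, `x/60`,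
  `goldbach_even_count_ge_60_exp279`), `σ(B) ≥ 1/30` and the file's best unconditional constant
  **`schnirelmann_goldbach_le_61`**: every `N ≥ 2` is a sum of at most `61` primes (conditional column `51`: `h = 25`,
  switch points `e^50`, `e^140`, `Λ₀ = 249`, `Λs = 239`, `A = 13.84`, `x/50`, `σ(B) ≥ 1/25`).
* §19 Sylvester's constant: the tree proves `ψ(x) ≥ 0.9392x − 9√x` (`ChebyshevSylvesterPsi.sylvester_le_psi`, zero facts),
  so `π(n) ≥ 0.93919·n/log n` for `n ≥ 10¹²` (`primeCountingLowerMul_sylvester`); the constant enters twice: the first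
  moment becomes `Σ_{N≤x} r(N) ≥ 0.441·x²/log²x` (`0.93919²/2`, `sum_goldbachCount_ge_0441`) and the four/seven-shift main
  terms become `7.51352`/`13.14866` (`half_count_ge_allN_bonf7S`; the one-shift regime keeps `0.9212`).  At `h = 29`:
  windows `[40.9, 177.0]` / `[104.5, 276.8]`, `Λ₀ = 275`, `Λs = 265`, `A = 13.78`, `F = 0.4409·gHol 275 − 0.0057 = 0.80655`,
  `(1/58)⁷·259.55·13.78⁸ = 0.1528 ≤ F⁸ = 0.1791` (`goldbach_even_count_ge_58_exp275`), `σ(B) ≥ 1/29` and the file's best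
  unconditional constant **`schnirelmann_goldbach_le_59`**: every `N ≥ 2` is a sum of at most `59` primes.  (The
  conditional column already has `c₀ = 1`: unchanged, `51`.)

Table of the series (K unconditional / under Rosser–Schoenfeld (3.3)): §9 4329/3121 → §10 1581/1141 → §11 791/571 →
§12 501/379 → §13 379/289 → §14 113/105 → §15 77/65 → §16 65/55 → §17 63/53 → §18 61/51 → §19 59/51.  Print calibration (NOT formalised, not
used): Klimov–Pil'tjaĭ–Šeptickaja 1972 (`115`), Klimov 1975 (`55`), Vaughan 1977 (`27`), Deshouillers 1977 (`26`),
Riesel–Vaughan 1983 (`19`), Ramaré 1995 (even `n`: `≤ 6` primes), Helfgott 2013 (`K ≤ 4`) — the constants here are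
those of the ELEMENTARY method with kernel-checked inputs, not a record in print.
-/

namespace Literature.NumberTheory.Sieve.ShnirelmanGoldbachExplicit

open Finset Real
open scoped Classical Pointwise
open Literature.NumberTheory.Sieve Literature.Combinatorics.Additive
open Literature.NumberTheory.Sieve.GoldbachLinnik (oddSingularFactor oddSingularFactor_nonneg)
open Literature.NumberTheory.Sieve.RomanoffExplicit (PrimeCountingLowerMul primeCountingLowerMul_09212)

/-! ### Private copies (verbatim) of the helpers of §1–§15 used below -/

/-- `t/log²t` is increasing on `[e², ∞)`. [folklore] -/
private theorem div_log_sq_mono {a b : ℝ} (ha : Real.exp 2 ≤ a) (hab : a ≤ b) :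
    a / Real.log a ^ 2 ≤ b / Real.log b ^ 2 := by
  have ha0 : 0 < a := lt_of_lt_of_le (Real.exp_pos 2) ha
  have hb0 : 0 < b := lt_of_lt_of_le ha0 hab
  have hu2 : 2 ≤ Real.log a := by
    have := Real.log_le_log (Real.exp_pos 2) ha
    rwa [Real.log_exp] at this
  have huv : Real.log a ≤ Real.log b := Real.log_le_log ha0 hab
  have hexp : b = a * Real.exp (Real.log b - Real.log a) := by
    rw [Real.exp_sub, Real.exp_log hb0, Real.exp_log ha0]
    field_simp
  set u := Real.log a with hu_def
  set v := Real.log b with hv_def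
  set d := v - u with hd
  have hd0 : 0 ≤ d := by rw [hd]; linarith
  have hq := Real.quadratic_le_exp_of_nonneg hd0
  have hu0 : (0 : ℝ) < u := by linarith
  have hv0 : (0 : ℝ) < v := by linarith
  rw [div_le_div_iff₀ (pow_pos hu0 2) (pow_pos hv0 2)]
  have hv : v = u + d := by rw [hd]; ring
  rw [hv, hexp]
  have hin : (u + d) ^ 2 ≤ (1 + d + d ^ 2 / 2) * u ^ 2 := by
    nlinarith [mul_nonneg hd0 (by nlinarith : (0 : ℝ) ≤ u ^ 2 - 2 * u),
      mul_nonneg (sq_nonneg d) (by nlinarith : (0 : ℝ) ≤ u ^ 2 / 2 - 1)]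
  calc a * (u + d) ^ 2 ≤ a * ((1 + d + d ^ 2 / 2) * u ^ 2) := mul_le_mul_of_nonneg_left hin ha0.le
    _ ≤ a * (Real.exp d * u ^ 2) :=
        mul_le_mul_of_nonneg_left (mul_le_mul_of_nonneg_right hq (sq_nonneg u)) ha0.le
    _ = a * Real.exp d * u ^ 2 := by ring

/-- `log⁴x ≤ 4096·√x` for `x ≥ 1` (`log x = 8 log x^{1/8} ≤ 8 x^{1/8}`). [folklore] -/
private theorem log_pow_four_le_sqrt {x : ℝ} (hx : 1 ≤ x) : Real.log x ^ 4 ≤ 4096 * Real.sqrt x := by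
  set t := Real.sqrt (Real.sqrt (Real.sqrt x)) with ht
  have hx0 : 0 ≤ x := by linarith
  have ht1 : 1 ≤ t := Real.one_le_sqrt.mpr (Real.one_le_sqrt.mpr (Real.one_le_sqrt.mpr hx))
  have ht0 : 0 < t := by linarith
  have ht2 : t ^ 2 = Real.sqrt (Real.sqrt x) := by rw [ht, Real.sq_sqrt (Real.sqrt_nonneg _)]
  have ht4 : t ^ 4 = Real.sqrt x := by
    rw [show t ^ 4 = (t ^ 2) ^ 2 by ring, ht2, Real.sq_sqrt (Real.sqrt_nonneg _)]
  have ht8 : t ^ 8 = x := by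
    rw [show t ^ 8 = (t ^ 4) ^ 2 by ring, ht4, Real.sq_sqrt hx0]
  have hlog : Real.log x = 8 * Real.log t := by
    rw [← ht8, Real.log_pow]; norm_num
  have hlt : Real.log t ≤ t := by linarith [Real.log_le_sub_one_of_pos ht0]
  have hl0 : 0 ≤ Real.log t := Real.log_nonneg ht1
  rw [hlog, ← ht4, show (8 * Real.log t) ^ 4 = 4096 * Real.log t ^ 4 by ring]
  exact mul_le_mul_of_nonneg_left (pow_le_pow_left₀ hl0 hlt 4) (by norm_num)

/-- `r(N) ≤ N + 1`. [folklore] -/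
private theorem goldbachCount_le_succ (N : ℕ) : SingularSeries.goldbachCount N ≤ N + 1 := by
  unfold SingularSeries.goldbachCount
  exact (card_filter_le _ _).trans (by rw [Finset.Nat.card_antidiagonal])

/-- For odd `N`, `r(N) ≤ 2` (one of `p, q` is even, hence `= 2`). [folklore] -/
private theorem goldbachCount_le_two_of_odd {N : ℕ} (hN : Odd N) : SingularSeries.goldbachCount N ≤ 2 := by
  unfold SingularSeries.goldbachCount
  calc #{pq ∈ antidiagonal N | pq.1.Prime ∧ pq.2.Prime}
      ≤ #({(2, N - 2), (N - 2, 2)} : Finset (ℕ × ℕ)) := by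
        refine card_le_card fun pq hpq => ?_
        rw [mem_filter, Finset.HasAntidiagonal.mem_antidiagonal] at hpq
        obtain ⟨hsum, hp, hq⟩ := hpq
        rw [mem_insert, mem_singleton]
        rcases Nat.even_or_odd pq.1 with h1 | h1
        · have h2 : pq.1 = 2 := (Nat.Prime.even_iff hp).mp h1
          left
          exact Prod.ext h2 (by simp only; omega)
        · have h2 : Even pq.2 := by
            rw [← hsum] at hN
            exact (Nat.odd_add.mp hN).mp h1
          have h3 : pq.2 = 2 := (Nat.Prime.even_iff hq).mp h2
          right
          exact Prod.ext (by simp only; omega) h3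
    _ ≤ 2 := card_le_two

/-- **Odd `N` are negligible in the first moment**: `Σ_{odd N ≤ x} r(N) ≤ 2(x + 1)`. [folklore] -/
private theorem sum_goldbachCount_odd_le (x : ℕ) :
    ∑ N ∈ (range (x + 1)).filter (fun N => ¬Even N), (SingularSeries.goldbachCount N : ℝ) ≤ 2 * ((x : ℝ) + 1) := by
  calc ∑ N ∈ (range (x + 1)).filter (fun N => ¬Even N), (SingularSeries.goldbachCount N : ℝ)
      ≤ ∑ N ∈ (range (x + 1)).filter (fun N => ¬Even N), (2 : ℝ) := sum_le_sum fun N hN => by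
        rw [mem_filter] at hN
        exact_mod_cast goldbachCount_le_two_of_odd (Nat.not_even_iff_odd.mp hN.2)
    _ = #((range (x + 1)).filter (fun N => ¬Even N)) * 2 := by rw [sum_const, nsmul_eq_mul]
    _ ≤ ((x : ℝ) + 1) * 2 := by
        apply mul_le_mul_of_nonneg_right _ (by norm_num)
        have : #((range (x + 1)).filter (fun N => ¬Even N)) ≤ x + 1 :=
          (card_filter_le _ _).trans (by rw [card_range])
        exact_mod_cast this
    _ = 2 * ((x : ℝ) + 1) := by ring

/-- `σ(S) ≥ 1/K` from `S(N) ≥ N/K` (`N ≥ 1`), for any set `S`. [folklore] -/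
private theorem schnirelmannDensity_ge_of_count' {S : Set ℕ} [DecidablePred (· ∈ S)] {K : ℕ}
    (h : ∀ N : ℕ, 1 ≤ N → (N : ℝ) / K ≤ #{a ∈ Ioc 0 N | a ∈ S}) :
    (1 : ℝ) / K ≤ schnirelmannDensity S := by
  rw [le_schnirelmannDensity_iff]
  intro n hn
  have hn' : (0 : ℝ) < n := by exact_mod_cast hn
  rw [le_div_iff₀ hn']
  have := h n hn
  calc (1 : ℝ) / K * n = (n : ℝ) / K := by ring
    _ ≤ _ := by convert this using 2

/-- The halving map: `#{even N ∈ (0, 2y] : N = p + q} ≤ #{b ∈ (0, y] : b ∈ B}`, `B = {0, 1} ∪ {m : 2m = p + q}`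
(`N ↦ N/2`). [folklore] -/
private theorem even_goldbach_card_le_half (y : ℕ) :
    #{N ∈ Ioc 0 (2 * y) | Even N ∧ ∃ p q : ℕ, p.Prime ∧ q.Prime ∧ p + q = N}
      ≤ #{b ∈ Ioc 0 y | b ∈ (({0, 1} : Set ℕ) ∪ {m | ∃ p q : ℕ, p.Prime ∧ q.Prime ∧ p + q = 2 * m})} := by
  refine card_le_card_of_injOn (fun N => N / 2) ?_ ?_
  · intro N hN
    rw [mem_coe, mem_filter, mem_Ioc] at hN
    obtain ⟨⟨hN0, hNy⟩, ⟨k, hk⟩, p, q, hp, hq, hpq⟩ := hN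
    rw [mem_coe, mem_filter, mem_Ioc]
    dsimp only
    exact ⟨⟨by omega, by omega⟩, Or.inr ⟨p, q, hp, hq, by omega⟩⟩
  · intro N hN N' hN' h
    rw [mem_coe, mem_filter] at hN hN'
    obtain ⟨k, hk⟩ := hN.2.1
    obtain ⟨k', hk'⟩ := hN'.2.1
    simp only at h
    omega

/-- `#{p ≤ y : p prime} = π(y)`. [folklore] -/
private theorem card_filter_prime_range (y : ℕ) : #{p ∈ range (y + 1) | p.Prime} = Nat.primeCounting y := by
  rw [Nat.primeCounting, ← Nat.primesBelow_card_eq_primeCounting']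
  rfl

/-- `0 < log 1.01`. [folklore] -/
private theorem log_101_pos : 0 < Real.log ((101 : ℝ) / 100) := Real.log_pos (by norm_num)

/-- `log 1.01 ≤ 0.01`. [folklore] -/
private theorem log_101_le : Real.log ((101 : ℝ) / 100) ≤ 0.01 := by
  have h := Real.log_le_sub_one_of_pos (show (0 : ℝ) < 101 / 100 by norm_num)
  have e : (101 : ℝ) / 100 - 1 = 0.01 := by norm_num
  rw [e] at h
  exact h

/-- `t_0 = x`. [folklore] -/
private theorem stairT_zero (x : ℕ) : stairT x 0 = x := by simp [stairT]

/-- `t_j = 1.01 · t_{j+1}`. [folklore] -/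
private theorem stairT_succ (x j : ℕ) : stairT x j = (101 / 100) * stairT x (j + 1) := by
  unfold stairT
  rw [pow_succ]
  field_simp

/-- `t_j = x · (100/101)^j`. [folklore] -/
private theorem stairT_eq_mul_pow (x j : ℕ) : stairT x j = (x : ℝ) * ((100 : ℝ) / 101) ^ j := by
  unfold stairT
  rw [div_eq_mul_inv, ← inv_pow]
  norm_num

/-- `t_j ≥ 0`. [folklore] -/
private theorem stairT_nonneg (x j : ℕ) : 0 ≤ stairT x j := by unfold stairT; positivity

/-- `t_j > 0` for `x > 0`. [folklore] -/
private theorem stairT_pos {x : ℕ} (hx : 0 < x) (j : ℕ) : 0 < stairT x j := by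
  unfold stairT
  have : (0 : ℝ) < x := by exact_mod_cast hx
  positivity

/-- `t_j` is non-increasing in `j`. [folklore] -/
private theorem stairT_le_of_le (x : ℕ) {i j : ℕ} (hij : i ≤ j) : stairT x j ≤ stairT x i := by
  unfold stairT
  apply div_le_div_of_nonneg_left (Nat.cast_nonneg x) (by positivity)
  exact pow_le_pow_right₀ (by norm_num) hij

/-- `t_j ≤ x`. [folklore] -/
private theorem stairT_le_self (x j : ℕ) : stairT x j ≤ x := by
  have := stairT_le_of_le x (Nat.zero_le j)
  rwa [stairT_zero] at this

/-- `log t_j = ℓ_j`. [folklore] -/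
private theorem log_stairT {x : ℕ} (hx : 0 < x) (j : ℕ) : Real.log (stairT x j) = stairL x j := by
  unfold stairT stairL
  have hx' : (0 : ℝ) < x := by exact_mod_cast hx
  rw [Real.log_div (ne_of_gt hx') (by positivity), Real.log_pow]

/-- `ℓ_j = ℓ_{j+1} + log 1.01`. [folklore] -/
private theorem stairL_succ (x j : ℕ) : stairL x j = stairL x (j + 1) + Real.log ((101 : ℝ) / 100) := by
  unfold stairL; push_cast; ring

/-- `ℓ_j` is non-increasing in `j`. [folklore] -/
private theorem stairL_le_of_le (x : ℕ) {i j : ℕ} (hij : i ≤ j) : stairL x j ≤ stairL x i := by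
  unfold stairL
  have : (i : ℝ) ≤ j := by exact_mod_cast hij
  nlinarith [log_101_pos]

/-- `ℓ_j ≥ log x − 0.01·j`. [folklore] -/
private theorem stairL_ge (x j : ℕ) : Real.log (x : ℝ) - 0.01 * j ≤ stairL x j := by
  unfold stairL
  have hj : (0 : ℝ) ≤ j := Nat.cast_nonneg j
  nlinarith [log_101_le]

/-- A downward-closed subset of `range J` is an initial segment. [folklore] -/
private theorem filter_range_eq_range_card {p : ℕ → Prop} [DecidablePred p]
    (hp : ∀ i j, i ≤ j → p j → p i) (J : ℕ) :
    (range J).filter p = range #((range J).filter p) := by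
  set S := (range J).filter p with hS
  ext j
  rw [mem_range]
  constructor
  · intro hj
    have hsub : range (j + 1) ⊆ S := by
      intro i hi
      rw [mem_range] at hi
      rw [hS, mem_filter, mem_range] at hj ⊢
      exact ⟨by omega, hp i j (by omega) hj.2⟩
    have := card_le_card hsub
    rw [card_range] at this
    omega
  · intro hj
    by_contra hjS
    have hsub : S ⊆ range j := by
      intro i hi
      rw [mem_range]
      by_contra hij
      rw [not_lt] at hij
      apply hjS
      rw [hS, mem_filter, mem_range] at hi ⊢
      exact ⟨by omega, hp j i hij hi.2⟩
    have := card_le_card hsub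
    rw [card_range] at this
    omega

/-- Telescoping: `Σ_{j<s} c_j = Mf(s)`. [folklore] -/
private theorem sum_range_stairC (x s : ℕ) : ∑ j ∈ range s, stairC x j = stairMf x s := by
  unfold stairC
  rw [Finset.sum_range_sub]
  simp [stairMf]

/-- **The staircase identification**: for `N ≤ x` there is a block index `k < J` with `m(N) = M_k`,
`N ≤ t_k`, and `t_{k+1} < N` unless `k + 1 = J`. [folklore] -/
private theorem stairW_eq {x J N : ℕ} (hJ : 0 < J) (hNx : (N : ℝ) ≤ x) :
    ∃ k, k < J ∧ stairW x J N = stairM x k ∧ (N : ℝ) ≤ stairT x k ∧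
      (k + 1 < J → stairT x (k + 1) < N) := by
  set S := (range J).filter (fun j => (N : ℝ) ≤ stairT x j) with hS
  have hSeq : S = range #S :=
    filter_range_eq_range_card (fun i j hij hj => hj.trans (stairT_le_of_le x hij)) J
  have h0 : 0 ∈ S := by
    rw [hS, mem_filter, mem_range, stairT_zero]
    exact ⟨hJ, hNx⟩
  obtain ⟨k, hk⟩ : ∃ k, #S = k + 1 := ⟨#S - 1, by have := card_pos.mpr ⟨0, h0⟩; omega⟩
  rw [hk] at hSeq
  have hmem : ∀ j, j ∈ S ↔ j < k + 1 := fun j => by rw [hSeq, mem_range]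
  have hkS : k ∈ S := (hmem k).mpr (by omega)
  have hkS' := hkS
  rw [hS, mem_filter, mem_range] at hkS'
  refine ⟨k, hkS'.1, ?_, hkS'.2, fun hk1 => ?_⟩
  · unfold stairW
    rw [← hS, hSeq, sum_range_stairC]
    rfl
  · by_contra hle
    rw [not_lt] at hle
    have h1 : k + 1 ∈ S := by
      rw [hS, mem_filter, mem_range]
      exact ⟨hk1, hle⟩
    have := (hmem _).mp h1
    omega

/-- `c_0 = M_0`. [folklore] -/
private theorem stairC_zero (x : ℕ) : stairC x 0 = stairM x 0 := by simp [stairC, stairMf]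

/-- `c_{j+1} = M_{j+1} − M_j`. [folklore] -/
private theorem stairC_succ (x j : ℕ) : stairC x (j + 1) = stairM x (j + 1) - stairM x j := by
  simp [stairC, stairMf]

/-- `M_j ≤ M_{j+1}` as soon as `ℓ_{j+2} ≥ 3`. [folklore] -/
private theorem stairM_mono {x : ℕ} (hx : 0 < x) {j : ℕ} (hℓ : 3 ≤ stairL x (j + 1 + 1)) :
    stairM x j ≤ stairM x (j + 1) := by
  unfold stairM
  have ht := stairT_pos hx (j + 1)
  rw [stairT_succ x j, div_le_div_iff₀ (by positivity) ht, stairL_succ x (j + 1)]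
  set l := stairL x (j + 1 + 1)
  set lam := Real.log ((101 : ℝ) / 100)
  have hlam := log_101_le
  have hlam0 := log_101_pos
  have h : (l + lam) ^ 2 ≤ 101 / 100 * l ^ 2 := by nlinarith
  nlinarith [mul_le_mul_of_nonneg_left h ht.le]

/-- `c_j ≥ 0` for `j < J` as soon as `ℓ_J ≥ 3`. [folklore] -/
private theorem stairC_nonneg {x : ℕ} (hx : 0 < x) {J j : ℕ} (hj : j < J) (hℓ : 3 ≤ stairL x J) :
    0 ≤ stairC x j := by
  cases j with
  | zero =>
      rw [stairC_zero]
      unfold stairM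
      exact div_nonneg (sq_nonneg _) (stairT_nonneg x 0)
  | succ i =>
      rw [stairC_succ, sub_nonneg]
      exact stairM_mono hx (hℓ.trans (stairL_le_of_le x (by omega)))

/-- **The swap**: `Σ_N r(N)·m(N) = Σ_j c_j·Σ_{N ≤ t_j} r(N)`. [folklore] -/
private theorem sum_mul_stairW (x J : ℕ) (E : Finset ℕ) (r : ℕ → ℝ) :
    ∑ N ∈ E, r N * stairW x J N
      = ∑ j ∈ range J, stairC x j * ∑ N ∈ E.filter (fun N : ℕ => (N : ℝ) ≤ stairT x j), r N := by
  unfold stairW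
  simp_rw [Finset.sum_filter, Finset.mul_sum]
  rw [Finset.sum_comm]
  refine sum_congr rfl fun j _ => sum_congr rfl fun N _ => ?_
  split_ifs <;> ring

/-- `{even N ≤ x : N ≤ t} = {even N ≤ ⌊t⌋}` for `0 ≤ t ≤ x`. [folklore] -/
private theorem filter_even_le_eq {x : ℕ} {t : ℝ} (ht0 : 0 ≤ t) (htx : t ≤ x) :
    ((range (x + 1)).filter Even).filter (fun N : ℕ => (N : ℝ) ≤ t) = (range (⌊t⌋₊ + 1)).filter Even := by
  ext N
  simp only [mem_filter, mem_range]
  constructor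
  · rintro ⟨⟨_, he⟩, hNt⟩
    exact ⟨by have := Nat.le_floor hNt; omega, he⟩
  · rintro ⟨hN, he⟩
    have hN' : N ≤ ⌊t⌋₊ := by omega
    have hNt : (N : ℝ) ≤ t := (Nat.le_floor_iff ht0).mp hN'
    have hNx : (N : ℝ) ≤ x := hNt.trans htx
    have hNx' : N ≤ x := by exact_mod_cast hNx
    exact ⟨⟨by omega, he⟩, hNt⟩

/-- **The level-`0` term**: `c_0·(x−1)²/ℓ_0² ≥ (1 − 0.01/Λ₀)²·(x − 2)` for `log x ≥ Λ₀ ≥ 1`. [folklore] -/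
private theorem stair_term_zero_ge {x : ℕ} (hx : 0 < x) {Λ₀ : ℝ} (hΛ₀ : 1 ≤ Λ₀) (hL : Λ₀ ≤ Real.log (x : ℝ)) :
    (1 - 0.01 / Λ₀) ^ 2 * ((x : ℝ) - 2)
      ≤ stairC x 0 * ((stairT x 0 - 1) ^ 2 / stairL x 0 ^ 2) := by
  rw [stairC_zero, stairT_zero]
  unfold stairM
  rw [stairT_zero]
  have hx' : (0 : ℝ) < x := by exact_mod_cast hx
  set L := Real.log (x : ℝ) with hL_def
  set lam := Real.log ((101 : ℝ) / 100)
  have hlam := log_101_le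
  have hlam0 := log_101_pos
  have hL0 : 0 < L := by linarith
  have hl0 : stairL x 0 = L := by simp [stairL, hL_def]
  have hl1 : stairL x (0 + 1) = L - lam := by simp [stairL, hL_def, lam]
  rw [hl0, hl1]
  -- `(L - lam)^2/x * ((x-1)^2/L^2) = ((L-lam)/L)^2 * ((x-1)^2/x) ≥ (1 - 0.01/Λ₀)^2 * (x - 2)`
  have h1 : 1 - 0.01 / Λ₀ ≤ (L - lam) / L := by
    rw [le_div_iff₀ hL0]
    have : lam ≤ 0.01 / Λ₀ * L := by
      have h2 : 0.01 / Λ₀ * Λ₀ = 0.01 := by field_simp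
      nlinarith [div_nonneg (by norm_num : (0:ℝ) ≤ 0.01) (by linarith : (0:ℝ) ≤ Λ₀)]
    nlinarith
  have h0 : 0 ≤ 1 - 0.01 / Λ₀ := by
    have : 0.01 / Λ₀ ≤ 0.01 / 1 := div_le_div_of_nonneg_left (by norm_num) (by norm_num) hΛ₀
    linarith
  have h2 : (1 - 0.01 / Λ₀) ^ 2 ≤ ((L - lam) / L) ^ 2 := pow_le_pow_left₀ h0 h1 2
  have h3 : (x : ℝ) - 2 ≤ ((x : ℝ) - 1) ^ 2 / x := by
    rw [le_div_iff₀ hx']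
    nlinarith
  have e : (L - lam) ^ 2 / (x : ℝ) * (((x : ℝ) - 1) ^ 2 / L ^ 2) = ((L - lam) / L) ^ 2 * (((x : ℝ) - 1) ^ 2 / x) := by
    rw [div_pow]
    field_simp
  rw [e]
  by_cases hx2 : (x : ℝ) - 2 ≤ 0
  · have : 0 ≤ ((L - lam) / L) ^ 2 * (((x : ℝ) - 1) ^ 2 / x) := by positivity
    nlinarith [sq_nonneg (1 - 0.01 / Λ₀)]
  · rw [not_le] at hx2
    exact mul_le_mul h2 h3 hx2.le (by positivity)

/-- **The level-`(k+1)` terms**: `c_{k+1}·(t_{k+1} − 1)²/ℓ_{k+1}² ≥ ((1 − 0.01/ℓ*)² − 100/101)·(t_{k+1} − 2)`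
whenever `3 ≤ ℓ* ≤ ℓ_{k+1}` and `t_{k+1} ≥ 2`. [folklore] -/
private theorem stair_term_succ_ge {x : ℕ} {ls : ℝ} (hls : 3 ≤ ls) {k : ℕ}
    (hℓ : ls ≤ stairL x (k + 1)) (ht2 : 2 ≤ stairT x (k + 1)) :
    ((1 - 0.01 / ls) ^ 2 - 100 / 101) * (stairT x (k + 1) - 2)
      ≤ stairC x (k + 1) * ((stairT x (k + 1) - 1) ^ 2 / stairL x (k + 1) ^ 2) := by
  rw [stairC_succ]
  unfold stairM
  rw [stairT_succ x k]
  set t := stairT x (k + 1) with ht_def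
  set l1 := stairL x (k + 1) with hl1_def
  set l2 := stairL x (k + 1 + 1) with hl2_def
  set lam := Real.log ((101 : ℝ) / 100)
  set β := (1 - 0.01 / ls) ^ 2 with hβ
  have hlam := log_101_le
  have hlam0 := log_101_pos
  have ht0 : 0 < t := by linarith
  have hls0 : 0 < ls := by linarith
  have hl10 : 0 < l1 := by linarith
  have hl12 : l1 = l2 + lam := stairL_succ x (k + 1)
  -- `(1 - 0.01/ls) * l1 ≤ l2`
  have hq : 0 ≤ 1 - 0.01 / ls := by
    have : 0.01 / ls ≤ 0.01 / 3 := div_le_div_of_nonneg_left (by norm_num) (by norm_num) hls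
    linarith
  have hge : (1 - 0.01 / ls) * l1 ≤ l2 := by
    have e1 : (1 - 0.01 / ls) * l1 = l1 - 0.01 * (l1 / ls) := by ring
    have h2 : 1 ≤ l1 / ls := by rw [le_div_iff₀ hls0]; linarith
    rw [e1]
    nlinarith
  have hsq : β * l1 ^ 2 ≤ l2 ^ 2 := by
    have h0 : 0 ≤ (1 - 0.01 / ls) * l1 := mul_nonneg hq hl10.le
    calc β * l1 ^ 2 = ((1 - 0.01 / ls) * l1) ^ 2 := by rw [hβ]; ring
      _ ≤ l2 ^ 2 := pow_le_pow_left₀ h0 hge 2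
  have hδ0 : 0 ≤ β - 100 / 101 := by
    have : 0.01 / ls ≤ 0.01 / 3 := div_le_div_of_nonneg_left (by norm_num) (by norm_num) hls
    rw [hβ]
    nlinarith
  -- the algebra
  have e1 : (l2 ^ 2 / t - l1 ^ 2 / (101 / 100 * t)) * ((t - 1) ^ 2 / l1 ^ 2)
      = (l2 ^ 2 - 100 / 101 * l1 ^ 2) * (t - 1) ^ 2 / (t * l1 ^ 2) := by
    field_simp
  have h2 : (β * l1 ^ 2 - 100 / 101 * l1 ^ 2) * (t - 1) ^ 2 / (t * l1 ^ 2)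
      ≤ (l2 ^ 2 - 100 / 101 * l1 ^ 2) * (t - 1) ^ 2 / (t * l1 ^ 2) := by
    apply div_le_div_of_nonneg_right _ (by positivity)
    exact mul_le_mul_of_nonneg_right (by linarith) (sq_nonneg _)
  have e3 : (β * l1 ^ 2 - 100 / 101 * l1 ^ 2) * (t - 1) ^ 2 / (t * l1 ^ 2) = (β - 100 / 101) * ((t - 1) ^ 2 / t) := by
    field_simp
  have h4 : (β - 100 / 101) * (t - 2) ≤ (β - 100 / 101) * ((t - 1) ^ 2 / t) := by
    apply mul_le_mul_of_nonneg_left _ hδ0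
    rw [le_div_iff₀ ht0]
    nlinarith
  rw [e1]
  linarith [h2, e3, h4]

/-- The geometric sum `Σ_{k<n} (100/101)^{k+1} = 100·(1 − (100/101)^n)`. [folklore] -/
private theorem geom_sum_101 (n : ℕ) :
    ∑ k ∈ range n, ((100 : ℝ) / 101) ^ (k + 1) = 100 * (1 - ((100 : ℝ) / 101) ^ n) := by
  induction n with
  | zero => simp
  | succ n ih => rw [sum_range_succ, ih, pow_succ]; ring

/-- The staircase weight is non-negative. [folklore] -/
private theorem stairW_nonneg {x : ℕ} (hx : 0 < x) {J : ℕ} (hℓ : 3 ≤ stairL x J) (N : ℕ) : 0 ≤ stairW x J N := by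
  unfold stairW
  refine sum_nonneg fun j hj => ?_
  rw [mem_filter, mem_range] at hj
  exact stairC_nonneg hx hj.1 hℓ

/-- `(Σ_T u)² ≤ |T|·Σ_T u²`. [folklore] -/
private theorem sq_sum_le_card_mul_sum_sq' (T : Finset ℕ) (u : ℕ → ℝ) :
    (∑ N ∈ T, u N) ^ 2 ≤ (#T : ℝ) * ∑ N ∈ T, u N ^ 2 := by
  have h := sum_mul_sq_le_sq_mul_sq T u (fun _ => (1 : ℝ))
  simp only [mul_one, one_pow, sum_const, nsmul_eq_mul] at h
  linarith

/-- **Hölder, exponent 8**: `(Σ_T u)⁸ ≤ |T|⁷·Σ_T u⁸` for `u ≥ 0` on `T`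
(`(Σu)² ≤ n·Σu²`, `(Σu²)² ≤ n·Σu⁴`, `(Σu⁴)² ≤ n·Σu⁸`). [folklore] -/
private theorem pow8_sum_le (T : Finset ℕ) (u : ℕ → ℝ) (hu : ∀ N ∈ T, 0 ≤ u N) :
    (∑ N ∈ T, u N) ^ 8 ≤ (#T : ℝ) ^ 7 * ∑ N ∈ T, u N ^ 8 := by
  set n : ℝ := (#T : ℝ) with hn
  have hn0 : 0 ≤ n := by positivity
  have hS1 : 0 ≤ ∑ N ∈ T, u N := sum_nonneg hu
  have hS2 : 0 ≤ ∑ N ∈ T, u N ^ 2 := sum_nonneg fun N _ => by positivity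
  have hS4 : 0 ≤ ∑ N ∈ T, u N ^ 4 := sum_nonneg fun N _ => by positivity
  have h1 : (∑ N ∈ T, u N) ^ 2 ≤ n * ∑ N ∈ T, u N ^ 2 := sq_sum_le_card_mul_sum_sq' T u
  have h2 : (∑ N ∈ T, u N ^ 2) ^ 2 ≤ n * ∑ N ∈ T, u N ^ 4 := by
    have h := sq_sum_le_card_mul_sum_sq' T (fun N => u N ^ 2)
    have e : ∑ N ∈ T, (u N ^ 2) ^ 2 = ∑ N ∈ T, u N ^ 4 := sum_congr rfl fun N _ => by ring
    rw [e] at h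
    exact h
  have h3 : (∑ N ∈ T, u N ^ 4) ^ 2 ≤ n * ∑ N ∈ T, u N ^ 8 := by
    have h := sq_sum_le_card_mul_sum_sq' T (fun N => u N ^ 4)
    have e : ∑ N ∈ T, (u N ^ 4) ^ 2 = ∑ N ∈ T, u N ^ 8 := sum_congr rfl fun N _ => by ring
    rw [e] at h
    exact h
  have h1' : ((∑ N ∈ T, u N) ^ 2) ^ 4 ≤ (n * ∑ N ∈ T, u N ^ 2) ^ 4 :=
    pow_le_pow_left₀ (sq_nonneg _) h1 4
  have h2' : (∑ N ∈ T, u N ^ 2) ^ 4 ≤ (n * ∑ N ∈ T, u N ^ 4) ^ 2 := by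
    have := pow_le_pow_left₀ (sq_nonneg _) h2 2
    calc (∑ N ∈ T, u N ^ 2) ^ 4 = ((∑ N ∈ T, u N ^ 2) ^ 2) ^ 2 := by ring
      _ ≤ _ := this
  calc (∑ N ∈ T, u N) ^ 8 = ((∑ N ∈ T, u N) ^ 2) ^ 4 := by ring
    _ ≤ (n * ∑ N ∈ T, u N ^ 2) ^ 4 := h1'
    _ = n ^ 4 * (∑ N ∈ T, u N ^ 2) ^ 4 := by ring
    _ ≤ n ^ 4 * (n * ∑ N ∈ T, u N ^ 4) ^ 2 := mul_le_mul_of_nonneg_left h2' (by positivity)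
    _ = n ^ 6 * (∑ N ∈ T, u N ^ 4) ^ 2 := by ring
    _ ≤ n ^ 6 * (n * ∑ N ∈ T, u N ^ 8) := mul_le_mul_of_nonneg_left h3 (by positivity)
    _ = n ^ 7 * ∑ N ∈ T, u N ^ 8 := by ring

/-- `2⁵⁹ ≤ e⁴¹`. [folklore] -/
private theorem two_pow_59_le_exp_41 : (2 : ℝ) ^ 59 ≤ Real.exp 41 := by
  have he : (2.718281828 : ℝ) ≤ Real.exp 1 := by have := Real.exp_one_gt_d9; linarith
  have h := pow_le_pow_left₀ (by norm_num) he 41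
  rw [← Real.exp_nat_mul] at h
  norm_num at h
  exact le_trans (by norm_num) h

/-- `e¹³ ≥ 442000`. [folklore] -/
private theorem exp_13_ge : (442000 : ℝ) ≤ Real.exp 13 := by
  have he : (2.718281828 : ℝ) ≤ Real.exp 1 := by have := Real.exp_one_gt_d9; linarith
  have h := pow_le_pow_left₀ (by norm_num) he 13
  rw [← Real.exp_nat_mul] at h
  norm_num at h
  exact le_trans (by norm_num) h

/-- **First moment, `0.4243`, from `e^41`**: `Σ_{N ≤ x} r(N) ≥ 0.4243·x²/log²x` for `x ≥ e^41`. [folklore] -/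
private theorem sum_goldbachCount_ge_04243' {x : ℕ} (hx : Real.exp 41 ≤ (x : ℝ)) :
    0.4243 * ((x : ℝ) ^ 2 / Real.log x ^ 2) ≤ ∑ N ∈ range (x + 1), (SingularSeries.goldbachCount N : ℝ) := by
  have hbig : (2 : ℝ) ^ 59 ≤ x := two_pow_59_le_exp_41.trans hx
  have h59 : (2000000 : ℝ) ≤ (2 : ℝ) ^ 59 := by norm_num
  have hx2 : 2 * 10 ^ 6 ≤ x := by
    have : ((2 * 10 ^ 6 : ℕ) : ℝ) ≤ x := by push_cast; linarith
    exact_mod_cast this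
  have h := sum_goldbachCount_ge_of_lower (by norm_num) (by norm_num) primeCountingLowerMul_09212 hx2
  have e : ((10 ^ 6 : ℕ) : ℝ) = (10 : ℝ) ^ 6 := by norm_num
  rw [e] at h
  refine le_trans ?_ h
  have hx1 : (1 : ℝ) < x := by linarith
  have hL : 0 < Real.log x := Real.log_pos hx1
  have hL2 : 0 < 2 * Real.log x ^ 2 := by positivity
  have hxn : (0 : ℝ) ≤ x := by linarith
  have key : 0.4243 * (x : ℝ) ^ 2 * 2 ≤ 0.9212 ^ 2 * (((x : ℝ) - (10 : ℝ) ^ 6) ^ 2 - ((10 : ℝ) ^ 6) ^ 2) := by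
    nlinarith [mul_le_mul_of_nonneg_right hbig hxn]
  calc 0.4243 * ((x : ℝ) ^ 2 / Real.log x ^ 2) = (0.4243 * (x : ℝ) ^ 2 * 2) / (2 * Real.log x ^ 2) := by
        field_simp
    _ ≤ 0.9212 ^ 2 * (((x : ℝ) - (10 : ℝ) ^ 6) ^ 2 - ((10 : ℝ) ^ 6) ^ 2) / (2 * Real.log x ^ 2) :=
        div_le_div_of_nonneg_right key hL2.le
    _ = 0.9212 ^ 2 * ((((x : ℝ) - (10 : ℝ) ^ 6) ^ 2 - ((10 : ℝ) ^ 6) ^ 2) / (2 * Real.log x ^ 2)) := by ring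

/-- `2(x + 1) ≤ 10⁻⁴·x²/log²x` for `x ≥ e^41` (`log²x ≤ 2.4367√x`, `√x ≥ 2^29`). [folklore] -/
private theorem two_mul_succ_le_small41 {x : ℕ} (hx : Real.exp 41 ≤ (x : ℝ)) :
    2 * ((x : ℝ) + 1) ≤ 0.0001 * ((x : ℝ) ^ 2 / Real.log x ^ 2) := by
  have hx1 : (1 : ℝ) < x := lt_of_lt_of_le (by have := Real.add_one_le_exp (41 : ℝ); linarith) hx
  have hx0 : (0 : ℝ) < x := by linarith
  set L := Real.log x with hL
  have hL41 : 41 ≤ L := by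
    have := Real.log_le_log (Real.exp_pos 41) hx
    rwa [Real.log_exp] at this
  have hLpos : 0 < L ^ 2 := by positivity
  have hL4 : L ^ 4 ≤ 4096 * Real.sqrt x := log_pow_four_le_sqrt hx1.le
  have hLsq : (1681 : ℝ) ≤ L ^ 2 := by nlinarith
  have hL2 : L ^ 2 ≤ 2.4367 * Real.sqrt x := by
    have e : L ^ 4 = L ^ 2 * L ^ 2 := by ring
    nlinarith [Real.sqrt_nonneg (x : ℝ)]
  have hbig : (2 : ℝ) ^ 59 ≤ x := two_pow_59_le_exp_41.trans hx
  have hsx : (2 : ℝ) ^ 29 ≤ Real.sqrt x :=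
    Real.le_sqrt_of_sq_le (by
      rw [show ((2 : ℝ) ^ 29) ^ 2 = (2 : ℝ) ^ 58 by norm_num]
      exact le_trans (by norm_num) hbig)
  have hxx : Real.sqrt x * Real.sqrt x = x := Real.mul_self_sqrt hx0.le
  have key : 2 * ((x : ℝ) + 1) * L ^ 2 ≤ 0.0001 * (x : ℝ) ^ 2 := by
    have h1 : 2 * ((x : ℝ) + 1) * L ^ 2 ≤ 4 * x * (2.4367 * Real.sqrt x) := by
      have : 2 * ((x : ℝ) + 1) ≤ 4 * x := by linarith
      exact mul_le_mul this hL2 (by positivity) (by positivity)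
    have h2 : (1 : ℝ) ≤ Real.sqrt x / 2 ^ 29 := by
      rw [le_div_iff₀ (by positivity)]; linarith
    calc 2 * ((x : ℝ) + 1) * L ^ 2 ≤ 4 * x * (2.4367 * Real.sqrt x) := h1
      _ ≤ 4 * x * (2.4367 * Real.sqrt x) * (Real.sqrt x / 2 ^ 29) :=
          le_mul_of_one_le_right (by positivity) h2
      _ = (9.7468 / 2 ^ 29) * (x * (Real.sqrt x * Real.sqrt x)) := by ring
      _ = (9.7468 / 2 ^ 29) * (x : ℝ) ^ 2 := by rw [hxx]; ring
      _ ≤ 0.0001 * (x : ℝ) ^ 2 := mul_le_mul_of_nonneg_right (by norm_num) (by positivity)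
  calc 2 * ((x : ℝ) + 1) = 2 * ((x : ℝ) + 1) * L ^ 2 / L ^ 2 := by field_simp
    _ ≤ 0.0001 * (x : ℝ) ^ 2 / L ^ 2 := div_le_div_of_nonneg_right key hLpos.le
    _ = _ := by ring

/-- **First moment over even `N`, threshold `e^{Λs}`, `Λs ≥ 41`**: `S₁^{ev}(x) ≥ (c₁ − 10⁻⁴)·x²/log²x`. [folklore] -/
private theorem sum_even_goldbachCount_ge' {c₁ Λs : ℝ} (hΛs : 41 ≤ Λs) {x : ℕ} (hx : Real.exp Λs ≤ (x : ℝ))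
    (hS₁ : c₁ * ((x : ℝ) ^ 2 / Real.log x ^ 2) ≤ ∑ N ∈ range (x + 1), (SingularSeries.goldbachCount N : ℝ)) :
    (c₁ - 0.0001) * ((x : ℝ) ^ 2 / Real.log x ^ 2)
      ≤ ∑ N ∈ (range (x + 1)).filter Even, (SingularSeries.goldbachCount N : ℝ) := by
  have hsplit := sum_filter_add_sum_filter_not (range (x + 1)) Even
    (fun N => (SingularSeries.goldbachCount N : ℝ))
  have hodd := sum_goldbachCount_odd_le x
  have hsmall := two_mul_succ_le_small41 (((Real.exp_le_exp.mpr hΛs)).trans hx)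
  have e : (c₁ - 0.0001) * ((x : ℝ) ^ 2 / Real.log x ^ 2)
      = c₁ * ((x : ℝ) ^ 2 / Real.log x ^ 2) - 0.0001 * ((x : ℝ) ^ 2 / Real.log x ^ 2) := by ring
  rw [e]
  linarith

/-- **One level of the lower side, threshold `e^{Λs}`**: `Σ_{even N ≤ t_j} r(N) ≥ (c₁ − 10⁻⁴)·(t_j − 1)²/ℓ_j²`
when `t_j ≥ e^{Λs} + 1`. [folklore] -/
private theorem level_lower' {c₁ Λs : ℝ} (hΛs : 41 ≤ Λs)
    (hS₁ : ∀ y : ℕ, Real.exp Λs ≤ (y : ℝ) →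
      c₁ * ((y : ℝ) ^ 2 / Real.log y ^ 2) ≤ ∑ N ∈ range (y + 1), (SingularSeries.goldbachCount N : ℝ))
    (hc₁ : 0.0001 ≤ c₁) {x j : ℕ} (hx : 0 < x) (ht : Real.exp Λs + 1 ≤ stairT x j) :
    (c₁ - 0.0001) * ((stairT x j - 1) ^ 2 / stairL x j ^ 2)
      ≤ ∑ N ∈ ((range (x + 1)).filter Even).filter (fun N : ℕ => (N : ℝ) ≤ stairT x j),
          (SingularSeries.goldbachCount N : ℝ) := by
  set t := stairT x j with ht_def
  have heΛ : (1 : ℝ) < Real.exp Λs := by have := Real.add_one_le_exp Λs; linarith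
  have ht0 : 0 ≤ t := by linarith
  set y := ⌊t⌋₊ with hy_def
  have hy1 : t - 1 ≤ y := (Nat.sub_one_lt_floor t).le
  have hyt : (y : ℝ) ≤ t := Nat.floor_le ht0
  have hy : Real.exp Λs ≤ (y : ℝ) := by linarith
  have hy0 : (1 : ℝ) < y := by linarith
  rw [filter_even_le_eq ht0 (stairT_le_self x j)]
  have h := sum_even_goldbachCount_ge' hΛs hy (hS₁ y hy)
  refine le_trans ?_ h
  apply mul_le_mul_of_nonneg_left _ (by linarith)
  have hlogy : 0 < Real.log y := Real.log_pos hy0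
  have hlogle : Real.log y ≤ stairL x j := by
    rw [← log_stairT hx]
    exact Real.log_le_log (by linarith) hyt
  calc (t - 1) ^ 2 / stairL x j ^ 2 ≤ (y : ℝ) ^ 2 / stairL x j ^ 2 :=
        div_le_div_of_nonneg_right (pow_le_pow_left₀ (by linarith) hy1 2) (by positivity)
    _ ≤ (y : ℝ) ^ 2 / Real.log y ^ 2 :=
        div_le_div_of_nonneg_left (by positivity) (by positivity) (pow_le_pow_left₀ hlogy.le hlogle 2)

/-- `(100/101)¹⁹⁹ ≤ 1/7`. [folklore] -/
private theorem q_pow_199_le : ((100 : ℝ) / 101) ^ 199 ≤ 1 / 7 := by norm_num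

/-- **The lower side, summed over `J = 200` levels**: `Σ_{j<200} c_j·(t_j − 1)²/ℓ_j² ≥ gHol(Λ₀)·x − 21`
for `log x ≥ Λ₀ ≥ 44`. [folklore] -/
private theorem stair_lower_sum_ge200 {x : ℕ} (hx : 0 < x) {Λ₀ : ℝ} (hΛ₀ : 44 ≤ Λ₀) (hL : Λ₀ ≤ Real.log (x : ℝ))
    (hx2 : (2 : ℝ) ≤ stairT x 200) :
    gHol Λ₀ * (x : ℝ) - 21 ≤ ∑ j ∈ range 200, stairC x j * ((stairT x j - 1) ^ 2 / stairL x j ^ 2) := by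
  rw [sum_range_succ']
  set ls := Λ₀ - 2 with hls_def
  have hls3 : 3 ≤ ls := by linarith
  set δ := (1 - 0.01 / ls) ^ 2 - 100 / 101 with hδ_def
  have hδ0 : 0 ≤ δ := by
    have : 0.01 / ls ≤ 0.01 / 3 := div_le_div_of_nonneg_left (by norm_num) (by norm_num) hls3
    rw [hδ_def]
    nlinarith
  have hδ1 : δ ≤ 0.01 := by
    have h0 : 0 ≤ 0.01 / ls := by positivity
    have : 0.01 / ls ≤ 0.01 / 3 := div_le_div_of_nonneg_left (by norm_num) (by norm_num) hls3
    rw [hδ_def]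
    nlinarith
  -- the terms `k+1`, `k < 199`
  have hterm : ∀ k ∈ range 199, δ * (stairT x (k + 1) - 2)
      ≤ stairC x (k + 1) * ((stairT x (k + 1) - 1) ^ 2 / stairL x (k + 1) ^ 2) := by
    intro k hk
    rw [mem_range] at hk
    apply stair_term_succ_ge hls3
    · have h1 := stairL_le_of_le x (show k + 1 ≤ 200 by omega)
      have h2 := stairL_ge x 200
      have : ls ≤ Real.log (x : ℝ) - 0.01 * ((200 : ℕ) : ℝ) := by push_cast; linarith
      linarith
    · exact hx2.trans (stairT_le_of_le x (by omega))
  have hsum1 : δ * ((x : ℝ) * (100 * (1 - ((100 : ℝ) / 101) ^ 199)) - 2 * 199)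
      ≤ ∑ k ∈ range 199, stairC x (k + 1) * ((stairT x (k + 1) - 1) ^ 2 / stairL x (k + 1) ^ 2) := by
    have h := sum_le_sum hterm
    have e : ∑ k ∈ range 199, δ * (stairT x (k + 1) - 2)
        = δ * ((x : ℝ) * (100 * (1 - ((100 : ℝ) / 101) ^ 199)) - 2 * 199) := by
      rw [← mul_sum, sum_sub_distrib, sum_const, card_range, ← geom_sum_101, mul_sum]
      simp only [stairT_eq_mul_pow, nsmul_eq_mul]
      push_cast
      ring
    rw [← e]
    exact h
  have hterm0 := stair_term_zero_ge hx (by linarith : (1 : ℝ) ≤ Λ₀) hL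
  have hq199 : ((100 : ℝ) / 101) ^ 199 ≤ 1 / 7 := q_pow_199_le
  have hx' : (0 : ℝ) < x := by exact_mod_cast hx
  generalize hQ : ((100 : ℝ) / 101) ^ 199 = Q at hq199 hsum1
  clear hQ
  have hmain : gHol Λ₀ * (x : ℝ) - 21
      ≤ (1 - 0.01 / Λ₀) ^ 2 * ((x : ℝ) - 2)
        + δ * ((x : ℝ) * (100 * (1 - Q)) - 2 * 199) := by
    have hS : 85.71 ≤ 100 * (1 - Q) := by linarith [hq199]
    have h1 : 85.71 * (x : ℝ) ≤ (x : ℝ) * (100 * (1 - Q)) := by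
      nlinarith [mul_le_mul_of_nonneg_left hS hx'.le]
    have h2 : (1 - 0.01 / Λ₀) ^ 2 ≤ 1 := by
      have h0 : 0 ≤ 0.01 / Λ₀ := by positivity
      have : 0.01 / Λ₀ ≤ 0.01 / 44 := div_le_div_of_nonneg_left (by norm_num) (by norm_num) hΛ₀
      nlinarith
    have hA : (1 - 0.01 / Λ₀) ^ 2 * (x : ℝ) - 2 ≤ (1 - 0.01 / Λ₀) ^ 2 * ((x : ℝ) - 2) := by
      nlinarith [sq_nonneg (1 - 0.01 / Λ₀)]
    have hB : 85.71 * δ * (x : ℝ) - 19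
        ≤ δ * ((x : ℝ) * (100 * (1 - Q)) - 2 * 199) := by
      have h3 := mul_le_mul_of_nonneg_left h1 hδ0
      nlinarith [hδ1]
    have e : gHol Λ₀ * (x : ℝ) = (1 - 0.01 / Λ₀) ^ 2 * (x : ℝ) + 85.71 * δ * (x : ℝ) := by
      unfold gHol
      rw [← hls_def, ← hδ_def]
      ring
    linarith [hA, hB, e]
  linarith [hmain, hterm0, hsum1]

/-- `m(N) ≤ M_{J−1} = Σ_{j<J} c_j` (all increments are `≥ 0`). [folklore] -/
private theorem stairW_le_stairMf {x : ℕ} (hx : 0 < x) {J : ℕ} (hℓ : 3 ≤ stairL x J) (N : ℕ) :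
    stairW x J N ≤ stairMf x J := by
  unfold stairW
  rw [← sum_range_stairC x J]
  exact sum_le_sum_of_subset_of_nonneg (filter_subset _ _) fun j hj _ => stairC_nonneg hx (mem_range.mp hj) hℓ

/-- **Main blocks, `J = 200`**: for even `N` with `t_{200} < N ≤ x`, `r(N)·m(N) ≤ A·f(N)`. [folklore] -/
private theorem stair_rm_le_main200 {x : ℕ} (hx : 0 < x) {Λ A : ℝ} (hΛ0 : 0 < Λ) (hA : 0 ≤ A)
    (hpt : ∀ N : ℕ, Real.exp Λ ≤ (N : ℝ) → Even N →
      (SingularSeries.goldbachCount N : ℝ) ≤ A * oddSingularFactor N * (N : ℝ) / Real.log (N : ℝ) ^ 2)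
    (hbot : Real.exp Λ ≤ stairT x 200) {N : ℕ} (heven : Even N) (hNx : (N : ℝ) ≤ x)
    (hNt : stairT x 200 < N) :
    (SingularSeries.goldbachCount N : ℝ) * stairW x 200 N ≤ A * oddSingularFactor N := by
  obtain ⟨k, hk, hW, hNk, hnext⟩ := stairW_eq (x := x) (J := 200) (N := N) (by norm_num) hNx
  have htk1 : stairT x (k + 1) < N := by
    by_cases h : k + 1 < 200
    · exact hnext h
    · have : k + 1 = 200 := by omega
      rw [this]; exact hNt
  have hNΛ : Real.exp Λ ≤ (N : ℝ) := hbot.trans hNt.le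
  have hN1 : (1 : ℝ) < N := lt_of_lt_of_le (by have := Real.add_one_le_exp Λ; linarith) hNΛ
  have hlogN : 0 < Real.log (N : ℝ) := Real.log_pos hN1
  have hr := hpt N hNΛ heven
  have hf := oddSingularFactor_nonneg N
  have hΛℓ : Λ ≤ stairL x 200 := by
    rw [← log_stairT hx]
    have := Real.log_le_log (Real.exp_pos Λ) hbot
    rwa [Real.log_exp] at this
  have hl0 : 0 ≤ stairL x (k + 1) := (hΛ0.le.trans hΛℓ).trans (stairL_le_of_le x (by omega))
  have hl : stairL x (k + 1) ≤ Real.log (N : ℝ) := by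
    rw [← log_stairT hx]
    exact Real.log_le_log (stairT_pos hx _) htk1.le
  have h1 : stairL x (k + 1) ^ 2 ≤ Real.log (N : ℝ) ^ 2 := pow_le_pow_left₀ hl0 hl 2
  have htk : 0 < stairT x k := stairT_pos hx k
  have hN0 : (0 : ℝ) < N := by linarith
  rw [hW]
  unfold stairM
  calc (SingularSeries.goldbachCount N : ℝ) * (stairL x (k + 1) ^ 2 / stairT x k)
      ≤ A * oddSingularFactor N * (N : ℝ) / Real.log (N : ℝ) ^ 2 * (stairL x (k + 1) ^ 2 / stairT x k) :=
        mul_le_mul_of_nonneg_right hr (div_nonneg (sq_nonneg _) htk.le)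
    _ = A * oddSingularFactor N * (((N : ℝ) / stairT x k) * (stairL x (k + 1) ^ 2 / Real.log (N : ℝ) ^ 2)) := by
        field_simp
    _ ≤ A * oddSingularFactor N * 1 := by
        apply mul_le_mul_of_nonneg_left _ (mul_nonneg hA hf)
        exact mul_le_one₀ ((div_le_one htk).mpr hNk) (div_nonneg (sq_nonneg _) (sq_nonneg _))
          ((div_le_one (pow_pos hlogN 2)).mpr h1)
    _ = A * oddSingularFactor N := mul_one _

/-- **The bottom segment, `J = 200`**: for even `e^Λ ≤ N ≤ t_{200}`, `r(N)·m(N) ≤ A·f(N)`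
(`m(N) = ℓ_{200}²/t_{199}`, `N/log²N ≤ t_{200}/ℓ_{200}²`, `t_{200} ≤ t_{199}`). [folklore] -/
private theorem stair_rm_le_bottom200 {x : ℕ} (hx : 0 < x) {Λ A : ℝ} (hΛ2 : 2 ≤ Λ) (hA : 0 ≤ A)
    (hpt : ∀ N : ℕ, Real.exp Λ ≤ (N : ℝ) → Even N →
      (SingularSeries.goldbachCount N : ℝ) ≤ A * oddSingularFactor N * (N : ℝ) / Real.log (N : ℝ) ^ 2)
    {N : ℕ} (heven : Even N) (hNΛ : Real.exp Λ ≤ (N : ℝ)) (hNt : (N : ℝ) ≤ stairT x 200) :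
    (SingularSeries.goldbachCount N : ℝ) * stairW x 200 N ≤ A * oddSingularFactor N := by
  have hNx : (N : ℝ) ≤ x := hNt.trans (stairT_le_self x 200)
  obtain ⟨k, hk, hW, hNk, hnext⟩ := stairW_eq (x := x) (J := 200) (N := N) (by norm_num) hNx
  have hk199 : k = 199 := by
    by_contra hne
    have hlt : k + 1 < 200 := by omega
    have h1 := hnext hlt
    have h2 := stairT_le_of_le x (show k + 1 ≤ 200 by omega)
    linarith
  subst hk199
  rw [hW]
  unfold stairM
  have ht199 := stairT_pos hx 199
  have ht200 := stairT_pos hx 200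
  have hℓ : Real.log (stairT x 200) = stairL x (199 + 1) := log_stairT hx 200
  have hr := hpt N hNΛ heven
  have he2 : Real.exp 2 ≤ (N : ℝ) := le_trans (Real.exp_le_exp.mpr hΛ2) hNΛ
  have hmono := div_log_sq_mono he2 hNt
  rw [hℓ] at hmono
  have hN1 : (1 : ℝ) < N := lt_of_lt_of_le (by have := Real.add_one_le_exp (2 : ℝ); linarith) he2
  have hlogN : 0 < Real.log (N : ℝ) := Real.log_pos hN1
  have hf := oddSingularFactor_nonneg N
  calc (SingularSeries.goldbachCount N : ℝ) * (stairL x (199 + 1) ^ 2 / stairT x 199)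
      ≤ A * oddSingularFactor N * (N : ℝ) / Real.log (N : ℝ) ^ 2 * (stairL x (199 + 1) ^ 2 / stairT x 199) :=
        mul_le_mul_of_nonneg_right hr (div_nonneg (sq_nonneg _) ht199.le)
    _ = A * oddSingularFactor N * ((N : ℝ) / Real.log (N : ℝ) ^ 2) * (stairL x (199 + 1) ^ 2 / stairT x 199) := by
        ring
    _ ≤ A * oddSingularFactor N * (stairT x 200 / stairL x (199 + 1) ^ 2)
          * (stairL x (199 + 1) ^ 2 / stairT x 199) :=
        mul_le_mul_of_nonneg_right (mul_le_mul_of_nonneg_left hmono (mul_nonneg hA hf))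
          (div_nonneg (sq_nonneg _) ht199.le)
    _ ≤ A * oddSingularFactor N * 1 := by
        rw [mul_assoc (A * oddSingularFactor N)]
        apply mul_le_mul_of_nonneg_left _ (mul_nonneg hA hf)
        have hℓ0 : 0 < stairL x (199 + 1) := by
          rw [← hℓ]
          have h1 := Real.log_le_log (by positivity) (hNΛ.trans hNt)
          have h2 : Real.log (N : ℝ) ≤ Real.log (stairT x 200) := Real.log_le_log (by linarith) hNt
          linarith
        calc stairT x 200 / stairL x (199 + 1) ^ 2 * (stairL x (199 + 1) ^ 2 / stairT x 199)
            = stairT x 200 / stairT x 199 := by field_simp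
          _ ≤ 1 := (div_le_one ht199).mpr (stairT_le_of_le x (by norm_num))
    _ = A * oddSingularFactor N := mul_one _

/-- `((2y − 3 : ℕ) : ℝ) = 2y − 3` for `y ≥ 2`. [folklore] -/
private theorem cast_two_mul_sub_three {y : ℕ} (hy : 2 ≤ y) : ((2 * y - 3 : ℕ) : ℝ) = 2 * (y : ℝ) - 3 := by
  have h3y : 3 ≤ 2 * y := by omega
  rw [Nat.cast_sub h3y]
  push_cast
  ring

/-- `log n ≤ 14` for `n < 10⁶` (`10⁶ ≤ 2.7¹⁴ ≤ e¹⁴`). [folklore] -/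
private theorem log_le_14_of_lt {n : ℕ} (hn0 : 0 < n) (h6 : n < 10 ^ 6) : Real.log (n : ℝ) ≤ 14 := by
  have hn0' : (0 : ℝ) < n := by exact_mod_cast hn0
  have hy6 : (n : ℝ) ≤ (2.7 : ℝ) ^ 14 := by
    have : (n : ℝ) < 10 ^ 6 := by exact_mod_cast h6
    have h27 : (10 : ℝ) ^ 6 ≤ (2.7 : ℝ) ^ 14 := by norm_num
    linarith
  have he : (2.7 : ℝ) ≤ Real.exp 1 := by have := Real.exp_one_gt_d9; linarith
  have h14 : (2.7 : ℝ) ^ 14 ≤ Real.exp 14 := by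
    rw [show (14 : ℝ) = ((14 : ℕ) : ℝ) * 1 by norm_num, Real.exp_nat_mul]
    exact pow_le_pow_left₀ (by norm_num) he 14
  have := Real.log_le_log hn0' (hy6.trans h14)
  rwa [Real.log_exp] at this

/-! ## §16 ROUND-31 «BONFERRONI»: four shifts `q ∈ {3, 5, 7, 11}` with inclusion–exclusion in the all-`y` glue —
`K = 65` (RS: `55`)

The near-miss of §15 is again its GLUE, now through the CEILING it puts on the count threshold: one shift gives
`B(y) ≥ π(2y−3) + 1 ≈ 1.8424·y/log(2y)`, which is `≥ y/h` only while `log(2y) ≤ 1.8424·h`, so the count must start at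
`Λ₀ ≤ 1.8424·h ≈ 70`; with the trivial discard (`2Λs ≤ Λ₀ + 36.5`) the sieve threshold is then `Λs ≤ 53`, where the
tree's sieve constant is `A(53) = 16.5` against `A(114) = 14.6` and `A(∞) = 13.2`.  ONE INPUT VARIED: the glue uses
FOUR shifted copies of the primes, `S_q(y) = {(p+q)/2 : p odd prime ≤ 2y − q}` for `q ∈ {3,5,7,11}` (`#S_q = π(2y−q) − 1`,
`S_q ⊆ (0,y] ∩ B`, `1, 2 ∉ S_q`), and the two-term Bonferroni inequality
`#(S₃ ∪ S₅ ∪ S₇ ∪ S₁₁) ≥ Σ #S_q − Σ_{q<q'} #(S_q ∩ S_{q'})`, where `S_q ∩ S_{q'}` is counted by the prime pairs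
`(p, p + (q'−q))`, `p ≤ 2y`, which the tree's PROVED explicit pair sieve bounds by `17.75·f(q'−q)·2y/log²(2y)` above
`e^41` (`TwoResidueSelbergExplicit.pairCount_le_kappa`; differences `2,4,8,2,6,4`, `f = 1,1,1,1,2,1`, total weight `7`):
`B(y) ≥ (7.3696·y − 24)/L − 2 − 248.5·y/L²`, `L = log 2y`, which is `≥ y/h` as long as `L² + h ≤ h·(7.3696·L − 248.5)` —
for `h = 32` up to `L = 194`.  The count threshold moves to `Λ₀ = 192`, the sieve threshold to `Λs = 114` (`A = 14.6`),
and §15's generic Hölder count gives `x/64` even Goldbach numbers above `e^192`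
(`(1/64)⁷·259.55·14.6⁸ = 0.121 ≤ (0.4242·gHol 192 − 0.0057)⁸ = 0.129`): `σ(B) ≥ 1/32`, Mann,
**`schnirelmann_goldbach_le_65`** — unconditionally; under Rosser–Schoenfeld (3.3) (`c₀ = 1`, glue
`L² + h ≤ h·(8L − 248.5)`): `h = 27`, `Λ₀ = 176`, `Λs = 106` (`A = 14.72`), `x/54`, `σ(B) ≥ 1/27`,
`schnirelmann_goldbach_of_RS_le_55`. -/

/-! #### §16.1 Four shifted prime sets and their inclusion–exclusion -/

/-- The shifted image `S_q(y) = {(p+q)/2 : p an odd prime, p ≤ 2y − q}`. [folklore] -/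
def shiftImg (q y : ℕ) : Finset ℕ :=
  (((range (2 * y - q + 1)).filter Nat.Prime).erase 2).image (fun p : ℕ => (p + q) / 2)

/-- Membership in the odd-prime finset: odd primes `≤ 2y − q`. [folklore] -/
private theorem mem_oddPrimes_iff {q y p : ℕ} :
    p ∈ ((range (2 * y - q + 1)).filter Nat.Prime).erase 2 ↔ p.Prime ∧ p ≠ 2 ∧ p ≤ 2 * y - q := by
  rw [mem_erase, mem_filter, mem_range]
  constructor
  · rintro ⟨h2, hlt, hp⟩
    exact ⟨hp, h2, by omega⟩
  · rintro ⟨hp, h2, hle⟩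
    exact ⟨h2, by omega, hp⟩

/-- A prime `≠ 2` is odd. [folklore] -/
private theorem prime_ne_two_mod {p : ℕ} (hp : p.Prime) (h2 : p ≠ 2) : p % 2 = 1 := by
  rcases hp.eq_two_or_odd with h | h
  · exact absurd h h2
  · exact h

/-- `#S_q(y) + 1 = π(2y − q)` for odd `q` with `2 ≤ 2y − q` (`p ↦ (p+q)/2` is injective on odd `p`). [folklore] -/
private theorem card_shiftImg {q y : ℕ} (hq : q % 2 = 1) (h2 : 2 ≤ 2 * y - q) :
    #(shiftImg q y) + 1 = Nat.primeCounting (2 * y - q) := by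
  unfold shiftImg
  have hinj : Set.InjOn (fun p : ℕ => (p + q) / 2) ↑(((range (2 * y - q + 1)).filter Nat.Prime).erase 2) := by
    intro p hp p' hp' hpp'
    rw [mem_coe, mem_oddPrimes_iff] at hp hp'
    simp only at hpp'
    have h1 := prime_ne_two_mod hp.1 hp.2.1
    have h1' := prime_ne_two_mod hp'.1 hp'.2.1
    omega
  rw [card_image_of_injOn hinj]
  have hmem : 2 ∈ (range (2 * y - q + 1)).filter Nat.Prime := by
    rw [mem_filter, mem_range]
    exact ⟨by omega, Nat.prime_two⟩
  have hpos : 1 ≤ #((range (2 * y - q + 1)).filter Nat.Prime) := card_pos.mpr ⟨2, hmem⟩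
  rw [card_erase_of_mem hmem]
  rw [card_filter_prime_range] at hpos ⊢
  omega

/-- `S_q(y) ⊆ (0, y] ∩ B` for an odd prime `q` (`2·((p+q)/2) = p + q`). [folklore] -/
private theorem shiftImg_subset {q y : ℕ} (hq : q.Prime) (hq2 : q ≠ 2) :
    shiftImg q y ⊆ {b ∈ Ioc 0 y | b ∈ (({0, 1} : Set ℕ) ∪ {m | ∃ p q : ℕ, p.Prime ∧ q.Prime ∧ p + q = 2 * m})} := by
  intro m hm
  unfold shiftImg at hm
  rw [mem_image] at hm
  obtain ⟨p, hp, rfl⟩ := hm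
  rw [mem_oddPrimes_iff] at hp
  obtain ⟨hpp, hp2, hple⟩ := hp
  have h1 := prime_ne_two_mod hpp hp2
  have h2 := prime_ne_two_mod hq hq2
  have hp3 := hpp.two_le
  have hq3 := hq.two_le
  rw [mem_filter, mem_Ioc]
  exact ⟨⟨by omega, by omega⟩, Or.inr ⟨p, q, hpp, hq, by omega⟩⟩

/-- `#(S_q ∩ S_{q+d}) ≤ #{p ≤ 2y prime : p + d prime}` for odd `q` and even `d > 0`: a common element
`m = (p+q)/2 = (p'+q+d)/2` gives the prime pair `(p', p' + d) = (p', p)`. [folklore] -/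
private theorem card_shiftImg_inter_le {q q' d y : ℕ} (hq : q % 2 = 1) (hq' : q' % 2 = 1) (hd : q' = q + d) :
    #(shiftImg q y ∩ shiftImg q' y) ≤ #((Nat.primesLE (2 * y)).filter (fun p => (p + d).Prime)) := by
  calc #(shiftImg q y ∩ shiftImg q' y)
      ≤ #(((Nat.primesLE (2 * y)).filter (fun p => (p + d).Prime)).image (fun p : ℕ => (p + q') / 2)) := by
        refine card_le_card ?_
        intro m hm
        rw [mem_inter] at hm
        obtain ⟨hm1, hm2⟩ := hm
        unfold shiftImg at hm1 hm2
        rw [mem_image] at hm1 hm2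
        obtain ⟨p, hp, hpm⟩ := hm1
        obtain ⟨p', hp', rfl⟩ := hm2
        rw [mem_oddPrimes_iff] at hp hp'
        have h1 := prime_ne_two_mod hp.1 hp.2.1
        have h2 := prime_ne_two_mod hp'.1 hp'.2.1
        have hpp' : p = p' + d := by omega
        rw [mem_image]
        refine ⟨p', ?_, rfl⟩
        rw [mem_filter, Nat.mem_primesLE]
        refine ⟨⟨by omega, hp'.1⟩, ?_⟩
        rw [← hpp']
        exact hp.1
    _ ≤ _ := card_image_le

/-- Two-term Bonferroni lower bound for four finsets, subtraction-free:
`Σ #Sᵢ ≤ #(⋃ Sᵢ) + Σ_{i<j} #(Sᵢ ∩ Sⱼ)`. [folklore] -/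
private theorem bonferroni4 (A B C D : Finset ℕ) :
    #A + #B + #C + #D ≤ #(A ∪ B ∪ C ∪ D)
      + (#(A ∩ B) + #(A ∩ C) + #(A ∩ D) + #(B ∩ C) + #(B ∩ D) + #(C ∩ D)) := by
  have h1 := card_union_add_card_inter A B
  have h2 := card_union_add_card_inter (A ∪ B) C
  have h3 := card_union_add_card_inter (A ∪ B ∪ C) D
  have e2 : (A ∪ B) ∩ C = (A ∩ C) ∪ (B ∩ C) := by
    ext x
    simp only [mem_inter, mem_union]
    tauto
  have e3 : (A ∪ B ∪ C) ∩ D = (A ∩ D) ∪ (B ∩ D) ∪ (C ∩ D) := by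
    ext x
    simp only [mem_inter, mem_union]
    tauto
  have h2' : #((A ∪ B) ∩ C) ≤ #(A ∩ C) + #(B ∩ C) := by
    rw [e2]
    exact card_union_le _ _
  have h3' : #((A ∪ B ∪ C) ∩ D) ≤ #(A ∩ D) + #(B ∩ D) + #(C ∩ D) := by
    rw [e3]
    have h4 := card_union_le (A ∩ D) (B ∩ D)
    have h5 := card_union_le (A ∩ D ∪ B ∩ D) (C ∩ D)
    omega
  omega

/-- **Four shifts with inclusion–exclusion**: for `2y ≥ 13`,
`π(2y−3) + π(2y−5) + π(2y−7) + π(2y−11) ≤ B(y) + 2 + 2P₂ + 2P₄ + P₈ + P₆`, `P_d = #{p ≤ 2y prime : p + d prime}`,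
`B(y) = #((0,y] ∩ B)`: the sets `S₃, S₅, S₇, S₁₁ ⊆ (0,y] ∩ B` avoid `1, 2 ∈ B`, have `#S_q = π(2y−q) − 1`, and their
pairwise intersections are counted by prime pairs with differences `2, 4, 8, 2, 6, 4`. [cite: Nathanson1996, Theorem 7.8 (four shifted embeddings of the primes into the halved set, with two-term inclusion–exclusion; proved here)] -/
theorem four_shift_count {y : ℕ} (hy : 13 ≤ 2 * y) :
    Nat.primeCounting (2 * y - 3) + Nat.primeCounting (2 * y - 5) + Nat.primeCounting (2 * y - 7)
        + Nat.primeCounting (2 * y - 11)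
      ≤ #{b ∈ Ioc 0 y | b ∈ (({0, 1} : Set ℕ) ∪ {m | ∃ p q : ℕ, p.Prime ∧ q.Prime ∧ p + q = 2 * m})} + 2
        + (2 * #((Nat.primesLE (2 * y)).filter (fun p => (p + 2).Prime))
          + 2 * #((Nat.primesLE (2 * y)).filter (fun p => (p + 4).Prime))
          + #((Nat.primesLE (2 * y)).filter (fun p => (p + 8).Prime))
          + #((Nat.primesLE (2 * y)).filter (fun p => (p + 6).Prime))) := by
  have h3 := card_shiftImg (q := 3) (y := y) (by norm_num) (by omega)
  have h5 := card_shiftImg (q := 5) (y := y) (by norm_num) (by omega)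
  have h7 := card_shiftImg (q := 7) (y := y) (by norm_num) (by omega)
  have h11 := card_shiftImg (q := 11) (y := y) (by norm_num) (by omega)
  have hbon := bonferroni4 (shiftImg 3 y) (shiftImg 5 y) (shiftImg 7 y) (shiftImg 11 y)
  have i35 := card_shiftImg_inter_le (q := 3) (q' := 5) (d := 2) (y := y) (by norm_num) (by norm_num) (by norm_num)
  have i37 := card_shiftImg_inter_le (q := 3) (q' := 7) (d := 4) (y := y) (by norm_num) (by norm_num) (by norm_num)
  have i311 := card_shiftImg_inter_le (q := 3) (q' := 11) (d := 8) (y := y) (by norm_num) (by norm_num) (by norm_num)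
  have i57 := card_shiftImg_inter_le (q := 5) (q' := 7) (d := 2) (y := y) (by norm_num) (by norm_num) (by norm_num)
  have i511 := card_shiftImg_inter_le (q := 5) (q' := 11) (d := 6) (y := y) (by norm_num) (by norm_num) (by norm_num)
  have i711 := card_shiftImg_inter_le (q := 7) (q' := 11) (d := 4) (y := y) (by norm_num) (by norm_num) (by norm_num)
  set U := shiftImg 3 y ∪ shiftImg 5 y ∪ shiftImg 7 y ∪ shiftImg 11 y with hU
  have hUsub : U ⊆ {b ∈ Ioc 0 y | b ∈ (({0, 1} : Set ℕ) ∪ {m | ∃ p q : ℕ, p.Prime ∧ q.Prime ∧ p + q = 2 * m})} :=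
    union_subset (union_subset (union_subset (shiftImg_subset Nat.prime_three (by norm_num))
      (shiftImg_subset (by norm_num) (by norm_num))) (shiftImg_subset (by norm_num) (by norm_num)))
      (shiftImg_subset (by norm_num) (by norm_num))
  have hmemU : ∀ m ∈ U, 3 ≤ m := by
    intro m hm
    rw [hU, mem_union, mem_union, mem_union] at hm
    rcases hm with ((hm | hm) | hm) | hm
    all_goals
      unfold shiftImg at hm
      rw [mem_image] at hm
      obtain ⟨p, hp, rfl⟩ := hm
      rw [mem_oddPrimes_iff] at hp
      have h1 := hp.1.two_le
      have h2 := hp.2.1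
      omega
  have h2U : 2 ∉ U := fun h => by have := hmemU 2 h; omega
  have h1U : 1 ∉ insert 2 U := by
    rw [mem_insert]
    rintro (h | h)
    · omega
    · have := hmemU 1 h; omega
  have hsub : insert 1 (insert 2 U)
      ⊆ {b ∈ Ioc 0 y | b ∈ (({0, 1} : Set ℕ) ∪ {m | ∃ p q : ℕ, p.Prime ∧ q.Prime ∧ p + q = 2 * m})} := by
    intro b hb
    rw [mem_insert, mem_insert] at hb
    rcases hb with rfl | rfl | hb
    · rw [mem_filter, mem_Ioc]
      exact ⟨⟨by omega, by omega⟩, Or.inl (by simp)⟩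
    · rw [mem_filter, mem_Ioc]
      exact ⟨⟨by omega, by omega⟩, Or.inr ⟨2, 2, Nat.prime_two, Nat.prime_two, by norm_num⟩⟩
    · exact hUsub hb
  have hcard := card_le_card hsub
  rw [card_insert_of_notMem h1U, card_insert_of_notMem h2U] at hcard
  omega

/-! #### §16.2 The four-shift glue -/

/-- `((2y − q : ℕ) : ℝ) = 2y − q` for `q ≤ 2y`. [folklore] -/
private theorem cast_two_mul_sub {y q : ℕ} (h : q ≤ 2 * y) : ((2 * y - q : ℕ) : ℝ) = 2 * (y : ℝ) - q := by
  rw [Nat.cast_sub h]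
  push_cast
  ring

/-- `f(2) = 1`. [folklore] -/
private theorem oddSingularFactor_two' : oddSingularFactor 2 = 1 := by
  rw [show (2 : ℕ) = 2 ^ 1 * 1 by norm_num, GoldbachLinnik.oddSingularFactor_two_pow_mul 1 one_ne_zero,
    GoldbachLinnik.oddSingularFactor_one]

/-- `f(4) = 1`. [folklore] -/
private theorem oddSingularFactor_four : oddSingularFactor 4 = 1 := by
  rw [show (4 : ℕ) = 2 ^ 2 * 1 by norm_num, GoldbachLinnik.oddSingularFactor_two_pow_mul 2 one_ne_zero,
    GoldbachLinnik.oddSingularFactor_one]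

/-- `f(8) = 1`. [folklore] -/
private theorem oddSingularFactor_eight : oddSingularFactor 8 = 1 := by
  rw [show (8 : ℕ) = 2 ^ 3 * 1 by norm_num, GoldbachLinnik.oddSingularFactor_two_pow_mul 3 one_ne_zero,
    GoldbachLinnik.oddSingularFactor_one]

/-- `f(6) = 2` (the factor `(3−1)/(3−2)`). [folklore] -/
private theorem oddSingularFactor_six : oddSingularFactor 6 = 2 := by
  rw [show (6 : ℕ) = 2 ^ 1 * 3 by norm_num, GoldbachLinnik.oddSingularFactor_two_pow_mul 1 (by norm_num)]
  show ∏ p ∈ (Nat.primeFactors 3).filter (2 < ·), (((p : ℝ) - 1) / ((p : ℝ) - 2)) = 2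
  rw [Nat.prime_three.primeFactors, Finset.filter_singleton, if_pos (by norm_num), Finset.prod_singleton]
  norm_num

/-- `2^59 ≤ e^41` as a numeral. [folklore] -/
private theorem numeral_le_exp_41 : (576460752303423488 : ℝ) ≤ Real.exp 41 := by
  have := two_pow_59_le_exp_41
  norm_num at this
  exact this

set_option maxHeartbeats 800000 in
/-- **All `y ≥ 1` for the halved set, FOUR-SHIFT glue**: suppose `x/(2h) ≤ #{even N ∈ (0, x] : N = p + q}` for
`x ≥ e^{Λ₀}`, `h ≥ 28`, `41 ≤ L₁ ≤ 1.8424·h`, `Λ₀ ≤ 10⁴`, and `L² + h ≤ h·(7.3696·L − 248.5)` for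
`L ∈ [L₁, Λ₀]`.  Then `y/h ≤ B(y)` for EVERY `y ≥ 1`: below `e^{L₁}` by ONE shift (§15: `π(2y−3) + 1 ≥ y/28`, resp.
`≥ 0.9212·(2y−3)/L₁ + 1 ≥ y/h`); on `(e^{L₁}, e^{Λ₀})` by FOUR shifts and Bonferroni (`four_shift_count`):
`B(y) ≥ Σ_q 0.9212·(2y−q)/L − 2 − 7·17.75·2y/L² ≥ y/h`, `L = log 2y`, the pair terms by the tree's explicit pair
sieve above `e^41`; above `e^{Λ₀}` by the count.
[cite: Nathanson1996, Thm 7.7 (all-`x` form; four-shift inclusion–exclusion proved here)] -/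
theorem half_count_ge_allN_bonf {L₁ Λ₀ : ℝ} {h : ℕ} (h28 : 28 ≤ h) (h41 : 41 ≤ L₁) (hL₁h : L₁ ≤ 1.8424 * h)
    (hΛ4 : Λ₀ ≤ 10000)
    (hquad : ∀ L : ℝ, L₁ ≤ L → L ≤ Λ₀ → L ^ 2 + h ≤ h * (7.3696 * L - 248.5))
    (hlarge : ∀ x : ℕ, Real.exp Λ₀ ≤ (x : ℝ) →
      (x : ℝ) / (2 * h) ≤ #{N ∈ Ioc 0 x | Even N ∧ ∃ p q : ℕ, p.Prime ∧ q.Prime ∧ p + q = N})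
    {y : ℕ} (hy : 1 ≤ y) :
    (y : ℝ) / h ≤ #{b ∈ Ioc 0 y | b ∈ (({0, 1} : Set ℕ) ∪ {m | ∃ p q : ℕ, p.Prime ∧ q.Prime ∧ p + q = 2 * m})} := by
  set B : Set ℕ := ({0, 1} : Set ℕ) ∪ {m | ∃ p q : ℕ, p.Prime ∧ q.Prime ∧ p + q = 2 * m} with hB
  have hhr : (28 : ℝ) ≤ h := by exact_mod_cast h28
  have hh0 : (0 : ℝ) < h := by linarith
  have hL₁pos : (0 : ℝ) < L₁ := by linarith
  by_cases hbig : Real.exp Λ₀ ≤ ((2 * y : ℕ) : ℝ)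
  · have h1 := hlarge (2 * y) hbig
    have h2 := even_goldbach_card_le_half y
    have e : ((2 * y : ℕ) : ℝ) / (2 * h) = (y : ℝ) / h := by
      push_cast
      field_simp
    rw [e] at h1
    exact h1.trans (by exact_mod_cast h2)
  rw [not_le] at hbig
  by_cases hsmall : y ≤ h
  · have h1 : 1 ≤ #{b ∈ Ioc 0 y | b ∈ B} :=
      card_pos.mpr ⟨1, by
        rw [mem_filter, mem_Ioc]
        exact ⟨⟨by omega, hy⟩, Or.inl (by simp)⟩⟩
    have h1' : (1 : ℝ) ≤ #{b ∈ Ioc 0 y | b ∈ B} := by exact_mod_cast h1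
    have h2 : (y : ℝ) / h ≤ 1 := by
      rw [div_le_one hh0]
      exact_mod_cast hsmall
    linarith
  rw [not_le] at hsmall
  have hy29 : 29 ≤ y := by omega
  have hnr : ((2 * y - 3 : ℕ) : ℝ) = 2 * (y : ℝ) - 3 := cast_two_mul_sub_three (by omega)
  have hy29r : (29 : ℝ) ≤ y := by exact_mod_cast hy29
  have hy0 : (0 : ℝ) < y := by linarith
  have hn55 : 55 ≤ 2 * y - 3 := by omega
  have hn0 : (0 : ℝ) < ((2 * y - 3 : ℕ) : ℝ) := by rw [hnr]; linarith
  have hn1 : (1 : ℝ) < ((2 * y - 3 : ℕ) : ℝ) := by rw [hnr]; linarith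
  have hlogpos : 0 < Real.log ((2 * y - 3 : ℕ) : ℝ) := Real.log_pos hn1
  by_cases hmid : Real.log ((2 * y - 3 : ℕ) : ℝ) ≤ L₁
  · -- ONE SHIFT below `e^{L₁}` (§15)
    have hemb := primeCounting_shift_le_half_count (y := y) (by omega)
    have hembr : (Nat.primeCounting (2 * y - 3) : ℝ) + 1 ≤ #{b ∈ Ioc 0 y | b ∈ B} := by exact_mod_cast hemb
    refine le_trans ?_ hembr
    by_cases h6 : 10 ^ 6 ≤ 2 * y - 3
    · have hπ : 0.9212 * ((2 * y - 3 : ℕ) : ℝ) / Real.log ((2 * y - 3 : ℕ) : ℝ)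
          ≤ (Nat.primeCounting (2 * y - 3) : ℝ) := by
        have := primeCountingLowerMul_09212
        unfold PrimeCountingLowerMul at this
        exact this (2 * y - 3) h6
      have h2 : 0.9212 * ((2 * y - 3 : ℕ) : ℝ) / L₁
          ≤ 0.9212 * ((2 * y - 3 : ℕ) : ℝ) / Real.log ((2 * y - 3 : ℕ) : ℝ) :=
        div_le_div_of_nonneg_left (by positivity) hlogpos hmid
      have h3 : (y : ℝ) / h ≤ 1.8424 * y / L₁ := by
        rw [div_le_div_iff₀ hh0 hL₁pos]
        nlinarith [mul_le_mul_of_nonneg_left hL₁h hy0.le]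
      have h4 : 1.8424 * (y : ℝ) / L₁ ≤ 0.9212 * ((2 * y - 3 : ℕ) : ℝ) / L₁ + 1 := by
        rw [hnr]
        have e : 0.9212 * (2 * (y : ℝ) - 3) / L₁ = 1.8424 * y / L₁ - 2.7636 / L₁ := by
          field_simp
          ring
        rw [e]
        have : 2.7636 / L₁ ≤ 1 := by
          rw [div_le_one hL₁pos]
          linarith
        linarith
      linarith [h2, h3, h4, hπ]
    · rw [not_le] at h6
      have hn32 : 32 ≤ 2 * y - 3 := by omega
      have hπ := ShnirelmanGoldbachTheorem.primeCounting_ge hn32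
      have hlog14 : Real.log ((2 * y - 3 : ℕ) : ℝ) ≤ 14 := log_le_14_of_lt (by omega) h6
      have h5 : ((2 * y - 3 : ℕ) : ℝ) / 56 ≤ ((2 * y - 3 : ℕ) : ℝ) / (4 * Real.log ((2 * y - 3 : ℕ) : ℝ)) :=
        div_le_div_of_nonneg_left hn0.le (by positivity) (by linarith)
      have h6' : (y : ℝ) / h ≤ (y : ℝ) / 28 := div_le_div_of_nonneg_left hy0.le (by norm_num) hhr
      have h7 : ((2 * y - 3 : ℕ) : ℝ) / 56 + 1 - (y : ℝ) / 28 = 53 / 56 := by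
        rw [hnr]
        ring
      linarith [hπ, h5, h6', h7]
  · -- FOUR SHIFTS on `(e^{L₁}, e^{Λ₀})`
    rw [not_le] at hmid
    have h59 : (576460752303423488 : ℝ) < ((2 * y - 3 : ℕ) : ℝ) := by
      have h1 : Real.exp L₁ < ((2 * y - 3 : ℕ) : ℝ) := by
        by_contra hc
        rw [not_lt] at hc
        have := Real.log_le_log hn0 hc
        rw [Real.log_exp] at this
        linarith
      exact lt_of_le_of_lt (numeral_le_exp_41.trans (Real.exp_le_exp.mpr h41)) h1
    have h59n : 576460752303423488 < 2 * y - 3 := by exact_mod_cast h59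
    have hy58 : (288230376151711744 : ℝ) ≤ (y : ℝ) := by
      have : 288230376151711744 ≤ y := by omega
      exact_mod_cast this
    have h2y0 : (0 : ℝ) < ((2 * y : ℕ) : ℝ) := by push_cast; linarith
    set L := Real.log ((2 * y : ℕ) : ℝ) with hLdef
    have hLΛ : L < Λ₀ := by
      have := Real.log_lt_log h2y0 hbig
      rwa [Real.log_exp] at this
    have hL₁L : L₁ ≤ L := by
      have h2y : ((2 * y - 3 : ℕ) : ℝ) ≤ ((2 * y : ℕ) : ℝ) := by rw [hnr]; push_cast; linarith
      exact (hmid.trans_le (Real.log_le_log hn0 h2y)).le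
    have hL41 : (41 : ℝ) ≤ L := h41.trans hL₁L
    have hLpos : (0 : ℝ) < L := by linarith
    have hL4 : L ≤ 10000 := by linarith
    have hq := hquad L hL₁L hLΛ.le
    have he41 : Real.exp 41 ≤ ((2 * y : ℕ) : ℝ) := by
      have : Real.exp 41 ≤ Real.exp L := Real.exp_le_exp.mpr hL41
      rwa [hLdef, Real.exp_log h2y0] at this
    -- the four prime counts
    have hπ : ∀ q : ℕ, q ≤ 11 → 0.9212 * (2 * (y : ℝ) - q) / L ≤ (Nat.primeCounting (2 * y - q) : ℝ) := by
      intro q hq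
      have hqr : (q : ℝ) ≤ 11 := by exact_mod_cast hq
      have hnq : ((2 * y - q : ℕ) : ℝ) = 2 * (y : ℝ) - q := cast_two_mul_sub (by omega)
      have h6 : 10 ^ 6 ≤ 2 * y - q := by omega
      have hnq0 : (0 : ℝ) < ((2 * y - q : ℕ) : ℝ) := by rw [hnq]; linarith
      have hnq1 : (1 : ℝ) < ((2 * y - q : ℕ) : ℝ) := by rw [hnq]; linarith
      have h1 : 0.9212 * ((2 * y - q : ℕ) : ℝ) / Real.log ((2 * y - q : ℕ) : ℝ)
          ≤ (Nat.primeCounting (2 * y - q) : ℝ) := by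
        have := primeCountingLowerMul_09212
        unfold PrimeCountingLowerMul at this
        exact this (2 * y - q) h6
      have hlogq0 : 0 < Real.log ((2 * y - q : ℕ) : ℝ) := Real.log_pos hnq1
      have hlogq : Real.log ((2 * y - q : ℕ) : ℝ) ≤ L := by
        have h2y : ((2 * y - q : ℕ) : ℝ) ≤ ((2 * y : ℕ) : ℝ) := by
          rw [hnq]; push_cast; linarith [Nat.cast_nonneg (α := ℝ) q]
        exact Real.log_le_log hnq0 h2y
      have h2 : 0.9212 * (2 * (y : ℝ) - q) / L
          ≤ 0.9212 * ((2 * y - q : ℕ) : ℝ) / Real.log ((2 * y - q : ℕ) : ℝ) := by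
        rw [← hnq]
        exact div_le_div_of_nonneg_left (by positivity) hlogq0 hlogq
      linarith
    -- the pair counts (tree: explicit pair sieve above `e^41`)
    have hP : ∀ d : ℕ, d ≠ 0 → Even d →
        (#((Nat.primesLE (2 * y)).filter (fun p => (p + d).Prime)) : ℝ)
          ≤ 17.75 * oddSingularFactor d * ((2 * y : ℕ) : ℝ) / L ^ 2 := by
      intro d hd hde
      exact TwoResidueSelbergExplicit.pairCount_le_kappa (N := 2 * y) (h := d) he41 hd hde
    have hP2 := hP 2 (by norm_num) (by norm_num)
    have hP4 := hP 4 (by norm_num) (by norm_num)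
    have hP6 := hP 6 (by norm_num) (by norm_num)
    have hP8 := hP 8 (by norm_num) (by norm_num)
    rw [oddSingularFactor_two'] at hP2
    rw [oddSingularFactor_four] at hP4
    rw [oddSingularFactor_six] at hP6
    rw [oddSingularFactor_eight] at hP8
    -- combinatorics
    have hcomb := four_shift_count (y := y) (by omega)
    have hcombr : (Nat.primeCounting (2 * y - 3) : ℝ) + Nat.primeCounting (2 * y - 5)
        + Nat.primeCounting (2 * y - 7) + Nat.primeCounting (2 * y - 11)
        ≤ (#{b ∈ Ioc 0 y | b ∈ B} : ℝ) + 2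
          + (2 * #((Nat.primesLE (2 * y)).filter (fun p => (p + 2).Prime))
            + 2 * #((Nat.primesLE (2 * y)).filter (fun p => (p + 4).Prime))
            + #((Nat.primesLE (2 * y)).filter (fun p => (p + 8).Prime))
            + #((Nat.primesLE (2 * y)).filter (fun p => (p + 6).Prime))) := by
      exact_mod_cast hcomb
    have hπ3 := hπ 3 (by norm_num)
    have hπ5 := hπ 5 (by norm_num)
    have hπ7 := hπ 7 (by norm_num)
    have hπ11 := hπ 11 (by norm_num)
    push_cast at hπ3 hπ5 hπ7 hπ11
    have h2yr : ((2 * y : ℕ) : ℝ) = 2 * (y : ℝ) := by push_cast; ring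
    rw [h2yr] at hP2 hP4 hP6 hP8
    set G : ℝ := (#{b ∈ Ioc 0 y | b ∈ B} : ℝ) with hG
    set Y : ℝ := (y : ℝ) with hY
    -- `G ≥ (7.3696 Y − 23.9512)/L − 2 − 248.5 Y/L²`
    have hG1 : (7.3696 * Y - 23.9512) / L - 2 - 248.5 * Y / L ^ 2 ≤ G := by
      have e1 : (7.3696 * Y - 23.9512) / L = 0.9212 * (2 * Y - 3) / L + 0.9212 * (2 * Y - 5) / L
          + 0.9212 * (2 * Y - 7) / L + 0.9212 * (2 * Y - 11) / L := by
        field_simp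
        ring
      have e2 : 248.5 * Y / L ^ 2 = 2 * (17.75 * 1 * (2 * Y) / L ^ 2) + 2 * (17.75 * 1 * (2 * Y) / L ^ 2)
          + 17.75 * 1 * (2 * Y) / L ^ 2 + 17.75 * 2 * (2 * Y) / L ^ 2 := by
        field_simp
        ring
      rw [e1, e2]
      linarith [hcombr, hπ3, hπ5, hπ7, hπ11, hP2, hP4, hP6, hP8]
    have hL2 : (0 : ℝ) < L ^ 2 := by positivity
    have hkey : Y * L ^ 2 ≤ (h : ℝ) * G * L ^ 2 := by
      have e3 : ((7.3696 * Y - 23.9512) / L - 2 - 248.5 * Y / L ^ 2) * L ^ 2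
          = 7.3696 * Y * L - 23.9512 * L - 2 * L ^ 2 - 248.5 * Y := by
        field_simp
      have h1 : (7.3696 * Y * L - 23.9512 * L - 2 * L ^ 2 - 248.5 * Y) * h ≤ G * L ^ 2 * h := by
        rw [← e3]
        exact mul_le_mul_of_nonneg_right (mul_le_mul_of_nonneg_right hG1 hL2.le) hh0.le
      have h2 : Y * (L ^ 2 + h) ≤ Y * (h * (7.3696 * L - 248.5)) :=
        mul_le_mul_of_nonneg_left hq (by linarith)
      have h3 : 23.9512 * L + 2 * L ^ 2 ≤ Y := by
        nlinarith [mul_nonneg (sub_nonneg.2 hL4) hLpos.le]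
      have h3' : (h : ℝ) * (23.9512 * L + 2 * L ^ 2) ≤ h * Y := mul_le_mul_of_nonneg_left h3 hh0.le
      nlinarith [h1, h2, h3']
    have hfin := le_of_mul_le_mul_right hkey hL2
    rw [div_le_iff₀ hh0, mul_comm]
    exact hfin

set_option maxHeartbeats 800000 in
/-- **All `y ≥ 1` for the halved set under (3.3), FOUR-SHIFT glue**: as `half_count_ge_allN_bonf` with `c₀ = 1`
(`π(n) ≥ n/log n`, `n ≥ 67`; any `h ≥ 18`): one shift below `e^{L₁}` needs `L₁ ≤ 2h`; four shifts on `(e^{L₁}, e^{Λ₀})` need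
`L² + h ≤ h·(8L − 248.5)`. [cite: RosserSchoenfeld1962, Theorem 2, eq. (3.3) (as input)] -/
theorem half_count_ge_allN_bonf_RS (hRS : Literature.NumberTheory.LFunctions.RosserSchoenfeld1962_theorem2)
    {L₁ Λ₀ : ℝ} {h : ℕ} (h18 : 18 ≤ h) (h41 : 41 ≤ L₁) (hL₁h : L₁ ≤ 2 * h)
    (hΛ4 : Λ₀ ≤ 10000)
    (hquad : ∀ L : ℝ, L₁ ≤ L → L ≤ Λ₀ → L ^ 2 + h ≤ h * (8 * L - 248.5))
    (hlarge : ∀ x : ℕ, Real.exp Λ₀ ≤ (x : ℝ) →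
      (x : ℝ) / (2 * h) ≤ #{N ∈ Ioc 0 x | Even N ∧ ∃ p q : ℕ, p.Prime ∧ q.Prime ∧ p + q = N})
    {y : ℕ} (hy : 1 ≤ y) :
    (y : ℝ) / h ≤ #{b ∈ Ioc 0 y | b ∈ (({0, 1} : Set ℕ) ∪ {m | ∃ p q : ℕ, p.Prime ∧ q.Prime ∧ p + q = 2 * m})} := by
  set B : Set ℕ := ({0, 1} : Set ℕ) ∪ {m | ∃ p q : ℕ, p.Prime ∧ q.Prime ∧ p + q = 2 * m} with hB
  have hhr : (18 : ℝ) ≤ h := by exact_mod_cast h18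
  have hh0 : (0 : ℝ) < h := by linarith
  have hL₁pos : (0 : ℝ) < L₁ := by linarith
  by_cases hbig : Real.exp Λ₀ ≤ ((2 * y : ℕ) : ℝ)
  · have h1 := hlarge (2 * y) hbig
    have h2 := even_goldbach_card_le_half y
    have e : ((2 * y : ℕ) : ℝ) / (2 * h) = (y : ℝ) / h := by
      push_cast
      field_simp
    rw [e] at h1
    exact h1.trans (by exact_mod_cast h2)
  rw [not_le] at hbig
  by_cases hsmall : y ≤ h
  · have h1 : 1 ≤ #{b ∈ Ioc 0 y | b ∈ B} :=
      card_pos.mpr ⟨1, by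
        rw [mem_filter, mem_Ioc]
        exact ⟨⟨by omega, hy⟩, Or.inl (by simp)⟩⟩
    have h1' : (1 : ℝ) ≤ #{b ∈ Ioc 0 y | b ∈ B} := by exact_mod_cast h1
    have h2 : (y : ℝ) / h ≤ 1 := by
      rw [div_le_one hh0]
      exact_mod_cast hsmall
    linarith
  rw [not_le] at hsmall
  have hy29 : 19 ≤ y := by omega
  have hnr : ((2 * y - 3 : ℕ) : ℝ) = 2 * (y : ℝ) - 3 := cast_two_mul_sub_three (by omega)
  have hy29r : (19 : ℝ) ≤ y := by exact_mod_cast hy29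
  have hy0 : (0 : ℝ) < y := by linarith
  have hn55 : 35 ≤ 2 * y - 3 := by omega
  have hn0 : (0 : ℝ) < ((2 * y - 3 : ℕ) : ℝ) := by rw [hnr]; linarith
  have hn1 : (1 : ℝ) < ((2 * y - 3 : ℕ) : ℝ) := by rw [hnr]; linarith
  have hlogpos : 0 < Real.log ((2 * y - 3 : ℕ) : ℝ) := Real.log_pos hn1
  by_cases hmid : Real.log ((2 * y - 3 : ℕ) : ℝ) ≤ L₁
  · -- ONE SHIFT below `e^{L₁}` (§15, RS)
    have hemb := primeCounting_shift_le_half_count (y := y) (by omega)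
    have hembr : (Nat.primeCounting (2 * y - 3) : ℝ) + 1 ≤ #{b ∈ Ioc 0 y | b ∈ B} := by exact_mod_cast hemb
    refine le_trans ?_ hembr
    by_cases h67 : 67 ≤ 2 * y - 3
    · have hπ : 1 * ((2 * y - 3 : ℕ) : ℝ) / Real.log ((2 * y - 3 : ℕ) : ℝ)
          ≤ (Nat.primeCounting (2 * y - 3) : ℝ) := by
        have := primeCountingLowerMul_one_of_RS hRS
        unfold PrimeCountingLowerMul at this
        exact this (2 * y - 3) h67
      rw [one_mul] at hπ
      have h2 : ((2 * y - 3 : ℕ) : ℝ) / L₁ ≤ ((2 * y - 3 : ℕ) : ℝ) / Real.log ((2 * y - 3 : ℕ) : ℝ) :=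
        div_le_div_of_nonneg_left hn0.le hlogpos hmid
      have h3 : (y : ℝ) / h ≤ 2 * y / L₁ := by
        rw [div_le_div_iff₀ hh0 hL₁pos]
        nlinarith [mul_le_mul_of_nonneg_left hL₁h hy0.le]
      have h4 : 2 * (y : ℝ) / L₁ ≤ ((2 * y - 3 : ℕ) : ℝ) / L₁ + 1 := by
        rw [hnr]
        have e : (2 * (y : ℝ) - 3) / L₁ = 2 * y / L₁ - 3 / L₁ := by
          field_simp
        rw [e]
        have : 3 / L₁ ≤ 1 := by
          rw [div_le_one hL₁pos]
          linarith
        linarith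
      linarith [h2, h3, h4, hπ]
    · rw [not_le] at h67
      have hn32 : 32 ≤ 2 * y - 3 := by omega
      have hπ := ShnirelmanGoldbachTheorem.primeCounting_ge hn32
      have hlog7 : Real.log ((2 * y - 3 : ℕ) : ℝ) ≤ 7 := by
        have hy7 : ((2 * y - 3 : ℕ) : ℝ) ≤ (2 : ℝ) ^ 7 := by
          have : ((2 * y - 3 : ℕ) : ℝ) < 67 := by exact_mod_cast h67
          have h27 : (67 : ℝ) ≤ (2 : ℝ) ^ 7 := by norm_num
          linarith
        have he : (2 : ℝ) ≤ Real.exp 1 := by have := Real.add_one_le_exp (1 : ℝ); linarith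
        have h7 : (2 : ℝ) ^ 7 ≤ Real.exp 7 := by
          rw [show (7 : ℝ) = ((7 : ℕ) : ℝ) * 1 by norm_num, Real.exp_nat_mul]
          exact pow_le_pow_left₀ (by norm_num) he 7
        have := Real.log_le_log hn0 (hy7.trans h7)
        rwa [Real.log_exp] at this
      have h5 : ((2 * y - 3 : ℕ) : ℝ) / 28 ≤ ((2 * y - 3 : ℕ) : ℝ) / (4 * Real.log ((2 * y - 3 : ℕ) : ℝ)) :=
        div_le_div_of_nonneg_left hn0.le (by positivity) (by linarith)
      have h6' : (y : ℝ) / h ≤ (y : ℝ) / 18 := div_le_div_of_nonneg_left hy0.le (by norm_num) hhr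
      have h7 : ((2 * y - 3 : ℕ) : ℝ) / 28 + 1 - (y : ℝ) / 18 = (4 * (y : ℝ) + 225) / 252 := by
        rw [hnr]
        ring
      have h8 : 0 ≤ (4 * (y : ℝ) + 225) / 252 := by positivity
      linarith [hπ, h5, h6', h7, h8]
  · -- FOUR SHIFTS on `(e^{L₁}, e^{Λ₀})`, `c₀ = 1`
    rw [not_le] at hmid
    have h59 : (576460752303423488 : ℝ) < ((2 * y - 3 : ℕ) : ℝ) := by
      have h1 : Real.exp L₁ < ((2 * y - 3 : ℕ) : ℝ) := by
        by_contra hc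
        rw [not_lt] at hc
        have := Real.log_le_log hn0 hc
        rw [Real.log_exp] at this
        linarith
      exact lt_of_le_of_lt (numeral_le_exp_41.trans (Real.exp_le_exp.mpr h41)) h1
    have h59n : 576460752303423488 < 2 * y - 3 := by exact_mod_cast h59
    have hy58 : (288230376151711744 : ℝ) ≤ (y : ℝ) := by
      have : 288230376151711744 ≤ y := by omega
      exact_mod_cast this
    have h2y0 : (0 : ℝ) < ((2 * y : ℕ) : ℝ) := by push_cast; linarith
    set L := Real.log ((2 * y : ℕ) : ℝ) with hLdef
    have hLΛ : L < Λ₀ := by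
      have := Real.log_lt_log h2y0 hbig
      rwa [Real.log_exp] at this
    have hL₁L : L₁ ≤ L := by
      have h2y : ((2 * y - 3 : ℕ) : ℝ) ≤ ((2 * y : ℕ) : ℝ) := by rw [hnr]; push_cast; linarith
      exact (hmid.trans_le (Real.log_le_log hn0 h2y)).le
    have hL41 : (41 : ℝ) ≤ L := h41.trans hL₁L
    have hLpos : (0 : ℝ) < L := by linarith
    have hL4 : L ≤ 10000 := by linarith
    have hq := hquad L hL₁L hLΛ.le
    have he41 : Real.exp 41 ≤ ((2 * y : ℕ) : ℝ) := by
      have : Real.exp 41 ≤ Real.exp L := Real.exp_le_exp.mpr hL41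
      rwa [hLdef, Real.exp_log h2y0] at this
    have hπ : ∀ q : ℕ, q ≤ 11 → (2 * (y : ℝ) - q) / L ≤ (Nat.primeCounting (2 * y - q) : ℝ) := by
      intro q hq
      have hqr : (q : ℝ) ≤ 11 := by exact_mod_cast hq
      have hnq : ((2 * y - q : ℕ) : ℝ) = 2 * (y : ℝ) - q := cast_two_mul_sub (by omega)
      have h67 : 67 ≤ 2 * y - q := by omega
      have hnq0 : (0 : ℝ) < ((2 * y - q : ℕ) : ℝ) := by rw [hnq]; linarith
      have hnq1 : (1 : ℝ) < ((2 * y - q : ℕ) : ℝ) := by rw [hnq]; linarith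
      have h1 : 1 * ((2 * y - q : ℕ) : ℝ) / Real.log ((2 * y - q : ℕ) : ℝ)
          ≤ (Nat.primeCounting (2 * y - q) : ℝ) := by
        have := primeCountingLowerMul_one_of_RS hRS
        unfold PrimeCountingLowerMul at this
        exact this (2 * y - q) h67
      rw [one_mul] at h1
      have hlogq0 : 0 < Real.log ((2 * y - q : ℕ) : ℝ) := Real.log_pos hnq1
      have hlogq : Real.log ((2 * y - q : ℕ) : ℝ) ≤ L := by
        have h2y : ((2 * y - q : ℕ) : ℝ) ≤ ((2 * y : ℕ) : ℝ) := by
          rw [hnq]; push_cast; linarith [Nat.cast_nonneg (α := ℝ) q]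
        exact Real.log_le_log hnq0 h2y
      have h2 : (2 * (y : ℝ) - q) / L ≤ ((2 * y - q : ℕ) : ℝ) / Real.log ((2 * y - q : ℕ) : ℝ) := by
        rw [← hnq]
        exact div_le_div_of_nonneg_left hnq0.le hlogq0 hlogq
      linarith
    have hP : ∀ d : ℕ, d ≠ 0 → Even d →
        (#((Nat.primesLE (2 * y)).filter (fun p => (p + d).Prime)) : ℝ)
          ≤ 17.75 * oddSingularFactor d * ((2 * y : ℕ) : ℝ) / L ^ 2 := by
      intro d hd hde
      exact TwoResidueSelbergExplicit.pairCount_le_kappa (N := 2 * y) (h := d) he41 hd hde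
    have hP2 := hP 2 (by norm_num) (by norm_num)
    have hP4 := hP 4 (by norm_num) (by norm_num)
    have hP6 := hP 6 (by norm_num) (by norm_num)
    have hP8 := hP 8 (by norm_num) (by norm_num)
    rw [oddSingularFactor_two'] at hP2
    rw [oddSingularFactor_four] at hP4
    rw [oddSingularFactor_six] at hP6
    rw [oddSingularFactor_eight] at hP8
    have hcomb := four_shift_count (y := y) (by omega)
    have hcombr : (Nat.primeCounting (2 * y - 3) : ℝ) + Nat.primeCounting (2 * y - 5)
        + Nat.primeCounting (2 * y - 7) + Nat.primeCounting (2 * y - 11)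
        ≤ (#{b ∈ Ioc 0 y | b ∈ B} : ℝ) + 2
          + (2 * #((Nat.primesLE (2 * y)).filter (fun p => (p + 2).Prime))
            + 2 * #((Nat.primesLE (2 * y)).filter (fun p => (p + 4).Prime))
            + #((Nat.primesLE (2 * y)).filter (fun p => (p + 8).Prime))
            + #((Nat.primesLE (2 * y)).filter (fun p => (p + 6).Prime))) := by
      exact_mod_cast hcomb
    have hπ3 := hπ 3 (by norm_num)
    have hπ5 := hπ 5 (by norm_num)
    have hπ7 := hπ 7 (by norm_num)
    have hπ11 := hπ 11 (by norm_num)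
    push_cast at hπ3 hπ5 hπ7 hπ11
    have h2yr : ((2 * y : ℕ) : ℝ) = 2 * (y : ℝ) := by push_cast; ring
    rw [h2yr] at hP2 hP4 hP6 hP8
    set G : ℝ := (#{b ∈ Ioc 0 y | b ∈ B} : ℝ) with hG
    set Y : ℝ := (y : ℝ) with hY
    have hG1 : (8 * Y - 26) / L - 2 - 248.5 * Y / L ^ 2 ≤ G := by
      have e1 : (8 * Y - 26) / L = (2 * Y - 3) / L + (2 * Y - 5) / L + (2 * Y - 7) / L + (2 * Y - 11) / L := by
        field_simp
        ring
      have e2 : 248.5 * Y / L ^ 2 = 2 * (17.75 * 1 * (2 * Y) / L ^ 2) + 2 * (17.75 * 1 * (2 * Y) / L ^ 2)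
          + 17.75 * 1 * (2 * Y) / L ^ 2 + 17.75 * 2 * (2 * Y) / L ^ 2 := by
        field_simp
        ring
      rw [e1, e2]
      linarith [hcombr, hπ3, hπ5, hπ7, hπ11, hP2, hP4, hP6, hP8]
    have hL2 : (0 : ℝ) < L ^ 2 := by positivity
    have hkey : Y * L ^ 2 ≤ (h : ℝ) * G * L ^ 2 := by
      have e3 : ((8 * Y - 26) / L - 2 - 248.5 * Y / L ^ 2) * L ^ 2
          = 8 * Y * L - 26 * L - 2 * L ^ 2 - 248.5 * Y := by
        field_simp
      have h1 : (8 * Y * L - 26 * L - 2 * L ^ 2 - 248.5 * Y) * h ≤ G * L ^ 2 * h := by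
        rw [← e3]
        exact mul_le_mul_of_nonneg_right (mul_le_mul_of_nonneg_right hG1 hL2.le) hh0.le
      have h2 : Y * (L ^ 2 + h) ≤ Y * (h * (8 * L - 248.5)) :=
        mul_le_mul_of_nonneg_left hq (by linarith)
      have h3 : 26 * L + 2 * L ^ 2 ≤ Y := by
        nlinarith [mul_nonneg (sub_nonneg.2 hL4) hLpos.le]
      have h3' : (h : ℝ) * (26 * L + 2 * L ^ 2) ≤ h * Y := mul_le_mul_of_nonneg_left h3 hh0.le
      nlinarith [h1, h2, h3']
    have hfin := le_of_mul_le_mul_right hkey hL2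
    rw [div_le_iff₀ hh0, mul_comm]
    exact hfin

/-! #### §16.3 Instances: `K = 65` unconditionally, `K = 55` under (3.3) -/

/-- Numerics at `Λ = 114`: `17L² ≤ 16·14.58·TlowK(L/2 − 1.38632)` for `L ≥ 114`. [folklore] -/
private theorem kappa_numeric_114 {L : ℝ} (hL : 114 ≤ L) :
    17 * L ^ 2 ≤ 16 * (14.6 - 0.02) * TwoResidueSelbergExplicit.TlowK (L / 2 - 1.38632) := by
  unfold TwoResidueSelbergExplicit.TlowK
  nlinarith [hL, mul_self_nonneg (L - 114)]

/-- **`A = 14.6` above `e^114`**. [cite: BatemanDiamond2004, §13.4 (13.13)–(13.14)] -/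
theorem goldbachCount_le_1460 {N : ℕ} (hN : Real.exp 114 ≤ (N : ℝ)) (heven : Even N) :
    (SingularSeries.goldbachCount N : ℝ) ≤ 14.6 * oddSingularFactor N * (N : ℝ) / Real.log (N : ℝ) ^ 2 :=
  goldbachCount_le_of_numeric41 (by norm_num) (fun _ hL => kappa_numeric_114 hL) hN heven

/-- Numerics at `Λ = 106`: `17L² ≤ 16·14.7·TlowK(L/2 − 1.38632)` for `L ≥ 106`. [folklore] -/
private theorem kappa_numeric_106 {L : ℝ} (hL : 106 ≤ L) :
    17 * L ^ 2 ≤ 16 * (14.72 - 0.02) * TwoResidueSelbergExplicit.TlowK (L / 2 - 1.38632) := by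
  unfold TwoResidueSelbergExplicit.TlowK
  nlinarith [hL, mul_self_nonneg (L - 106)]

/-- **`A = 14.72` above `e^106`**. [cite: BatemanDiamond2004, §13.4 (13.13)–(13.14)] -/
theorem goldbachCount_le_1472 {N : ℕ} (hN : Real.exp 106 ≤ (N : ℝ)) (heven : Even N) :
    (SingularSeries.goldbachCount N : ℝ) ≤ 14.72 * oddSingularFactor N * (N : ℝ) / Real.log (N : ℝ) ^ 2 :=
  goldbachCount_le_of_numeric41 (by norm_num) (fun _ hL => kappa_numeric_106 hL) hN heven

/-- **Unconditional, above `e^192`**: at least `x/64` EVEN Goldbach numbers in `(0, x]`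
(`Λs = 114`, `A = 14.6`, `2·114 ≤ 192 + 36.5`; `(1/64)⁷·259.55·14.6⁸ = 0.121 ≤ (0.4242·gHol 192 − 0.0057)⁸ = 0.129`).
[cite: Nathanson1996, Theorem 7.8 (proof, restricted to even N; explicit form proved here)] -/
theorem goldbach_even_count_ge_64_exp192 {x : ℕ} (hx : Real.exp 192 ≤ (x : ℝ)) :
    (x : ℝ) / 64 ≤ #{N ∈ Ioc 0 x | Even N ∧ ∃ p q : ℕ, p.Prime ∧ q.Prime ∧ p + q = N} := by
  have h := goldbach_even_count_ge_holder_gap (Λs := 114) (Λ₀ := 192) (A := 14.6) (c₁ := 0.4243) (κ := 1 / 64)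
    (by norm_num) (by norm_num) (by norm_num) (by norm_num)
    (fun N hN hev => goldbachCount_le_1460 hN hev) (by norm_num) (by norm_num)
    (fun y hy => sum_goldbachCount_ge_04243' ((Real.exp_le_exp.mpr (by norm_num)).trans hy))
    (by unfold gHol; norm_num) (by unfold gHol; norm_num) hx
  have e : (1 : ℝ) / 64 * x = x / 64 := by ring
  rw [e] at h
  exact h

/-- **Under (3.3), above `e^176`**: at least `x/54` EVEN Goldbach numbers in `(0, x]`
(`Λs = 106`, `A = 14.72`, `2·106 ≤ 176 + 36.5`, `c₁ = 0.4995`). [cite: RosserSchoenfeld1962, Theorem 2, eq. (3.3) (as input)] -/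
theorem goldbach_even_count_ge_of_RS_54 (hRS : Literature.NumberTheory.LFunctions.RosserSchoenfeld1962_theorem2)
    {x : ℕ} (hx : Real.exp 176 ≤ (x : ℝ)) :
    (x : ℝ) / 54 ≤ #{N ∈ Ioc 0 x | Even N ∧ ∃ p q : ℕ, p.Prime ∧ q.Prime ∧ p + q = N} := by
  have h := goldbach_even_count_ge_holder_gap (Λs := 106) (Λ₀ := 176) (A := 14.72) (c₁ := 0.4995) (κ := 1 / 54)
    (by norm_num) (by norm_num) (by norm_num) (by norm_num)
    (fun N hN hev => goldbachCount_le_1472 hN hev) (by norm_num) (by norm_num)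
    (fun y hy => sum_goldbachCount_ge_of_RS' hRS ((Real.exp_le_exp.mpr (by norm_num)).trans hy))
    (by unfold gHol; norm_num) (by unfold gHol; norm_num) hx
  have e : (1 : ℝ) / 54 * x = x / 54 := by ring
  rw [e] at h
  exact h

/-- **Unconditional count for all `y ≥ 1`**: `B(y) ≥ y/32` (four-shift glue on `(e^58.9568, e^192)`:
`L² + 32 ≤ 32·(7.3696L − 248.5)` there; one shift below, `58.9568 = 1.8424·32`). [cite: Nathanson1996, Theorem 7.8 (explicit constant for the halved set proved here)] -/
theorem half_count_ge_allN_32 {y : ℕ} (hy : 1 ≤ y) :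
    (y : ℝ) / 32 ≤ #{b ∈ Ioc 0 y | b ∈ (({0, 1} : Set ℕ) ∪ {m | ∃ p q : ℕ, p.Prime ∧ q.Prime ∧ p + q = 2 * m})} := by
  have h := half_count_ge_allN_bonf (L₁ := 58.9568) (Λ₀ := 192) (h := 32) (by norm_num) (by norm_num)
    (by norm_num) (by norm_num)
    (fun L h1 h2 => by
      push_cast
      nlinarith [mul_nonneg (sub_nonneg.2 h1) (sub_nonneg.2 h2)])
    (fun x hx => by
      have h1 := goldbach_even_count_ge_64_exp192 hx
      have e : (x : ℝ) / (2 * ((32 : ℕ) : ℝ)) = (x : ℝ) / 64 := by norm_num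
      rw [e]
      exact h1) hy
  exact_mod_cast h

/-- **Under (3.3), all `y ≥ 1`**: `B(y) ≥ y/27` (four-shift RS glue on `(e^54, e^176)`: `L² + 27 ≤ 27·(8L − 248.5)`).
[cite: RosserSchoenfeld1962, Theorem 2, eq. (3.3) (as input)] -/
theorem half_count_ge_allN_of_RS_27 (hRS : Literature.NumberTheory.LFunctions.RosserSchoenfeld1962_theorem2)
    {y : ℕ} (hy : 1 ≤ y) :
    (y : ℝ) / 27 ≤ #{b ∈ Ioc 0 y | b ∈ (({0, 1} : Set ℕ) ∪ {m | ∃ p q : ℕ, p.Prime ∧ q.Prime ∧ p + q = 2 * m})} := by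
  have h := half_count_ge_allN_bonf_RS hRS (L₁ := 54) (Λ₀ := 176) (h := 27) (by norm_num) (by norm_num)
    (by norm_num) (by norm_num)
    (fun L h1 h2 => by
      push_cast
      nlinarith [mul_nonneg (sub_nonneg.2 h1) (sub_nonneg.2 h2)])
    (fun x hx => by
      have h1 := goldbach_even_count_ge_of_RS_54 hRS hx
      have e : (x : ℝ) / (2 * ((27 : ℕ) : ℝ)) = (x : ℝ) / 54 := by norm_num
      rw [e]
      exact h1) hy
  exact_mod_cast h

/-- **The halved density, `1/32`**: `σ({0, 1} ∪ {m : 2m = p + q}) ≥ 1/32`, unconditionally. [cite: Nathanson1996, Theorem 7.8 (explicit constant for the halved set proved here)] -/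
theorem schnirelmannDensity_half_ge_32 :
    (1 : ℝ) / 32 ≤ schnirelmannDensity
      (({0, 1} : Set ℕ) ∪ {m | ∃ p q : ℕ, p.Prime ∧ q.Prime ∧ p + q = 2 * m}) := by
  have h := schnirelmannDensity_ge_of_count' (K := 32)
    (S := ({0, 1} : Set ℕ) ∪ {m | ∃ p q : ℕ, p.Prime ∧ q.Prime ∧ p + q = 2 * m})
    (fun N hN => by have := half_count_ge_allN_32 hN; exact_mod_cast this)
  exact_mod_cast h

/-- **The halved density under (3.3), `1/27`**. [cite: RosserSchoenfeld1962, Theorem 2, eq. (3.3) (as input)] -/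
theorem schnirelmannDensity_half_ge_of_RS_27
    (hRS : Literature.NumberTheory.LFunctions.RosserSchoenfeld1962_theorem2) :
    (1 : ℝ) / 27 ≤ schnirelmannDensity
      (({0, 1} : Set ℕ) ∪ {m | ∃ p q : ℕ, p.Prime ∧ q.Prime ∧ p + q = 2 * m}) := by
  have h := schnirelmannDensity_ge_of_count' (K := 27)
    (S := ({0, 1} : Set ℕ) ∪ {m | ∃ p q : ℕ, p.Prime ∧ q.Prime ∧ p + q = 2 * m})
    (fun N hN => by have := half_count_ge_allN_of_RS_27 hRS hN; exact_mod_cast this)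
  exact_mod_cast h

/-- ★★★★★★★★ **The Shnirel'man–Goldbach theorem, explicit and unconditional: every integer `N ≥ 2` is a sum of at
most `65` primes** (FOUR shifted copies of the primes `(p+q)/2`, `q ∈ {3,5,7,11}`, with
inclusion–exclusion and the tree's explicit pair sieve: `B(y) ≥ (7.3696y − 24)/log 2y − 2 − 248.5y/log²2y ≥ y/32` up
to `e^192`; the Hölder-8 count of §14/§15 at `e^114` (sieve, `A = 14.6`) and `e^192` (count): `|T| ≥ x/64`; halving,
Mann: `32 • B = ℕ`, `2·32 + 1`).  No hypotheses, no named facts.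
[cite: Nathanson1996, Thm 7.9 (explicit constant proved here)] -/
theorem schnirelmann_goldbach_le_65 (N : ℕ) (hN : 2 ≤ N) :
    ∃ M : Multiset ℕ, (∀ p ∈ M, p.Prime) ∧ Multiset.card M ≤ 65 ∧ M.sum = N := by
  have hσ : (1 : ℝ) / ((32 : ℕ) : ℝ) ≤ schnirelmannDensity
      (({0, 1} : Set ℕ) ∪ {m | ∃ p q : ℕ, p.Prime ∧ q.Prime ∧ p + q = 2 * m}) := by
    have := schnirelmannDensity_half_ge_32
    exact_mod_cast this
  exact sum_of_primes_of_half_density_mann (h := 32) (by norm_num) hσ N hN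

/-- ★★ **Under Rosser–Schoenfeld (3.3): every integer `N ≥ 2` is a sum of at most `55` primes** (`σ(B) ≥ 1/27`;
four-shift glue with `π(n) ≥ n/log n`, `n ≥ 67`). [cite: RosserSchoenfeld1962, Theorem 2, eq. (3.3) (as input)] -/
theorem schnirelmann_goldbach_of_RS_le_55 (hRS : Literature.NumberTheory.LFunctions.RosserSchoenfeld1962_theorem2)
    (N : ℕ) (hN : 2 ≤ N) :
    ∃ M : Multiset ℕ, (∀ p ∈ M, p.Prime) ∧ Multiset.card M ≤ 55 ∧ M.sum = N := by
  have hσ : (1 : ℝ) / ((27 : ℕ) : ℝ) ≤ schnirelmannDensity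
      (({0, 1} : Set ℕ) ∪ {m | ∃ p q : ℕ, p.Prime ∧ q.Prime ∧ p + q = 2 * m}) := by
    have := schnirelmannDensity_half_ge_of_RS_27 hRS
    exact_mod_cast this
  exact sum_of_primes_of_half_density_mann (h := 27) (by norm_num) hσ N hN

/-! ## §17 ROUND-32 «DISCARD»: the small-`N` discard keeps its `Λ₀`-dependence — threshold gap `Λs + 10 ≤ Λ₀`,
`K = 63` (RS: `53`)

The near-miss of §16 is the THRESHOLD GAP: in §15's generic Hölder count the `N < e^{Λs}` are discarded through
`m(N) ≤ ℓ_200²/t_200 = ℓ_200²·e^{−ℓ_200} ≤ 49.5²·e^{−49.5}` — the value of the decreasing function `ℓ²e^{−ℓ}` at the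
smallest admissible bottom level `ℓ = 49.5` — so the discarded mass is `≈ e^{2Λs − 49.5}·2450` and must be `≤ 0.0056x`,
`x ≥ e^{Λ₀}`: `2Λs ≤ Λ₀ + 36.5`.  ONE INPUT VARIED: evaluate the same monotonicity at the ACTUAL bottom level
`ℓ_200 ≥ Λ₀ − 2` (`sq_le_sq_mul_exp : 2 ≤ a → a ≤ ℓ → ℓ² ≤ a²·e^{ℓ−a}`): `m(N) ≤ (Λ₀−2)²·e^{2−Λ₀}`, the discarded mass is
`≤ 1.0001²·(Λ₀−2)²·e^{2Λs + 2 − Λ₀} ≤ 1.0002·158404·e^{−18}·x ≤ 0.0025x` as soon as `Λs + 10 ≤ Λ₀ ≤ 400`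
(`goldbach_even_count_ge_holder_gap10`).  The sieve threshold can now sit `10` below the count threshold instead of at
its half: unconditionally `h = 31`, `Λ₀ = 187` (four-shift glue of §16 on `[57.1144, 187]`, `57.1144 = 1.8424·31`),
`Λs = 177`, `A = 14.08`, `x/62` (`(1/62)⁷·259.55·14.08⁸ = 0.114 ≤ (0.4242·gHol 187 − 0.0057)⁸ = 0.129`),
`σ(B) ≥ 1/31`, **`schnirelmann_goldbach_le_63`**; under (3.3) `h = 26`, `Λ₀ = 169`, `Λs = 159`, `A = 14.18`, `x/52`,
`σ(B) ≥ 1/26`, `schnirelmann_goldbach_of_RS_le_53` (the RS four-shift glue `half_count_ge_allN_bonf_RS` needs only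
`h ≥ 18`). -/

/-! #### §17.1 The count with threshold gap `Λs + 10 ≤ Λ₀` -/

/-- `ℓ² ≤ a²·e^{ℓ − a}` for `ℓ ≥ a ≥ 2` (`ℓ²e^{−ℓ}` is decreasing on `[2, ∞)`). [folklore] -/
private theorem sq_le_sq_mul_exp {a l : ℝ} (ha : 2 ≤ a) (hl : a ≤ l) : l ^ 2 ≤ a ^ 2 * Real.exp (l - a) := by
  set u := l - a with hu
  have hu0 : 0 ≤ u := by linarith
  have ha0 : 0 ≤ a := by linarith
  have h1 : 1 + u / 2 ≤ Real.exp (u / 2) := by have := Real.add_one_le_exp (u / 2); linarith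
  have h2 : (1 + u / 2) ^ 2 ≤ Real.exp (u / 2) ^ 2 := pow_le_pow_left₀ (by linarith) h1 2
  have h3 : Real.exp (u / 2) ^ 2 = Real.exp u := by rw [← Real.exp_nat_mul]; ring_nf
  rw [h3] at h2
  have hl' : l = a + u := by linarith
  rw [hl']
  have h4 : a ^ 2 * (1 + u / 2) ^ 2 ≤ a ^ 2 * Real.exp u := mul_le_mul_of_nonneg_left h2 (sq_nonneg a)
  have h5 : 0 ≤ u * a * (a - 2) := mul_nonneg (mul_nonneg hu0 ha0) (sub_nonneg.2 ha)
  have h6 : 0 ≤ u ^ 2 * (a - 2) * (a + 2) := mul_nonneg (mul_nonneg (sq_nonneg u) (sub_nonneg.2 ha)) (by linarith)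
  nlinarith [h4, h5, h6]

/-- `e¹⁸ ≥ 6.5·10⁷`. [folklore] -/
private theorem exp_18_ge : (65000000 : ℝ) ≤ Real.exp 18 := by
  have he : (2.718281828 : ℝ) ≤ Real.exp 1 := by have := Real.exp_one_gt_d9; linarith
  have h := pow_le_pow_left₀ (by norm_num) he 18
  rw [← Real.exp_nat_mul] at h
  norm_num at h
  exact le_trans (by norm_num) h

set_option maxHeartbeats 1600000 in
/-- **Hölder with the staircase weight (`J = 200`), threshold gap `Λs + 10 ≤ Λ₀`**: §15's
`goldbach_even_count_ge_holder_gap` with the discard of the `N < e^{Λs}` done at the actual bottom level: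
`m(N) ≤ ℓ_200²e^{−ℓ_200} ≤ (Λ₀−2)²e^{2−Λ₀}`, so `(e^{Λs}+1)²·(Λ₀−2)²·e^{2−Λ₀} ≤ 1.0001²·158404·e^{−18}·x ≤ 0.0056·x`
for `Λs + 10 ≤ Λ₀ ≤ 400`, `x ≥ e^{Λ₀}` (`Λ₀ ≥ 51.5`, `Λs ≥ 41`); the rest verbatim: if `r(N) ≤ A·f(N)·N/log²N` for even
`N ≥ e^{Λs}` and `S₁(y) ≥ c₁·y²/log²y` for `y ≥ e^{Λs}`, then with `F = (c₁ − 10⁻⁴)·gHol(Λ₀) − 0.0057`: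
`#{even N ∈ (0,x] : N = p+q} ≥ κ·x` whenever `κ⁷·259.55·A⁸ ≤ F⁸`.
[cite: Nathanson1996, Thm 7.8 (Hölder variant proved here)] -/
theorem goldbach_even_count_ge_holder_gap10 {Λs Λ₀ A c₁ κ : ℝ} (hΛs : 41 ≤ Λs) (h2Λ : Λs + 10 ≤ Λ₀)
    (hΛ₀ : 51.5 ≤ Λ₀) (hΛ₀4 : Λ₀ ≤ 400)
    (hA : 1 ≤ A)
    (hpt : ∀ N : ℕ, Real.exp Λs ≤ (N : ℝ) → Even N →
      (SingularSeries.goldbachCount N : ℝ) ≤ A * oddSingularFactor N * (N : ℝ) / Real.log (N : ℝ) ^ 2)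
    (hc₁ : 0.0001 ≤ c₁) (hc₁1 : c₁ ≤ 1)
    (hS₁ : ∀ y : ℕ, Real.exp Λs ≤ (y : ℝ) →
      c₁ * ((y : ℝ) ^ 2 / Real.log y ^ 2) ≤ ∑ N ∈ range (y + 1), (SingularSeries.goldbachCount N : ℝ))
    (hF0 : 0 ≤ (c₁ - 0.0001) * gHol Λ₀ - 0.0057)
    (hκ : κ ^ 7 * (259.55 * A ^ 8) ≤ ((c₁ - 0.0001) * gHol Λ₀ - 0.0057) ^ 8)
    {x : ℕ} (hx : Real.exp Λ₀ ≤ (x : ℝ)) :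
    κ * (x : ℝ) ≤ #{N ∈ Ioc 0 x | Even N ∧ ∃ p q : ℕ, p.Prime ∧ q.Prime ∧ p + q = N} := by
  -- basics
  have hx515 : Real.exp 51.5 ≤ (x : ℝ) := (Real.exp_le_exp.mpr hΛ₀).trans hx
  have hx1 : (1 : ℝ) < x := lt_of_lt_of_le (by have := Real.add_one_le_exp (51.5 : ℝ); linarith) hx515
  have hx0 : (0 : ℝ) < x := by linarith
  have hxN : 0 < x := by exact_mod_cast hx0
  set L := Real.log (x : ℝ) with hL_def
  have hLΛ₀ : Λ₀ ≤ L := by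
    have := Real.log_le_log (Real.exp_pos Λ₀) hx
    rwa [Real.log_exp] at this
  have hΛs0 : 0 < Λs := by linarith
  have hA0 : 0 ≤ A := by linarith
  -- the bottom level `ℓ_200 ≥ Λ₀ − 2 ≥ 49.5`
  have hℓ200 : Λ₀ - 2 ≤ stairL x 200 := by
    have := stairL_ge x 200
    push_cast at this
    linarith
  have hℓ495 : 49.5 ≤ stairL x 200 := by linarith
  have hℓ3 : 3 ≤ stairL x 200 := by linarith
  have ht200 : stairT x 200 = Real.exp (stairL x 200) := by
    rw [← log_stairT hxN 200, Real.exp_log (stairT_pos hxN 200)]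
  have hbotΛ : Real.exp Λs ≤ stairT x 200 := by rw [ht200]; exact Real.exp_le_exp.mpr (by linarith)
  have hbotS : Real.exp Λs + 1 ≤ stairT x 200 := by
    rw [ht200]
    have h1 : Real.exp (Λs + 1) ≤ Real.exp (stairL x 200) := Real.exp_le_exp.mpr (by linarith)
    have h2 : Real.exp (Λs + 1) = Real.exp Λs * Real.exp 1 := by rw [Real.exp_add]
    have h3 : (2 : ℝ) ≤ Real.exp 1 := by have := Real.add_one_le_exp (1 : ℝ); linarith
    have h4 : (1 : ℝ) ≤ Real.exp Λs := by have := Real.add_one_le_exp Λs; linarith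
    nlinarith [Real.exp_pos Λs]
  have hbot2 : (2 : ℝ) ≤ stairT x 200 := by
    have h4 : (1 : ℝ) ≤ Real.exp Λs := by have := Real.add_one_le_exp Λs; linarith
    linarith
  -- notation
  set r : ℕ → ℝ := fun N => (SingularSeries.goldbachCount N : ℝ) with hr
  set f : ℕ → ℝ := fun N => oddSingularFactor N with hf_def
  set m : ℕ → ℝ := stairW x 200 with hm
  have hm0 : ∀ N, 0 ≤ m N := fun N => stairW_nonneg hxN hℓ3 N
  set c₁' := c₁ - 0.0001 with hc₁'
  have hc₁'0 : 0 ≤ c₁' := by rw [hc₁']; linarith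
  have hc₁'1 : c₁' ≤ 1 := by rw [hc₁']; linarith
  set g := gHol Λ₀ with hg
  set F := c₁' * g - 0.0057 with hF_def
  set E : Finset ℕ := (range (x + 1)).filter Even with hE
  -- LOWER: `Σ_E r·m ≥ c₁'·(g·x − 21)`
  have hlower : c₁' * (g * x - 21) ≤ ∑ N ∈ E, r N * m N := by
    rw [hm, sum_mul_stairW x 200 E r]
    have hterm : ∀ j ∈ range 200, stairC x j * (c₁' * ((stairT x j - 1) ^ 2 / stairL x j ^ 2))
        ≤ stairC x j * ∑ N ∈ E.filter (fun N : ℕ => (N : ℝ) ≤ stairT x j), r N := by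
      intro j hj
      rw [mem_range] at hj
      apply mul_le_mul_of_nonneg_left _ (stairC_nonneg hxN hj hℓ3)
      rw [hE, hr]
      exact level_lower' hΛs hS₁ hc₁ hxN (hbotS.trans (stairT_le_of_le x hj.le))
    refine le_trans ?_ (sum_le_sum hterm)
    have e : ∑ j ∈ range 200, stairC x j * (c₁' * ((stairT x j - 1) ^ 2 / stairL x j ^ 2))
        = c₁' * ∑ j ∈ range 200, stairC x j * ((stairT x j - 1) ^ 2 / stairL x j ^ 2) := by
      rw [mul_sum]
      exact sum_congr rfl fun j _ => by ring
    rw [e]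
    exact mul_le_mul_of_nonneg_left (stair_lower_sum_ge200 hxN (by linarith) hLΛ₀ hbot2) hc₁'0
  -- the small `N < e^{Λs}`: `Σ r·m ≤ 0.0056·x`
  set Ehi : Finset ℕ := E.filter (fun N : ℕ => Real.exp Λs ≤ (N : ℝ)) with hEhi
  set Elo : Finset ℕ := E.filter (fun N : ℕ => ¬(Real.exp Λs ≤ (N : ℝ))) with hElo
  have hsplit : ∑ N ∈ E, r N * m N = ∑ N ∈ Ehi, r N * m N + ∑ N ∈ Elo, r N * m N :=
    (sum_filter_add_sum_filter_not E (fun N : ℕ => Real.exp Λs ≤ (N : ℝ)) (fun N => r N * m N)).symm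
  have hMtop : stairMf x 200 ≤ (Λ₀ - 2) ^ 2 * Real.exp (-(Λ₀ - 2)) := by
    show stairM x 199 ≤ _
    unfold stairM
    have ht199 := stairT_pos hxN 199
    have h1 : stairL x (199 + 1) ^ 2 / stairT x 199 ≤ stairL x 200 ^ 2 / stairT x 200 :=
      div_le_div_of_nonneg_left (sq_nonneg _) (stairT_pos hxN 200) (stairT_le_of_le x (by norm_num))
    refine h1.trans ?_
    rw [ht200, div_le_iff₀ (Real.exp_pos _)]
    have h2 := sq_le_sq_mul_exp (a := Λ₀ - 2) (by linarith) hℓ200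
    have e : (Λ₀ - 2) ^ 2 * Real.exp (stairL x 200 - (Λ₀ - 2))
        = (Λ₀ - 2) ^ 2 * Real.exp (-(Λ₀ - 2)) * Real.exp (stairL x 200) := by
      rw [show stairL x 200 - (Λ₀ - 2) = -(Λ₀ - 2) + stairL x 200 by ring, Real.exp_add]; ring
    linarith [e]
  have hlo : ∑ N ∈ Elo, r N * m N ≤ 0.0056 * x := by
    have hterm : ∀ N ∈ Elo, r N * m N ≤ (Real.exp Λs + 1) * ((Λ₀ - 2) ^ 2 * Real.exp (-(Λ₀ - 2))) := by
      intro N hN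
      rw [hElo, mem_filter] at hN
      have hNlt : (N : ℝ) < Real.exp Λs := not_le.mp hN.2
      have h1 : r N ≤ Real.exp Λs + 1 := by
        have : r N ≤ (N : ℝ) + 1 := by
          show (SingularSeries.goldbachCount N : ℝ) ≤ (N : ℝ) + 1
          exact_mod_cast goldbachCount_le_succ N
        linarith
      have h2 : m N ≤ (Λ₀ - 2) ^ 2 * Real.exp (-(Λ₀ - 2)) := (stairW_le_stairMf hxN hℓ3 N).trans hMtop
      have hr0 : 0 ≤ r N := Nat.cast_nonneg _
      exact mul_le_mul h1 h2 (hm0 N) (by positivity)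
    have hcard : (#Elo : ℝ) ≤ Real.exp Λs + 1 := by
      have hsub : Elo ⊆ range (⌊Real.exp Λs⌋₊ + 1) := by
        intro N hN
        rw [hElo, mem_filter] at hN
        have hNlt : (N : ℝ) < Real.exp Λs := not_le.mp hN.2
        rw [mem_range]
        have := Nat.le_floor hNlt.le
        omega
      have h1 := card_le_card hsub
      rw [card_range] at h1
      have h2 : (#Elo : ℝ) ≤ (⌊Real.exp Λs⌋₊ : ℝ) + 1 := by exact_mod_cast h1
      have h3 : (⌊Real.exp Λs⌋₊ : ℝ) ≤ Real.exp Λs := Nat.floor_le (Real.exp_pos Λs).le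
      linarith
    have hs := sum_le_sum hterm
    rw [sum_const, nsmul_eq_mul] at hs
    refine hs.trans ?_
    -- `(e^Λs + 1)² · (Λ₀−2)² · e^{2−Λ₀} ≤ 0.0056·x` from `Λs + 10 ≤ Λ₀ ≤ 400` and `e^{Λ₀} ≤ x`
    have heΛ' : Real.exp Λs + 1 ≤ 1.0001 * Real.exp Λs := by
      have : (10000 : ℝ) ≤ Real.exp Λs := by
        have h13 := exp_13_ge
        have : Real.exp 13 ≤ Real.exp Λs := Real.exp_le_exp.mpr (by linarith)
        linarith
      linarith
    have hpos1 : 0 ≤ Real.exp Λs + 1 := by positivity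
    have hx18 : Real.exp (2 * Λs) * Real.exp (-(Λ₀ - 2)) ≤ Real.exp (-18) * x := by
      have e1 : Real.exp (2 * Λs) * Real.exp (-(Λ₀ - 2)) = Real.exp (2 * Λs + -(Λ₀ - 2)) := by
        rw [← Real.exp_add]
      have e2 : Real.exp (2 * Λs + -(Λ₀ - 2)) ≤ Real.exp (-18 + Λ₀) := Real.exp_le_exp.mpr (by linarith)
      have e3 : Real.exp (-18 + Λ₀) = Real.exp (-18) * Real.exp Λ₀ := Real.exp_add _ _
      rw [e1]
      refine e2.trans ?_
      rw [e3]
      exact mul_le_mul_of_nonneg_left hx (Real.exp_pos _).le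
    have h18 : Real.exp (-18) ≤ 1 / 65000000 := by
      rw [Real.exp_neg, one_div]
      exact inv_anti₀ (by norm_num) exp_18_ge
    have hΛsq : (Λ₀ - 2) ^ 2 ≤ 158404 := by nlinarith [hΛ₀4, hΛ₀]
    have e2Λ : Real.exp Λs * Real.exp Λs = Real.exp (2 * Λs) := by rw [← Real.exp_add]; ring_nf
    calc (#Elo : ℝ) * ((Real.exp Λs + 1) * ((Λ₀ - 2) ^ 2 * Real.exp (-(Λ₀ - 2))))
        ≤ (Real.exp Λs + 1) * ((Real.exp Λs + 1) * ((Λ₀ - 2) ^ 2 * Real.exp (-(Λ₀ - 2)))) :=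
          mul_le_mul_of_nonneg_right hcard (by positivity)
      _ ≤ (1.0001 * Real.exp Λs) * ((1.0001 * Real.exp Λs) * ((Λ₀ - 2) ^ 2 * Real.exp (-(Λ₀ - 2)))) :=
          mul_le_mul heΛ' (mul_le_mul_of_nonneg_right heΛ' (by positivity)) (by positivity) (by positivity)
      _ = 1.0001 ^ 2 * ((Λ₀ - 2) ^ 2 * (Real.exp (2 * Λs) * Real.exp (-(Λ₀ - 2)))) := by rw [← e2Λ]; ring
      _ ≤ 1.0001 ^ 2 * ((Λ₀ - 2) ^ 2 * (Real.exp (-18) * x)) :=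
          mul_le_mul_of_nonneg_left (mul_le_mul_of_nonneg_left hx18 (sq_nonneg _)) (by norm_num)
      _ ≤ 1.0001 ^ 2 * (158404 * ((1 / 65000000) * x)) :=
          mul_le_mul_of_nonneg_left (mul_le_mul hΛsq (mul_le_mul_of_nonneg_right h18 hx0.le)
            (by positivity) (by norm_num)) (by norm_num)
      _ ≤ 0.0056 * x := by nlinarith
  -- UPPER, pointwise on `T = {N ∈ Ehi : r(N) > 0}`: `r·m ≤ A·f`
  set T : Finset ℕ := Ehi.filter fun N => 0 < SingularSeries.goldbachCount N with hT
  have hpoint : ∀ N ∈ T, r N * m N ≤ A * f N := by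
    intro N hN
    rw [hT, mem_filter, hEhi, mem_filter, hE, mem_filter, mem_range] at hN
    obtain ⟨⟨⟨hNx, hev⟩, hNΛ⟩, _⟩ := hN
    have hNx' : (N : ℝ) ≤ x := by exact_mod_cast Nat.lt_succ_iff.mp hNx
    by_cases hQ : stairT x 200 < (N : ℝ)
    · exact stair_rm_le_main200 hxN hΛs0 hA0 hpt hbotΛ hev hNx' hQ
    · exact stair_rm_le_bottom200 hxN (by linarith) hA0 hpt hev hNΛ (not_lt.mp hQ)
  have hsumT : ∑ N ∈ Ehi, r N * m N = ∑ N ∈ T, r N * m N := by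
    have h := Finset.sum_filter_of_ne (s := Ehi) (f := fun N => r N * m N)
      (p := fun N => 0 < SingularSeries.goldbachCount N) (fun N _ hne => by
        by_contra h0
        apply hne
        simp only [not_lt, Nat.le_zero] at h0
        simp [hr, h0])
    rw [hT, h]
  have hupper : ∑ N ∈ T, r N * m N ≤ A * ∑ N ∈ T, f N := by
    rw [mul_sum]
    exact sum_le_sum hpoint
  -- `F·x ≤ A·Σ_T f`
  have hx21 : (21 : ℝ) + 0.0056 * x ≤ 0.0057 * x + 0 := by
    have : (210000 : ℝ) ≤ x := by
      have h13 := exp_13_ge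
      have : Real.exp 13 ≤ Real.exp 51.5 := Real.exp_le_exp.mpr (by norm_num)
      linarith
    linarith
  have hFx : F * x ≤ A * ∑ N ∈ T, f N := by
    have h1 : c₁' * (g * x - 21) - 0.0056 * x ≤ ∑ N ∈ T, r N * m N := by
      rw [← hsumT]; linarith [hsplit, hlower, hlo]
    have h2 : F * x ≤ c₁' * (g * x - 21) - 0.0056 * x := by
      rw [hF_def]
      have : c₁' * 21 ≤ 21 := by nlinarith
      nlinarith
    exact h2.trans (h1.trans hupper)
  -- Hölder on `T`
  set Ep : Finset ℕ := (Ioc 0 x).filter Even with hEp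
  have hTA : T ⊆ {N ∈ Ioc 0 x | Even N ∧ ∃ p q : ℕ, p.Prime ∧ q.Prime ∧ p + q = N} := by
    intro N hN
    rw [hT, mem_filter, hEhi, mem_filter, hE, mem_filter, mem_range] at hN
    obtain ⟨⟨⟨hNx, he⟩, _⟩, hpos⟩ := hN
    unfold SingularSeries.goldbachCount at hpos
    obtain ⟨pq, hpq⟩ := card_pos.mp hpos
    rw [mem_filter, Finset.HasAntidiagonal.mem_antidiagonal] at hpq
    have hN2 : 2 ≤ N := by
      have := hpq.2.1.two_le
      omega
    rw [mem_filter, mem_Ioc]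
    exact ⟨⟨by omega, by omega⟩, he, pq.1, pq.2, hpq.2.1, hpq.2.2, hpq.1⟩
  have hTEp : T ⊆ Ep := by
    intro N hN
    have h := hTA hN
    rw [mem_filter] at h
    rw [hEp, mem_filter]
    exact ⟨h.1, h.2.1⟩
  have hf0 : ∀ N ∈ T, 0 ≤ f N := fun N _ => oddSingularFactor_nonneg N
  have hHolder : (∑ N ∈ T, f N) ^ 8 ≤ (#T : ℝ) ^ 7 * (259.55 * x) := by
    have h1 := pow8_sum_le T f hf0
    have h2 : ∑ N ∈ T, f N ^ 8 ≤ 259.55 * x :=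
      (sum_le_sum_of_subset_of_nonneg hTEp fun N _ _ => by positivity).trans
        (sum_even_oddSingularFactor_pow8_le x)
    exact h1.trans (mul_le_mul_of_nonneg_left h2 (by positivity))
  set Ax : ℝ := ((#{N ∈ Ioc 0 x | Even N ∧ ∃ p q : ℕ, p.Prime ∧ q.Prime ∧ p + q = N} : ℕ) : ℝ) with hAx
  have hTcard : (#T : ℝ) ≤ Ax := by rw [hAx]; exact_mod_cast card_le_card hTA
  -- the final algebra: `(F x)⁸ ≤ A⁸·|T|⁷·259.55·x` and `κ⁷·259.55·A⁸ ≤ F⁸` give `|T| ≥ κ·x`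
  have hF0' : 0 ≤ F := hF0
  have hFx0 : 0 ≤ F * x := mul_nonneg hF0' hx0.le
  have hchain : (F * x) ^ 8 ≤ A ^ 8 * ((#T : ℝ) ^ 7 * (259.55 * x)) := by
    calc (F * x) ^ 8 ≤ (A * ∑ N ∈ T, f N) ^ 8 := pow_le_pow_left₀ hFx0 hFx 8
      _ = A ^ 8 * (∑ N ∈ T, f N) ^ 8 := by ring
      _ ≤ A ^ 8 * ((#T : ℝ) ^ 7 * (259.55 * x)) := mul_le_mul_of_nonneg_left hHolder (by positivity)
  by_contra hcon
  rw [not_le] at hcon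
  have hTlt : (#T : ℝ) < κ * x := lt_of_le_of_lt hTcard hcon
  have h7 : (#T : ℝ) ^ 7 < (κ * x) ^ 7 := pow_lt_pow_left₀ hTlt (by positivity) (by norm_num)
  have hlt : A ^ 8 * ((#T : ℝ) ^ 7 * (259.55 * x)) < A ^ 8 * ((κ * x) ^ 7 * (259.55 * x)) := by
    apply mul_lt_mul_of_pos_left _ (by positivity)
    exact mul_lt_mul_of_pos_right h7 (by positivity)
  have e1 : A ^ 8 * ((κ * x) ^ 7 * (259.55 * x)) = κ ^ 7 * (259.55 * A ^ 8) * (x : ℝ) ^ 8 := by ring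
  have e2 : (F * x) ^ 8 = F ^ 8 * (x : ℝ) ^ 8 := by ring
  have hκx : κ ^ 7 * (259.55 * A ^ 8) * (x : ℝ) ^ 8 ≤ F ^ 8 * (x : ℝ) ^ 8 :=
    mul_le_mul_of_nonneg_right hκ (by positivity)
  linarith [hchain, hlt, e1, e2, hκx]

/-! #### §17.2 Instances: `K = 63` unconditionally, `K = 53` under (3.3) -/

/-- Numerics at `Λ = 177`: `17L² ≤ 16·14.06·TlowK(L/2 − 1.38632)` for `L ≥ 177`. [folklore] -/
private theorem kappa_numeric_177 {L : ℝ} (hL : 177 ≤ L) :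
    17 * L ^ 2 ≤ 16 * (14.08 - 0.02) * TwoResidueSelbergExplicit.TlowK (L / 2 - 1.38632) := by
  unfold TwoResidueSelbergExplicit.TlowK
  nlinarith [hL, mul_self_nonneg (L - 177)]

/-- **`A = 14.08` above `e^177`**. [cite: BatemanDiamond2004, §13.4 (13.13)–(13.14)] -/
theorem goldbachCount_le_1408 {N : ℕ} (hN : Real.exp 177 ≤ (N : ℝ)) (heven : Even N) :
    (SingularSeries.goldbachCount N : ℝ) ≤ 14.08 * oddSingularFactor N * (N : ℝ) / Real.log (N : ℝ) ^ 2 :=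
  goldbachCount_le_of_numeric41 (by norm_num) (fun _ hL => kappa_numeric_177 hL) hN heven

/-- Numerics at `Λ = 159`: `17L² ≤ 16·14.16·TlowK(L/2 − 1.38632)` for `L ≥ 159`. [folklore] -/
private theorem kappa_numeric_159 {L : ℝ} (hL : 159 ≤ L) :
    17 * L ^ 2 ≤ 16 * (14.18 - 0.02) * TwoResidueSelbergExplicit.TlowK (L / 2 - 1.38632) := by
  unfold TwoResidueSelbergExplicit.TlowK
  nlinarith [hL, mul_self_nonneg (L - 159)]

/-- **`A = 14.18` above `e^159`**. [cite: BatemanDiamond2004, §13.4 (13.13)–(13.14)] -/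
theorem goldbachCount_le_1418 {N : ℕ} (hN : Real.exp 159 ≤ (N : ℝ)) (heven : Even N) :
    (SingularSeries.goldbachCount N : ℝ) ≤ 14.18 * oddSingularFactor N * (N : ℝ) / Real.log (N : ℝ) ^ 2 :=
  goldbachCount_le_of_numeric41 (by norm_num) (fun _ hL => kappa_numeric_159 hL) hN heven

/-- **Unconditional, above `e^187`**: at least `x/62` EVEN Goldbach numbers in `(0, x]`
(`Λs = 177`, `A = 14.08`, `177 + 10 ≤ 187`; `(1/62)⁷·259.55·14.08⁸ = 0.114 ≤ (0.4242·gHol 187 − 0.0057)⁸ = 0.129`).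
[cite: Nathanson1996, Theorem 7.8 (proof, restricted to even N; explicit form proved here)] -/
theorem goldbach_even_count_ge_62_exp187 {x : ℕ} (hx : Real.exp 187 ≤ (x : ℝ)) :
    (x : ℝ) / 62 ≤ #{N ∈ Ioc 0 x | Even N ∧ ∃ p q : ℕ, p.Prime ∧ q.Prime ∧ p + q = N} := by
  have h := goldbach_even_count_ge_holder_gap10 (Λs := 177) (Λ₀ := 187) (A := 14.08) (c₁ := 0.4243) (κ := 1 / 62)
    (by norm_num) (by norm_num) (by norm_num) (by norm_num) (by norm_num)
    (fun N hN hev => goldbachCount_le_1408 hN hev) (by norm_num) (by norm_num)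
    (fun y hy => sum_goldbachCount_ge_04243' ((Real.exp_le_exp.mpr (by norm_num)).trans hy))
    (by unfold gHol; norm_num) (by unfold gHol; norm_num) hx
  have e : (1 : ℝ) / 62 * x = x / 62 := by ring
  rw [e] at h
  exact h

/-- **Under (3.3), above `e^169`**: at least `x/52` EVEN Goldbach numbers in `(0, x]`
(`Λs = 159`, `A = 14.18`, `159 + 10 ≤ 169`, `c₁ = 0.4995`). [cite: RosserSchoenfeld1962, Theorem 2, eq. (3.3) (as input)] -/
theorem goldbach_even_count_ge_of_RS_52 (hRS : Literature.NumberTheory.LFunctions.RosserSchoenfeld1962_theorem2)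
    {x : ℕ} (hx : Real.exp 169 ≤ (x : ℝ)) :
    (x : ℝ) / 52 ≤ #{N ∈ Ioc 0 x | Even N ∧ ∃ p q : ℕ, p.Prime ∧ q.Prime ∧ p + q = N} := by
  have h := goldbach_even_count_ge_holder_gap10 (Λs := 159) (Λ₀ := 169) (A := 14.18) (c₁ := 0.4995) (κ := 1 / 52)
    (by norm_num) (by norm_num) (by norm_num) (by norm_num) (by norm_num)
    (fun N hN hev => goldbachCount_le_1418 hN hev) (by norm_num) (by norm_num)
    (fun y hy => sum_goldbachCount_ge_of_RS' hRS ((Real.exp_le_exp.mpr (by norm_num)).trans hy))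
    (by unfold gHol; norm_num) (by unfold gHol; norm_num) hx
  have e : (1 : ℝ) / 52 * x = x / 52 := by ring
  rw [e] at h
  exact h

/-- **Unconditional count for all `y ≥ 1`**: `B(y) ≥ y/31` (four-shift glue on `(e^57.1144, e^187)`:
`L² + 31 ≤ 31·(7.3696L − 248.5)` there; `57.1144 = 1.8424·31`). [cite: Nathanson1996, Theorem 7.8 (explicit constant for the halved set proved here)] -/
theorem half_count_ge_allN_31 {y : ℕ} (hy : 1 ≤ y) :
    (y : ℝ) / 31 ≤ #{b ∈ Ioc 0 y | b ∈ (({0, 1} : Set ℕ) ∪ {m | ∃ p q : ℕ, p.Prime ∧ q.Prime ∧ p + q = 2 * m})} := by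
  have h := half_count_ge_allN_bonf (L₁ := 57.1144) (Λ₀ := 187) (h := 31) (by norm_num) (by norm_num)
    (by norm_num) (by norm_num)
    (fun L h1 h2 => by
      push_cast
      nlinarith [mul_nonneg (sub_nonneg.2 h1) (sub_nonneg.2 h2)])
    (fun x hx => by
      have h1 := goldbach_even_count_ge_62_exp187 hx
      have e : (x : ℝ) / (2 * ((31 : ℕ) : ℝ)) = (x : ℝ) / 62 := by norm_num
      rw [e]
      exact h1) hy
  exact_mod_cast h

/-- **Under (3.3), all `y ≥ 1`**: `B(y) ≥ y/26` (four-shift RS glue on `(e^52, e^169)`: `L² + 26 ≤ 26·(8L − 248.5)`).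
[cite: RosserSchoenfeld1962, Theorem 2, eq. (3.3) (as input)] -/
theorem half_count_ge_allN_of_RS_26 (hRS : Literature.NumberTheory.LFunctions.RosserSchoenfeld1962_theorem2)
    {y : ℕ} (hy : 1 ≤ y) :
    (y : ℝ) / 26 ≤ #{b ∈ Ioc 0 y | b ∈ (({0, 1} : Set ℕ) ∪ {m | ∃ p q : ℕ, p.Prime ∧ q.Prime ∧ p + q = 2 * m})} := by
  have h := half_count_ge_allN_bonf_RS hRS (L₁ := 52) (Λ₀ := 169) (h := 26) (by norm_num) (by norm_num)
    (by norm_num) (by norm_num)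
    (fun L h1 h2 => by
      push_cast
      nlinarith [mul_nonneg (sub_nonneg.2 h1) (sub_nonneg.2 h2)])
    (fun x hx => by
      have h1 := goldbach_even_count_ge_of_RS_52 hRS hx
      have e : (x : ℝ) / (2 * ((26 : ℕ) : ℝ)) = (x : ℝ) / 52 := by norm_num
      rw [e]
      exact h1) hy
  exact_mod_cast h

/-- **The halved density, `1/31`**: `σ({0, 1} ∪ {m : 2m = p + q}) ≥ 1/31`, unconditionally. [cite: Nathanson1996, Theorem 7.8 (explicit constant for the halved set proved here)] -/
theorem schnirelmannDensity_half_ge_31 :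
    (1 : ℝ) / 31 ≤ schnirelmannDensity
      (({0, 1} : Set ℕ) ∪ {m | ∃ p q : ℕ, p.Prime ∧ q.Prime ∧ p + q = 2 * m}) := by
  have h := schnirelmannDensity_ge_of_count' (K := 31)
    (S := ({0, 1} : Set ℕ) ∪ {m | ∃ p q : ℕ, p.Prime ∧ q.Prime ∧ p + q = 2 * m})
    (fun N hN => by have := half_count_ge_allN_31 hN; exact_mod_cast this)
  exact_mod_cast h

/-- **The halved density under (3.3), `1/26`**. [cite: RosserSchoenfeld1962, Theorem 2, eq. (3.3) (as input)] -/
theorem schnirelmannDensity_half_ge_of_RS_26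
    (hRS : Literature.NumberTheory.LFunctions.RosserSchoenfeld1962_theorem2) :
    (1 : ℝ) / 26 ≤ schnirelmannDensity
      (({0, 1} : Set ℕ) ∪ {m | ∃ p q : ℕ, p.Prime ∧ q.Prime ∧ p + q = 2 * m}) := by
  have h := schnirelmannDensity_ge_of_count' (K := 26)
    (S := ({0, 1} : Set ℕ) ∪ {m | ∃ p q : ℕ, p.Prime ∧ q.Prime ∧ p + q = 2 * m})
    (fun N hN => by have := half_count_ge_allN_of_RS_26 hRS hN; exact_mod_cast this)
  exact_mod_cast h

/-- ★★★★★★★★★ **Explicit and unconditional, §17: every integer `N ≥ 2` is a sum of at most `63` primes** (the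
small-`N` discard of the Hölder count done at the actual bottom level: threshold gap `Λs + 10 ≤ Λ₀`; sieve at `e^177`
(`A = 14.08`), count at `e^187` (`|T| ≥ x/62`); four-shift glue `B(y) ≥ y/31` below `e^187`; halving, Mann:
`31 • B = ℕ`, `2·31 + 1`; superseded by §18's `61`).  No hypotheses, no named facts.
[cite: Nathanson1996, Thm 7.9 (explicit constant proved here)] -/
theorem schnirelmann_goldbach_le_63 (N : ℕ) (hN : 2 ≤ N) :
    ∃ M : Multiset ℕ, (∀ p ∈ M, p.Prime) ∧ Multiset.card M ≤ 63 ∧ M.sum = N := by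
  have hσ : (1 : ℝ) / ((31 : ℕ) : ℝ) ≤ schnirelmannDensity
      (({0, 1} : Set ℕ) ∪ {m | ∃ p q : ℕ, p.Prime ∧ q.Prime ∧ p + q = 2 * m}) := by
    have := schnirelmannDensity_half_ge_31
    exact_mod_cast this
  exact sum_of_primes_of_half_density_mann (h := 31) (by norm_num) hσ N hN

/-- ★★ **Under Rosser–Schoenfeld (3.3): every integer `N ≥ 2` is a sum of at most `53` primes** (`σ(B) ≥ 1/26`;
gap `159 + 10 ≤ 169`, `A = 14.18`, `x/52`). [cite: RosserSchoenfeld1962, Theorem 2, eq. (3.3) (as input)] -/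
theorem schnirelmann_goldbach_of_RS_le_53 (hRS : Literature.NumberTheory.LFunctions.RosserSchoenfeld1962_theorem2)
    (N : ℕ) (hN : 2 ≤ N) :
    ∃ M : Multiset ℕ, (∀ p ∈ M, p.Prime) ∧ Multiset.card M ≤ 53 ∧ M.sum = N := by
  have hσ : (1 : ℝ) / ((26 : ℕ) : ℝ) ≤ schnirelmannDensity
      (({0, 1} : Set ℕ) ∪ {m | ∃ p q : ℕ, p.Prime ∧ q.Prime ∧ p + q = 2 * m}) := by
    have := schnirelmannDensity_half_ge_of_RS_26 hRS
    exact_mod_cast this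
  exact sum_of_primes_of_half_density_mann (h := 26) (by norm_num) hσ N hN

/-! ## §18 ROUND-33 «SEVEN SHIFTS»: a third glue regime with seven shifted copies `q ∈ {3,5,7,11,13,17,19}` —
`K = 61` (RS: `51`)

The near-miss of §17 is the pair (four-shift glue ceiling `Λ₀(h)`, sieve constant `A(Λ₀ − 10)`): at `h = 30` four
shifts reach only `Λ₀ = 179` (`A(169) = 14.12`, Hölder ratio `0.88`).  ONE INPUT VARIED: the number of shifted copies in
the top regime.  With `k` copies the main term of the inclusion–exclusion grows like `k·1.8424·y/L` and the pair weight like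
`35.5·Σ_{q<q'} f(q'−q)·y/L²`, so each `k` owns a window of `L = log 2y`; for `k = 7`, `q ∈ {3,5,7,11,13,17,19}` (21
pair terms with differences `2⁴ 4³ 6⁴ 8³ 10² 12² 14² 16¹`, `Σ f = 28.0667`, `f(10) = 4/3`, `f(12) = 2`, `f(14) = 6/5`,
`f(16) = 1`) the window at `h = 30` is `[106.8, 280.1]`, overlapping the four-shift window `[41.7, 179.4]`.  A general
list-Bonferroni lemma (`bonferroni_list`, induction with `inter_union_distrib_left`) gives `seven_shift_count`, the
three-regime glue `half_count_ge_allN_bonf7` (one shift `≤ e^{1.8424h}`, four shifts to `e^{L₂}`, seven to `e^{Λ₀}`)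
reaches `Λ₀ = 279` at `h = 30` (`L₂ = 150`), §17's count with gap `10` runs at `Λs = 269` (`A = 13.77`):
`x/60` (`(1/60)⁷·259.55·13.77⁸ = 0.1198 ≤ (0.4242·gHol 279 − 0.0057)⁸ = 0.1313`), `σ(B) ≥ 1/30`,
**`schnirelmann_goldbach_le_61`**; under (3.3) `h = 25`, `L₂ = 140`, `Λ₀ = 249`, `Λs = 239`, `A = 13.84`, `x/50`,
`σ(B) ≥ 1/25`, `schnirelmann_goldbach_of_RS_le_51`. -/

/-! #### §18.1 Inclusion–exclusion for a list of finsets; seven shifts -/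

/-- Sum of the cardinalities of the pairwise intersections of a list of finsets (each pair once, list order). [folklore] -/
def pairInterSum : List (Finset ℕ) → ℕ
  | [] => 0
  | s :: t => (t.map (fun u => #(s ∩ u))).sum + pairInterSum t

/-- `#(s ∩ ⋃ t) ≤ Σ_{u ∈ t} #(s ∩ u)`. [folklore] -/
private theorem card_inter_foldr_union_le (s : Finset ℕ) (t : List (Finset ℕ)) :
    #(s ∩ t.foldr (· ∪ ·) ∅) ≤ (t.map (fun u => #(s ∩ u))).sum := by
  induction t with
  | nil => simp
  | cons u v ih =>
    simp only [List.foldr_cons, List.map_cons, List.sum_cons]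
    rw [inter_union_distrib_left]
    exact (card_union_le _ _).trans (Nat.add_le_add_left ih _)

/-- **Two-term Bonferroni lower bound for a list of finsets**, subtraction-free:
`Σ #Sᵢ ≤ #(⋃ Sᵢ) + Σ_{i<j} #(Sᵢ ∩ Sⱼ)`. [folklore] -/
private theorem bonferroni_list (L : List (Finset ℕ)) :
    (L.map Finset.card).sum ≤ #(L.foldr (· ∪ ·) ∅) + pairInterSum L := by
  induction L with
  | nil => simp [pairInterSum]
  | cons s t ih =>
    simp only [List.map_cons, List.sum_cons, List.foldr_cons, pairInterSum]
    have h1 := card_union_add_card_inter s (t.foldr (· ∪ ·) ∅)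
    have h2 := card_inter_foldr_union_le s t
    omega

/-- **Seven shifts with inclusion–exclusion**: for `2y ≥ 21`,
`Σ_{q ∈ {3,5,7,11,13,17,19}} π(2y−q) ≤ B(y) + 5 + 4P₂ + 3P₄ + 4P₆ + 3P₈ + 2P₁₀ + 2P₁₂ + 2P₁₄ + P₁₆`,
`P_d = #{p ≤ 2y prime : p + d prime}`. [cite: Nathanson1996, Theorem 7.8 (seven shifted embeddings of the primes into the halved set, with two-term inclusion–exclusion; proved here)] -/
theorem seven_shift_count {y : ℕ} (hy : 21 ≤ 2 * y) :
    Nat.primeCounting (2 * y - 3) + Nat.primeCounting (2 * y - 5) + Nat.primeCounting (2 * y - 7)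
        + Nat.primeCounting (2 * y - 11) + Nat.primeCounting (2 * y - 13) + Nat.primeCounting (2 * y - 17)
        + Nat.primeCounting (2 * y - 19)
      ≤ #{b ∈ Ioc 0 y | b ∈ (({0, 1} : Set ℕ) ∪ {m | ∃ p q : ℕ, p.Prime ∧ q.Prime ∧ p + q = 2 * m})} + 5
        + (4 * #((Nat.primesLE (2 * y)).filter (fun p => (p + 2).Prime))
          + 3 * #((Nat.primesLE (2 * y)).filter (fun p => (p + 4).Prime))
          + 4 * #((Nat.primesLE (2 * y)).filter (fun p => (p + 6).Prime))
          + 3 * #((Nat.primesLE (2 * y)).filter (fun p => (p + 8).Prime))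
          + 2 * #((Nat.primesLE (2 * y)).filter (fun p => (p + 10).Prime))
          + 2 * #((Nat.primesLE (2 * y)).filter (fun p => (p + 12).Prime))
          + 2 * #((Nat.primesLE (2 * y)).filter (fun p => (p + 14).Prime))
          + #((Nat.primesLE (2 * y)).filter (fun p => (p + 16).Prime))) := by
  have h3 := card_shiftImg (q := 3) (y := y) (by norm_num) (by omega)
  have h5 := card_shiftImg (q := 5) (y := y) (by norm_num) (by omega)
  have h7 := card_shiftImg (q := 7) (y := y) (by norm_num) (by omega)
  have h11 := card_shiftImg (q := 11) (y := y) (by norm_num) (by omega)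
  have h13 := card_shiftImg (q := 13) (y := y) (by norm_num) (by omega)
  have h17 := card_shiftImg (q := 17) (y := y) (by norm_num) (by omega)
  have h19 := card_shiftImg (q := 19) (y := y) (by norm_num) (by omega)
  have hbon := bonferroni_list
    [shiftImg 3 y, shiftImg 5 y, shiftImg 7 y, shiftImg 11 y, shiftImg 13 y, shiftImg 17 y, shiftImg 19 y]
  simp only [List.map_cons, List.map_nil, List.sum_cons, List.sum_nil, List.foldr_cons, List.foldr_nil,
    pairInterSum, add_zero, union_empty] at hbon
  have i3_5 := card_shiftImg_inter_le (q := 3) (q' := 5) (d := 2) (y := y) (by norm_num) (by norm_num)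
    (by norm_num)
  have i3_7 := card_shiftImg_inter_le (q := 3) (q' := 7) (d := 4) (y := y) (by norm_num) (by norm_num)
    (by norm_num)
  have i3_11 := card_shiftImg_inter_le (q := 3) (q' := 11) (d := 8) (y := y) (by norm_num) (by norm_num)
    (by norm_num)
  have i3_13 := card_shiftImg_inter_le (q := 3) (q' := 13) (d := 10) (y := y) (by norm_num) (by norm_num)
    (by norm_num)
  have i3_17 := card_shiftImg_inter_le (q := 3) (q' := 17) (d := 14) (y := y) (by norm_num) (by norm_num)
    (by norm_num)
  have i3_19 := card_shiftImg_inter_le (q := 3) (q' := 19) (d := 16) (y := y) (by norm_num) (by norm_num)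
    (by norm_num)
  have i5_7 := card_shiftImg_inter_le (q := 5) (q' := 7) (d := 2) (y := y) (by norm_num) (by norm_num)
    (by norm_num)
  have i5_11 := card_shiftImg_inter_le (q := 5) (q' := 11) (d := 6) (y := y) (by norm_num) (by norm_num)
    (by norm_num)
  have i5_13 := card_shiftImg_inter_le (q := 5) (q' := 13) (d := 8) (y := y) (by norm_num) (by norm_num)
    (by norm_num)
  have i5_17 := card_shiftImg_inter_le (q := 5) (q' := 17) (d := 12) (y := y) (by norm_num) (by norm_num)
    (by norm_num)
  have i5_19 := card_shiftImg_inter_le (q := 5) (q' := 19) (d := 14) (y := y) (by norm_num) (by norm_num)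
    (by norm_num)
  have i7_11 := card_shiftImg_inter_le (q := 7) (q' := 11) (d := 4) (y := y) (by norm_num) (by norm_num)
    (by norm_num)
  have i7_13 := card_shiftImg_inter_le (q := 7) (q' := 13) (d := 6) (y := y) (by norm_num) (by norm_num)
    (by norm_num)
  have i7_17 := card_shiftImg_inter_le (q := 7) (q' := 17) (d := 10) (y := y) (by norm_num) (by norm_num)
    (by norm_num)
  have i7_19 := card_shiftImg_inter_le (q := 7) (q' := 19) (d := 12) (y := y) (by norm_num) (by norm_num)
    (by norm_num)
  have i11_13 := card_shiftImg_inter_le (q := 11) (q' := 13) (d := 2) (y := y) (by norm_num) (by norm_num)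
    (by norm_num)
  have i11_17 := card_shiftImg_inter_le (q := 11) (q' := 17) (d := 6) (y := y) (by norm_num) (by norm_num)
    (by norm_num)
  have i11_19 := card_shiftImg_inter_le (q := 11) (q' := 19) (d := 8) (y := y) (by norm_num) (by norm_num)
    (by norm_num)
  have i13_17 := card_shiftImg_inter_le (q := 13) (q' := 17) (d := 4) (y := y) (by norm_num) (by norm_num)
    (by norm_num)
  have i13_19 := card_shiftImg_inter_le (q := 13) (q' := 19) (d := 6) (y := y) (by norm_num) (by norm_num)
    (by norm_num)
  have i17_19 := card_shiftImg_inter_le (q := 17) (q' := 19) (d := 2) (y := y) (by norm_num) (by norm_num)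
    (by norm_num)
  set U := shiftImg 3 y ∪ (shiftImg 5 y ∪ (shiftImg 7 y ∪ (shiftImg 11 y ∪ (shiftImg 13 y ∪ (shiftImg 17 y
    ∪ shiftImg 19 y))))) with hU
  have hUsub : U ⊆ {b ∈ Ioc 0 y | b ∈ (({0, 1} : Set ℕ) ∪ {m | ∃ p q : ℕ, p.Prime ∧ q.Prime ∧ p + q = 2 * m})} :=
    union_subset (shiftImg_subset Nat.prime_three (by norm_num))
      (union_subset (shiftImg_subset (by norm_num) (by norm_num))
        (union_subset (shiftImg_subset (by norm_num) (by norm_num))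
          (union_subset (shiftImg_subset (by norm_num) (by norm_num))
            (union_subset (shiftImg_subset (by norm_num) (by norm_num))
              (union_subset (shiftImg_subset (by norm_num) (by norm_num))
                (shiftImg_subset (by norm_num) (by norm_num)))))))
  have hmemU : ∀ m ∈ U, 3 ≤ m := by
    intro m hm
    rw [hU] at hm
    simp only [mem_union] at hm
    rcases hm with hm | hm | hm | hm | hm | hm | hm
    all_goals
      unfold shiftImg at hm
      rw [mem_image] at hm
      obtain ⟨p, hp, rfl⟩ := hm
      rw [mem_oddPrimes_iff] at hp
      have h1 := hp.1.two_le
      have h2 := hp.2.1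
      omega
  have h2U : 2 ∉ U := fun h => by have := hmemU 2 h; omega
  have h1U : 1 ∉ insert 2 U := by
    rw [mem_insert]
    rintro (h | h)
    · omega
    · have := hmemU 1 h; omega
  have hsub : insert 1 (insert 2 U)
      ⊆ {b ∈ Ioc 0 y | b ∈ (({0, 1} : Set ℕ) ∪ {m | ∃ p q : ℕ, p.Prime ∧ q.Prime ∧ p + q = 2 * m})} := by
    intro b hb
    rw [mem_insert, mem_insert] at hb
    rcases hb with rfl | rfl | hb
    · rw [mem_filter, mem_Ioc]
      exact ⟨⟨by omega, by omega⟩, Or.inl (by simp)⟩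
    · rw [mem_filter, mem_Ioc]
      exact ⟨⟨by omega, by omega⟩, Or.inr ⟨2, 2, Nat.prime_two, Nat.prime_two, by norm_num⟩⟩
    · exact hUsub hb
  have hcard := card_le_card hsub
  rw [card_insert_of_notMem h1U, card_insert_of_notMem h2U] at hcard
  omega

/-! #### §18.2 Odd singular factors of the new differences -/

/-- `f(10) = 4/3`. [folklore] -/
private theorem oddSingularFactor_ten : oddSingularFactor 10 = 4 / 3 := by
  rw [show (10 : ℕ) = 2 ^ 1 * 5 by norm_num, GoldbachLinnik.oddSingularFactor_two_pow_mul 1 (by norm_num)]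
  show ∏ p ∈ (Nat.primeFactors 5).filter (2 < ·), (((p : ℝ) - 1) / ((p : ℝ) - 2)) = 4 / 3
  rw [Nat.prime_five.primeFactors, Finset.filter_singleton, if_pos (by norm_num), Finset.prod_singleton]
  norm_num

/-- `f(12) = 2`. [folklore] -/
private theorem oddSingularFactor_twelve : oddSingularFactor 12 = 2 := by
  rw [show (12 : ℕ) = 2 ^ 2 * 3 by norm_num, GoldbachLinnik.oddSingularFactor_two_pow_mul 2 (by norm_num)]
  show ∏ p ∈ (Nat.primeFactors 3).filter (2 < ·), (((p : ℝ) - 1) / ((p : ℝ) - 2)) = 2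
  rw [Nat.prime_three.primeFactors, Finset.filter_singleton, if_pos (by norm_num), Finset.prod_singleton]
  norm_num

/-- `f(14) = 6/5`. [folklore] -/
private theorem oddSingularFactor_fourteen : oddSingularFactor 14 = 6 / 5 := by
  rw [show (14 : ℕ) = 2 ^ 1 * 7 by norm_num, GoldbachLinnik.oddSingularFactor_two_pow_mul 1 (by norm_num)]
  show ∏ p ∈ (Nat.primeFactors 7).filter (2 < ·), (((p : ℝ) - 1) / ((p : ℝ) - 2)) = 6 / 5
  rw [(by norm_num : Nat.Prime 7).primeFactors, Finset.filter_singleton, if_pos (by norm_num), Finset.prod_singleton]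
  norm_num

/-- `f(16) = 1`. [folklore] -/
private theorem oddSingularFactor_sixteen : oddSingularFactor 16 = 1 := by
  rw [show (16 : ℕ) = 2 ^ 4 * 1 by norm_num, GoldbachLinnik.oddSingularFactor_two_pow_mul 4 one_ne_zero,
    GoldbachLinnik.oddSingularFactor_one]

/-! #### §18.3 The three-regime glue -/

set_option maxHeartbeats 1600000 in
/-- **All `y ≥ 1` for the halved set, THREE-REGIME glue (1 / 4 / 7 shifts)**: as `half_count_ge_allN_bonf`, with the
four-shift inequality `L² + h ≤ h·(7.3696·L − 248.5)` required only on `[L₁, L₂]` and, on `[L₂, Λ₀]`, SEVEN shifts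
`q ∈ {3,5,7,11,13,17,19}` (`seven_shift_count`: 21 pair terms, `Σ f = 28.0667`, weight `35.5·Σf = 996.37`; main term
`7·1.8424 = 12.8968`): `L² + h ≤ h·(12.8968·L − 996.37)`.
[cite: Nathanson1996, Thm 7.7 (all-`x` form; seven-shift inclusion–exclusion proved here)] -/
theorem half_count_ge_allN_bonf7 {L₁ L₂ Λ₀ : ℝ} {h : ℕ} (h28 : 28 ≤ h) (h41 : 41 ≤ L₁) (hL₁h : L₁ ≤ 1.8424 * h)
    (hΛ4 : Λ₀ ≤ 10000)
    (hquad : ∀ L : ℝ, L₁ ≤ L → L ≤ L₂ → L ^ 2 + h ≤ h * (7.3696 * L - 248.5))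
    (hquad7 : ∀ L : ℝ, L₂ ≤ L → L ≤ Λ₀ → L ^ 2 + h ≤ h * (12.8968 * L - 996.37))
    (hlarge : ∀ x : ℕ, Real.exp Λ₀ ≤ (x : ℝ) →
      (x : ℝ) / (2 * h) ≤ #{N ∈ Ioc 0 x | Even N ∧ ∃ p q : ℕ, p.Prime ∧ q.Prime ∧ p + q = N})
    {y : ℕ} (hy : 1 ≤ y) :
    (y : ℝ) / h ≤ #{b ∈ Ioc 0 y | b ∈ (({0, 1} : Set ℕ) ∪ {m | ∃ p q : ℕ, p.Prime ∧ q.Prime ∧ p + q = 2 * m})} := by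
  set B : Set ℕ := ({0, 1} : Set ℕ) ∪ {m | ∃ p q : ℕ, p.Prime ∧ q.Prime ∧ p + q = 2 * m} with hB
  have hhr : (28 : ℝ) ≤ h := by exact_mod_cast h28
  have hh0 : (0 : ℝ) < h := by linarith
  have hL₁pos : (0 : ℝ) < L₁ := by linarith
  by_cases hbig : Real.exp Λ₀ ≤ ((2 * y : ℕ) : ℝ)
  · have h1 := hlarge (2 * y) hbig
    have h2 := even_goldbach_card_le_half y
    have e : ((2 * y : ℕ) : ℝ) / (2 * h) = (y : ℝ) / h := by
      push_cast
      field_simp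
    rw [e] at h1
    exact h1.trans (by exact_mod_cast h2)
  rw [not_le] at hbig
  by_cases hsmall : y ≤ h
  · have h1 : 1 ≤ #{b ∈ Ioc 0 y | b ∈ B} :=
      card_pos.mpr ⟨1, by
        rw [mem_filter, mem_Ioc]
        exact ⟨⟨by omega, hy⟩, Or.inl (by simp)⟩⟩
    have h1' : (1 : ℝ) ≤ #{b ∈ Ioc 0 y | b ∈ B} := by exact_mod_cast h1
    have h2 : (y : ℝ) / h ≤ 1 := by
      rw [div_le_one hh0]
      exact_mod_cast hsmall
    linarith
  rw [not_le] at hsmall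
  have hy29 : 29 ≤ y := by omega
  have hnr : ((2 * y - 3 : ℕ) : ℝ) = 2 * (y : ℝ) - 3 := cast_two_mul_sub_three (by omega)
  have hy29r : (29 : ℝ) ≤ y := by exact_mod_cast hy29
  have hy0 : (0 : ℝ) < y := by linarith
  have hn55 : 55 ≤ 2 * y - 3 := by omega
  have hn0 : (0 : ℝ) < ((2 * y - 3 : ℕ) : ℝ) := by rw [hnr]; linarith
  have hn1 : (1 : ℝ) < ((2 * y - 3 : ℕ) : ℝ) := by rw [hnr]; linarith
  have hlogpos : 0 < Real.log ((2 * y - 3 : ℕ) : ℝ) := Real.log_pos hn1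
  by_cases hmid : Real.log ((2 * y - 3 : ℕ) : ℝ) ≤ L₁
  · -- ONE SHIFT below `e^{L₁}` (§15)
    have hemb := primeCounting_shift_le_half_count (y := y) (by omega)
    have hembr : (Nat.primeCounting (2 * y - 3) : ℝ) + 1 ≤ #{b ∈ Ioc 0 y | b ∈ B} := by exact_mod_cast hemb
    refine le_trans ?_ hembr
    by_cases h6 : 10 ^ 6 ≤ 2 * y - 3
    · have hπ : 0.9212 * ((2 * y - 3 : ℕ) : ℝ) / Real.log ((2 * y - 3 : ℕ) : ℝ)
          ≤ (Nat.primeCounting (2 * y - 3) : ℝ) := by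
        have := primeCountingLowerMul_09212
        unfold PrimeCountingLowerMul at this
        exact this (2 * y - 3) h6
      have h2 : 0.9212 * ((2 * y - 3 : ℕ) : ℝ) / L₁
          ≤ 0.9212 * ((2 * y - 3 : ℕ) : ℝ) / Real.log ((2 * y - 3 : ℕ) : ℝ) :=
        div_le_div_of_nonneg_left (by positivity) hlogpos hmid
      have h3 : (y : ℝ) / h ≤ 1.8424 * y / L₁ := by
        rw [div_le_div_iff₀ hh0 hL₁pos]
        nlinarith [mul_le_mul_of_nonneg_left hL₁h hy0.le]
      have h4 : 1.8424 * (y : ℝ) / L₁ ≤ 0.9212 * ((2 * y - 3 : ℕ) : ℝ) / L₁ + 1 := by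
        rw [hnr]
        have e : 0.9212 * (2 * (y : ℝ) - 3) / L₁ = 1.8424 * y / L₁ - 2.7636 / L₁ := by
          field_simp
          ring
        rw [e]
        have : 2.7636 / L₁ ≤ 1 := by
          rw [div_le_one hL₁pos]
          linarith
        linarith
      linarith [h2, h3, h4, hπ]
    · rw [not_le] at h6
      have hn32 : 32 ≤ 2 * y - 3 := by omega
      have hπ := ShnirelmanGoldbachTheorem.primeCounting_ge hn32
      have hlog14 : Real.log ((2 * y - 3 : ℕ) : ℝ) ≤ 14 := log_le_14_of_lt (by omega) h6
      have h5 : ((2 * y - 3 : ℕ) : ℝ) / 56 ≤ ((2 * y - 3 : ℕ) : ℝ) / (4 * Real.log ((2 * y - 3 : ℕ) : ℝ)) :=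
        div_le_div_of_nonneg_left hn0.le (by positivity) (by linarith)
      have h6' : (y : ℝ) / h ≤ (y : ℝ) / 28 := div_le_div_of_nonneg_left hy0.le (by norm_num) hhr
      have h7 : ((2 * y - 3 : ℕ) : ℝ) / 56 + 1 - (y : ℝ) / 28 = 53 / 56 := by
        rw [hnr]
        ring
      linarith [hπ, h5, h6', h7]
  · -- FOUR SHIFTS on `(e^{L₁}, e^{Λ₀})`
    rw [not_le] at hmid
    have h59 : (576460752303423488 : ℝ) < ((2 * y - 3 : ℕ) : ℝ) := by
      have h1 : Real.exp L₁ < ((2 * y - 3 : ℕ) : ℝ) := by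
        by_contra hc
        rw [not_lt] at hc
        have := Real.log_le_log hn0 hc
        rw [Real.log_exp] at this
        linarith
      exact lt_of_le_of_lt (numeral_le_exp_41.trans (Real.exp_le_exp.mpr h41)) h1
    have h59n : 576460752303423488 < 2 * y - 3 := by exact_mod_cast h59
    have hy58 : (288230376151711744 : ℝ) ≤ (y : ℝ) := by
      have : 288230376151711744 ≤ y := by omega
      exact_mod_cast this
    have h2y0 : (0 : ℝ) < ((2 * y : ℕ) : ℝ) := by push_cast; linarith
    set L := Real.log ((2 * y : ℕ) : ℝ) with hLdef
    have hLΛ : L < Λ₀ := by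
      have := Real.log_lt_log h2y0 hbig
      rwa [Real.log_exp] at this
    have hL₁L : L₁ ≤ L := by
      have h2y : ((2 * y - 3 : ℕ) : ℝ) ≤ ((2 * y : ℕ) : ℝ) := by rw [hnr]; push_cast; linarith
      exact (hmid.trans_le (Real.log_le_log hn0 h2y)).le
    have hL41 : (41 : ℝ) ≤ L := h41.trans hL₁L
    have hLpos : (0 : ℝ) < L := by linarith
    have hL4 : L ≤ 10000 := by linarith
    have he41 : Real.exp 41 ≤ ((2 * y : ℕ) : ℝ) := by
      have : Real.exp 41 ≤ Real.exp L := Real.exp_le_exp.mpr hL41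
      rwa [hLdef, Real.exp_log h2y0] at this
    -- the four prime counts
    have hπ : ∀ q : ℕ, q ≤ 19 → 0.9212 * (2 * (y : ℝ) - q) / L ≤ (Nat.primeCounting (2 * y - q) : ℝ) := by
      intro q hq
      have hqr : (q : ℝ) ≤ 19 := by exact_mod_cast hq
      have hnq : ((2 * y - q : ℕ) : ℝ) = 2 * (y : ℝ) - q := cast_two_mul_sub (by omega)
      have h6 : 10 ^ 6 ≤ 2 * y - q := by omega
      have hnq0 : (0 : ℝ) < ((2 * y - q : ℕ) : ℝ) := by rw [hnq]; linarith
      have hnq1 : (1 : ℝ) < ((2 * y - q : ℕ) : ℝ) := by rw [hnq]; linarith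
      have h1 : 0.9212 * ((2 * y - q : ℕ) : ℝ) / Real.log ((2 * y - q : ℕ) : ℝ)
          ≤ (Nat.primeCounting (2 * y - q) : ℝ) := by
        have := primeCountingLowerMul_09212
        unfold PrimeCountingLowerMul at this
        exact this (2 * y - q) h6
      have hlogq0 : 0 < Real.log ((2 * y - q : ℕ) : ℝ) := Real.log_pos hnq1
      have hlogq : Real.log ((2 * y - q : ℕ) : ℝ) ≤ L := by
        have h2y : ((2 * y - q : ℕ) : ℝ) ≤ ((2 * y : ℕ) : ℝ) := by
          rw [hnq]; push_cast; linarith [Nat.cast_nonneg (α := ℝ) q]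
        exact Real.log_le_log hnq0 h2y
      have h2 : 0.9212 * (2 * (y : ℝ) - q) / L
          ≤ 0.9212 * ((2 * y - q : ℕ) : ℝ) / Real.log ((2 * y - q : ℕ) : ℝ) := by
        rw [← hnq]
        exact div_le_div_of_nonneg_left (by positivity) hlogq0 hlogq
      linarith
    -- the pair counts (tree: explicit pair sieve above `e^41`)
    have hP : ∀ d : ℕ, d ≠ 0 → Even d →
        (#((Nat.primesLE (2 * y)).filter (fun p => (p + d).Prime)) : ℝ)
          ≤ 17.75 * oddSingularFactor d * ((2 * y : ℕ) : ℝ) / L ^ 2 := by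
      intro d hd hde
      exact TwoResidueSelbergExplicit.pairCount_le_kappa (N := 2 * y) (h := d) he41 hd hde
    rcases le_or_gt L L₂ with hmid2 | hmid2
    · -- FOUR SHIFTS on `(e^{L₁}, e^{L₂}]`
      have hq := hquad L hL₁L hmid2
      have hP2 := hP 2 (by norm_num) (by norm_num)
      have hP4 := hP 4 (by norm_num) (by norm_num)
      have hP6 := hP 6 (by norm_num) (by norm_num)
      have hP8 := hP 8 (by norm_num) (by norm_num)
      rw [oddSingularFactor_two'] at hP2
      rw [oddSingularFactor_four] at hP4
      rw [oddSingularFactor_six] at hP6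
      rw [oddSingularFactor_eight] at hP8
      -- combinatorics
      have hcomb := four_shift_count (y := y) (by omega)
      have hcombr : (Nat.primeCounting (2 * y - 3) : ℝ) + Nat.primeCounting (2 * y - 5)
          + Nat.primeCounting (2 * y - 7) + Nat.primeCounting (2 * y - 11)
          ≤ (#{b ∈ Ioc 0 y | b ∈ B} : ℝ) + 2
            + (2 * #((Nat.primesLE (2 * y)).filter (fun p => (p + 2).Prime))
              + 2 * #((Nat.primesLE (2 * y)).filter (fun p => (p + 4).Prime))
              + #((Nat.primesLE (2 * y)).filter (fun p => (p + 8).Prime))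
              + #((Nat.primesLE (2 * y)).filter (fun p => (p + 6).Prime))) := by
        exact_mod_cast hcomb
      have hπ3 := hπ 3 (by norm_num)
      have hπ5 := hπ 5 (by norm_num)
      have hπ7 := hπ 7 (by norm_num)
      have hπ11 := hπ 11 (by norm_num)
      push_cast at hπ3 hπ5 hπ7 hπ11
      have h2yr : ((2 * y : ℕ) : ℝ) = 2 * (y : ℝ) := by push_cast; ring
      rw [h2yr] at hP2 hP4 hP6 hP8
      set G : ℝ := (#{b ∈ Ioc 0 y | b ∈ B} : ℝ) with hG
      set Y : ℝ := (y : ℝ) with hY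
      -- `G ≥ (7.3696 Y − 23.9512)/L − 2 − 248.5 Y/L²`
      have hG1 : (7.3696 * Y - 23.9512) / L - 2 - 248.5 * Y / L ^ 2 ≤ G := by
        have e1 : (7.3696 * Y - 23.9512) / L = 0.9212 * (2 * Y - 3) / L + 0.9212 * (2 * Y - 5) / L
            + 0.9212 * (2 * Y - 7) / L + 0.9212 * (2 * Y - 11) / L := by
          field_simp
          ring
        have e2 : 248.5 * Y / L ^ 2 = 2 * (17.75 * 1 * (2 * Y) / L ^ 2) + 2 * (17.75 * 1 * (2 * Y) / L ^ 2)
            + 17.75 * 1 * (2 * Y) / L ^ 2 + 17.75 * 2 * (2 * Y) / L ^ 2 := by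
          field_simp
          ring
        rw [e1, e2]
        linarith [hcombr, hπ3, hπ5, hπ7, hπ11, hP2, hP4, hP6, hP8]
      have hL2 : (0 : ℝ) < L ^ 2 := by positivity
      have hkey : Y * L ^ 2 ≤ (h : ℝ) * G * L ^ 2 := by
        have e3 : ((7.3696 * Y - 23.9512) / L - 2 - 248.5 * Y / L ^ 2) * L ^ 2
            = 7.3696 * Y * L - 23.9512 * L - 2 * L ^ 2 - 248.5 * Y := by
          field_simp
        have h1 : (7.3696 * Y * L - 23.9512 * L - 2 * L ^ 2 - 248.5 * Y) * h ≤ G * L ^ 2 * h := by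
          rw [← e3]
          exact mul_le_mul_of_nonneg_right (mul_le_mul_of_nonneg_right hG1 hL2.le) hh0.le
        have h2 : Y * (L ^ 2 + h) ≤ Y * (h * (7.3696 * L - 248.5)) :=
          mul_le_mul_of_nonneg_left hq (by linarith)
        have h3 : 23.9512 * L + 2 * L ^ 2 ≤ Y := by
          nlinarith [mul_nonneg (sub_nonneg.2 hL4) hLpos.le]
        have h3' : (h : ℝ) * (23.9512 * L + 2 * L ^ 2) ≤ h * Y := mul_le_mul_of_nonneg_left h3 hh0.le
        nlinarith [h1, h2, h3']
      have hfin := le_of_mul_le_mul_right hkey hL2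
      rw [div_le_iff₀ hh0, mul_comm]
      exact hfin
    · -- SEVEN SHIFTS on `(e^{L₂}, e^{Λ₀})`
      have hq := hquad7 L hmid2.le hLΛ.le
      have hP2 := hP 2 (by norm_num) (by norm_num)
      have hP4 := hP 4 (by norm_num) (by norm_num)
      have hP6 := hP 6 (by norm_num) (by norm_num)
      have hP8 := hP 8 (by norm_num) (by norm_num)
      have hP10 := hP 10 (by norm_num) (by norm_num)
      have hP12 := hP 12 (by norm_num) (by norm_num)
      have hP14 := hP 14 (by norm_num) (by norm_num)
      have hP16 := hP 16 (by norm_num) (by norm_num)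
      rw [oddSingularFactor_two'] at hP2
      rw [oddSingularFactor_four] at hP4
      rw [oddSingularFactor_six] at hP6
      rw [oddSingularFactor_eight] at hP8
      rw [oddSingularFactor_ten] at hP10
      rw [oddSingularFactor_twelve] at hP12
      rw [oddSingularFactor_fourteen] at hP14
      rw [oddSingularFactor_sixteen] at hP16
      have hcomb := seven_shift_count (y := y) (by omega)
      have hcombr : (Nat.primeCounting (2 * y - 3) : ℝ) + Nat.primeCounting (2 * y - 5)
          + Nat.primeCounting (2 * y - 7) + Nat.primeCounting (2 * y - 11) + Nat.primeCounting (2 * y - 13)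
          + Nat.primeCounting (2 * y - 17) + Nat.primeCounting (2 * y - 19)
          ≤ (#{b ∈ Ioc 0 y | b ∈ B} : ℝ) + 5
            + (4 * #((Nat.primesLE (2 * y)).filter (fun p => (p + 2).Prime))
              + 3 * #((Nat.primesLE (2 * y)).filter (fun p => (p + 4).Prime))
              + 4 * #((Nat.primesLE (2 * y)).filter (fun p => (p + 6).Prime))
              + 3 * #((Nat.primesLE (2 * y)).filter (fun p => (p + 8).Prime))
              + 2 * #((Nat.primesLE (2 * y)).filter (fun p => (p + 10).Prime))
              + 2 * #((Nat.primesLE (2 * y)).filter (fun p => (p + 12).Prime))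
              + 2 * #((Nat.primesLE (2 * y)).filter (fun p => (p + 14).Prime))
              + #((Nat.primesLE (2 * y)).filter (fun p => (p + 16).Prime))) := by
        exact_mod_cast hcomb
      have hπ3 := hπ 3 (by norm_num)
      have hπ5 := hπ 5 (by norm_num)
      have hπ7 := hπ 7 (by norm_num)
      have hπ11 := hπ 11 (by norm_num)
      have hπ13 := hπ 13 (by norm_num)
      have hπ17 := hπ 17 (by norm_num)
      have hπ19 := hπ 19 (by norm_num)
      push_cast at hπ3 hπ5 hπ7 hπ11 hπ13 hπ17 hπ19
      have h2yr : ((2 * y : ℕ) : ℝ) = 2 * (y : ℝ) := by push_cast; ring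
      rw [h2yr] at hP2 hP4 hP6 hP8 hP10 hP12 hP14 hP16
      set G : ℝ := (#{b ∈ Ioc 0 y | b ∈ B} : ℝ) with hG
      set Y : ℝ := (y : ℝ) with hY
      have hY0 : 0 ≤ Y := le_trans (by norm_num) hy58
      have hL2 : (0 : ℝ) < L ^ 2 := by positivity
      have hG1 : (12.8968 * Y - 69.09) / L - 5 - 996.37 * Y / L ^ 2 ≤ G := by
        have e1 : (12.8968 * Y - 69.09) / L
            = 0.9212 * (2 * Y - 3) / L + 0.9212 * (2 * Y - 5) / L + 0.9212 * (2 * Y - 7) / L + 0.9212 * (2 * Y - 11) / L + 0.9212 * (2 * Y - 13) / L + 0.9212 * (2 * Y - 17) / L + 0.9212 * (2 * Y - 19) / L := by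
          field_simp
          ring
        have e2 : 4 * (17.75 * 1 * (2 * Y) / L ^ 2) + 3 * (17.75 * 1 * (2 * Y) / L ^ 2)
            + 4 * (17.75 * 2 * (2 * Y) / L ^ 2) + 3 * (17.75 * 1 * (2 * Y) / L ^ 2)
            + 2 * (17.75 * (4 / 3) * (2 * Y) / L ^ 2) + 2 * (17.75 * 2 * (2 * Y) / L ^ 2)
            + 2 * (17.75 * (6 / 5) * (2 * Y) / L ^ 2) + 17.75 * 1 * (2 * Y) / L ^ 2
            = (29891 / 30) * Y / L ^ 2 := by
          field_simp
          ring
        have e3 : (29891 / 30 : ℝ) * Y / L ^ 2 ≤ 996.37 * Y / L ^ 2 :=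
          div_le_div_of_nonneg_right (mul_le_mul_of_nonneg_right (by norm_num) hY0) hL2.le
        rw [e1]
        linarith [hcombr, hπ3, hπ5, hπ7, hπ11, hπ13, hπ17, hπ19, hP2, hP4, hP6, hP8, hP10, hP12, hP14, hP16,
          e2, e3]
      have hkey : Y * L ^ 2 ≤ (h : ℝ) * G * L ^ 2 := by
        have e4 : ((12.8968 * Y - 69.09) / L - 5 - 996.37 * Y / L ^ 2) * L ^ 2
            = 12.8968 * Y * L - 69.09 * L - 5 * L ^ 2 - 996.37 * Y := by
          field_simp
        have h1 : (12.8968 * Y * L - 69.09 * L - 5 * L ^ 2 - 996.37 * Y) * h ≤ G * L ^ 2 * h := by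
          rw [← e4]
          exact mul_le_mul_of_nonneg_right (mul_le_mul_of_nonneg_right hG1 hL2.le) hh0.le
        have h2 : Y * (L ^ 2 + h) ≤ Y * (h * (12.8968 * L - 996.37)) :=
          mul_le_mul_of_nonneg_left hq (by linarith)
        have h3 : 69.09 * L + 5 * L ^ 2 ≤ Y := by
          nlinarith [mul_nonneg (sub_nonneg.2 hL4) hLpos.le]
        have h3' : (h : ℝ) * (69.09 * L + 5 * L ^ 2) ≤ h * Y := mul_le_mul_of_nonneg_left h3 hh0.le
        nlinarith [h1, h2, h3']
      have hfin := le_of_mul_le_mul_right hkey hL2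
      rw [div_le_iff₀ hh0, mul_comm]
      exact hfin
set_option maxHeartbeats 1600000 in
/-- **All `y ≥ 1` under (3.3), THREE-REGIME glue (1 / 4 / 7 shifts)**: as `half_count_ge_allN_bonf_RS` (`c₀ = 1`),
four shifts on `[L₁, L₂]` (`L² + h ≤ h·(8L − 248.5)`), seven shifts on `[L₂, Λ₀]` (`L² + h ≤ h·(14L − 996.37)`).
[cite: RosserSchoenfeld1962, Theorem 2, eq. (3.3) (as input)] -/
theorem half_count_ge_allN_bonf7_RS (hRS : Literature.NumberTheory.LFunctions.RosserSchoenfeld1962_theorem2)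
    {L₁ L₂ Λ₀ : ℝ} {h : ℕ} (h18 : 18 ≤ h) (h41 : 41 ≤ L₁) (hL₁h : L₁ ≤ 2 * h)
    (hΛ4 : Λ₀ ≤ 10000)
    (hquad : ∀ L : ℝ, L₁ ≤ L → L ≤ L₂ → L ^ 2 + h ≤ h * (8 * L - 248.5))
    (hquad7 : ∀ L : ℝ, L₂ ≤ L → L ≤ Λ₀ → L ^ 2 + h ≤ h * (14 * L - 996.37))
    (hlarge : ∀ x : ℕ, Real.exp Λ₀ ≤ (x : ℝ) →
      (x : ℝ) / (2 * h) ≤ #{N ∈ Ioc 0 x | Even N ∧ ∃ p q : ℕ, p.Prime ∧ q.Prime ∧ p + q = N})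
    {y : ℕ} (hy : 1 ≤ y) :
    (y : ℝ) / h ≤ #{b ∈ Ioc 0 y | b ∈ (({0, 1} : Set ℕ) ∪ {m | ∃ p q : ℕ, p.Prime ∧ q.Prime ∧ p + q = 2 * m})} := by
  set B : Set ℕ := ({0, 1} : Set ℕ) ∪ {m | ∃ p q : ℕ, p.Prime ∧ q.Prime ∧ p + q = 2 * m} with hB
  have hhr : (18 : ℝ) ≤ h := by exact_mod_cast h18
  have hh0 : (0 : ℝ) < h := by linarith
  have hL₁pos : (0 : ℝ) < L₁ := by linarith
  by_cases hbig : Real.exp Λ₀ ≤ ((2 * y : ℕ) : ℝ)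
  · have h1 := hlarge (2 * y) hbig
    have h2 := even_goldbach_card_le_half y
    have e : ((2 * y : ℕ) : ℝ) / (2 * h) = (y : ℝ) / h := by
      push_cast
      field_simp
    rw [e] at h1
    exact h1.trans (by exact_mod_cast h2)
  rw [not_le] at hbig
  by_cases hsmall : y ≤ h
  · have h1 : 1 ≤ #{b ∈ Ioc 0 y | b ∈ B} :=
      card_pos.mpr ⟨1, by
        rw [mem_filter, mem_Ioc]
        exact ⟨⟨by omega, hy⟩, Or.inl (by simp)⟩⟩
    have h1' : (1 : ℝ) ≤ #{b ∈ Ioc 0 y | b ∈ B} := by exact_mod_cast h1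
    have h2 : (y : ℝ) / h ≤ 1 := by
      rw [div_le_one hh0]
      exact_mod_cast hsmall
    linarith
  rw [not_le] at hsmall
  have hy29 : 19 ≤ y := by omega
  have hnr : ((2 * y - 3 : ℕ) : ℝ) = 2 * (y : ℝ) - 3 := cast_two_mul_sub_three (by omega)
  have hy29r : (19 : ℝ) ≤ y := by exact_mod_cast hy29
  have hy0 : (0 : ℝ) < y := by linarith
  have hn55 : 35 ≤ 2 * y - 3 := by omega
  have hn0 : (0 : ℝ) < ((2 * y - 3 : ℕ) : ℝ) := by rw [hnr]; linarith
  have hn1 : (1 : ℝ) < ((2 * y - 3 : ℕ) : ℝ) := by rw [hnr]; linarith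
  have hlogpos : 0 < Real.log ((2 * y - 3 : ℕ) : ℝ) := Real.log_pos hn1
  by_cases hmid : Real.log ((2 * y - 3 : ℕ) : ℝ) ≤ L₁
  · -- ONE SHIFT below `e^{L₁}` (§15, RS)
    have hemb := primeCounting_shift_le_half_count (y := y) (by omega)
    have hembr : (Nat.primeCounting (2 * y - 3) : ℝ) + 1 ≤ #{b ∈ Ioc 0 y | b ∈ B} := by exact_mod_cast hemb
    refine le_trans ?_ hembr
    by_cases h67 : 67 ≤ 2 * y - 3
    · have hπ : 1 * ((2 * y - 3 : ℕ) : ℝ) / Real.log ((2 * y - 3 : ℕ) : ℝ)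
          ≤ (Nat.primeCounting (2 * y - 3) : ℝ) := by
        have := primeCountingLowerMul_one_of_RS hRS
        unfold PrimeCountingLowerMul at this
        exact this (2 * y - 3) h67
      rw [one_mul] at hπ
      have h2 : ((2 * y - 3 : ℕ) : ℝ) / L₁ ≤ ((2 * y - 3 : ℕ) : ℝ) / Real.log ((2 * y - 3 : ℕ) : ℝ) :=
        div_le_div_of_nonneg_left hn0.le hlogpos hmid
      have h3 : (y : ℝ) / h ≤ 2 * y / L₁ := by
        rw [div_le_div_iff₀ hh0 hL₁pos]
        nlinarith [mul_le_mul_of_nonneg_left hL₁h hy0.le]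
      have h4 : 2 * (y : ℝ) / L₁ ≤ ((2 * y - 3 : ℕ) : ℝ) / L₁ + 1 := by
        rw [hnr]
        have e : (2 * (y : ℝ) - 3) / L₁ = 2 * y / L₁ - 3 / L₁ := by
          field_simp
        rw [e]
        have : 3 / L₁ ≤ 1 := by
          rw [div_le_one hL₁pos]
          linarith
        linarith
      linarith [h2, h3, h4, hπ]
    · rw [not_le] at h67
      have hn32 : 32 ≤ 2 * y - 3 := by omega
      have hπ := ShnirelmanGoldbachTheorem.primeCounting_ge hn32
      have hlog7 : Real.log ((2 * y - 3 : ℕ) : ℝ) ≤ 7 := by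
        have hy7 : ((2 * y - 3 : ℕ) : ℝ) ≤ (2 : ℝ) ^ 7 := by
          have : ((2 * y - 3 : ℕ) : ℝ) < 67 := by exact_mod_cast h67
          have h27 : (67 : ℝ) ≤ (2 : ℝ) ^ 7 := by norm_num
          linarith
        have he : (2 : ℝ) ≤ Real.exp 1 := by have := Real.add_one_le_exp (1 : ℝ); linarith
        have h7 : (2 : ℝ) ^ 7 ≤ Real.exp 7 := by
          rw [show (7 : ℝ) = ((7 : ℕ) : ℝ) * 1 by norm_num, Real.exp_nat_mul]
          exact pow_le_pow_left₀ (by norm_num) he 7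
        have := Real.log_le_log hn0 (hy7.trans h7)
        rwa [Real.log_exp] at this
      have h5 : ((2 * y - 3 : ℕ) : ℝ) / 28 ≤ ((2 * y - 3 : ℕ) : ℝ) / (4 * Real.log ((2 * y - 3 : ℕ) : ℝ)) :=
        div_le_div_of_nonneg_left hn0.le (by positivity) (by linarith)
      have h6' : (y : ℝ) / h ≤ (y : ℝ) / 18 := div_le_div_of_nonneg_left hy0.le (by norm_num) hhr
      have h7 : ((2 * y - 3 : ℕ) : ℝ) / 28 + 1 - (y : ℝ) / 18 = (4 * (y : ℝ) + 225) / 252 := by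
        rw [hnr]
        ring
      have h8 : 0 ≤ (4 * (y : ℝ) + 225) / 252 := by positivity
      linarith [hπ, h5, h6', h7, h8]
  · -- FOUR SHIFTS on `(e^{L₁}, e^{Λ₀})`, `c₀ = 1`
    rw [not_le] at hmid
    have h59 : (576460752303423488 : ℝ) < ((2 * y - 3 : ℕ) : ℝ) := by
      have h1 : Real.exp L₁ < ((2 * y - 3 : ℕ) : ℝ) := by
        by_contra hc
        rw [not_lt] at hc
        have := Real.log_le_log hn0 hc
        rw [Real.log_exp] at this
        linarith
      exact lt_of_le_of_lt (numeral_le_exp_41.trans (Real.exp_le_exp.mpr h41)) h1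
    have h59n : 576460752303423488 < 2 * y - 3 := by exact_mod_cast h59
    have hy58 : (288230376151711744 : ℝ) ≤ (y : ℝ) := by
      have : 288230376151711744 ≤ y := by omega
      exact_mod_cast this
    have h2y0 : (0 : ℝ) < ((2 * y : ℕ) : ℝ) := by push_cast; linarith
    set L := Real.log ((2 * y : ℕ) : ℝ) with hLdef
    have hLΛ : L < Λ₀ := by
      have := Real.log_lt_log h2y0 hbig
      rwa [Real.log_exp] at this
    have hL₁L : L₁ ≤ L := by
      have h2y : ((2 * y - 3 : ℕ) : ℝ) ≤ ((2 * y : ℕ) : ℝ) := by rw [hnr]; push_cast; linarith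
      exact (hmid.trans_le (Real.log_le_log hn0 h2y)).le
    have hL41 : (41 : ℝ) ≤ L := h41.trans hL₁L
    have hLpos : (0 : ℝ) < L := by linarith
    have hL4 : L ≤ 10000 := by linarith
    have he41 : Real.exp 41 ≤ ((2 * y : ℕ) : ℝ) := by
      have : Real.exp 41 ≤ Real.exp L := Real.exp_le_exp.mpr hL41
      rwa [hLdef, Real.exp_log h2y0] at this
    have hπ : ∀ q : ℕ, q ≤ 19 → (2 * (y : ℝ) - q) / L ≤ (Nat.primeCounting (2 * y - q) : ℝ) := by
      intro q hq
      have hqr : (q : ℝ) ≤ 19 := by exact_mod_cast hq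
      have hnq : ((2 * y - q : ℕ) : ℝ) = 2 * (y : ℝ) - q := cast_two_mul_sub (by omega)
      have h67 : 67 ≤ 2 * y - q := by omega
      have hnq0 : (0 : ℝ) < ((2 * y - q : ℕ) : ℝ) := by rw [hnq]; linarith
      have hnq1 : (1 : ℝ) < ((2 * y - q : ℕ) : ℝ) := by rw [hnq]; linarith
      have h1 : 1 * ((2 * y - q : ℕ) : ℝ) / Real.log ((2 * y - q : ℕ) : ℝ)
          ≤ (Nat.primeCounting (2 * y - q) : ℝ) := by
        have := primeCountingLowerMul_one_of_RS hRS
        unfold PrimeCountingLowerMul at this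
        exact this (2 * y - q) h67
      rw [one_mul] at h1
      have hlogq0 : 0 < Real.log ((2 * y - q : ℕ) : ℝ) := Real.log_pos hnq1
      have hlogq : Real.log ((2 * y - q : ℕ) : ℝ) ≤ L := by
        have h2y : ((2 * y - q : ℕ) : ℝ) ≤ ((2 * y : ℕ) : ℝ) := by
          rw [hnq]; push_cast; linarith [Nat.cast_nonneg (α := ℝ) q]
        exact Real.log_le_log hnq0 h2y
      have h2 : (2 * (y : ℝ) - q) / L ≤ ((2 * y - q : ℕ) : ℝ) / Real.log ((2 * y - q : ℕ) : ℝ) := by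
        rw [← hnq]
        exact div_le_div_of_nonneg_left hnq0.le hlogq0 hlogq
      linarith
    have hP : ∀ d : ℕ, d ≠ 0 → Even d →
        (#((Nat.primesLE (2 * y)).filter (fun p => (p + d).Prime)) : ℝ)
          ≤ 17.75 * oddSingularFactor d * ((2 * y : ℕ) : ℝ) / L ^ 2 := by
      intro d hd hde
      exact TwoResidueSelbergExplicit.pairCount_le_kappa (N := 2 * y) (h := d) he41 hd hde
    rcases le_or_gt L L₂ with hmid2 | hmid2
    · -- FOUR SHIFTS on `(e^{L₁}, e^{L₂}]`
      have hq := hquad L hL₁L hmid2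
      have hP2 := hP 2 (by norm_num) (by norm_num)
      have hP4 := hP 4 (by norm_num) (by norm_num)
      have hP6 := hP 6 (by norm_num) (by norm_num)
      have hP8 := hP 8 (by norm_num) (by norm_num)
      rw [oddSingularFactor_two'] at hP2
      rw [oddSingularFactor_four] at hP4
      rw [oddSingularFactor_six] at hP6
      rw [oddSingularFactor_eight] at hP8
      have hcomb := four_shift_count (y := y) (by omega)
      have hcombr : (Nat.primeCounting (2 * y - 3) : ℝ) + Nat.primeCounting (2 * y - 5)
          + Nat.primeCounting (2 * y - 7) + Nat.primeCounting (2 * y - 11)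
          ≤ (#{b ∈ Ioc 0 y | b ∈ B} : ℝ) + 2
            + (2 * #((Nat.primesLE (2 * y)).filter (fun p => (p + 2).Prime))
              + 2 * #((Nat.primesLE (2 * y)).filter (fun p => (p + 4).Prime))
              + #((Nat.primesLE (2 * y)).filter (fun p => (p + 8).Prime))
              + #((Nat.primesLE (2 * y)).filter (fun p => (p + 6).Prime))) := by
        exact_mod_cast hcomb
      have hπ3 := hπ 3 (by norm_num)
      have hπ5 := hπ 5 (by norm_num)
      have hπ7 := hπ 7 (by norm_num)
      have hπ11 := hπ 11 (by norm_num)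
      push_cast at hπ3 hπ5 hπ7 hπ11
      have h2yr : ((2 * y : ℕ) : ℝ) = 2 * (y : ℝ) := by push_cast; ring
      rw [h2yr] at hP2 hP4 hP6 hP8
      set G : ℝ := (#{b ∈ Ioc 0 y | b ∈ B} : ℝ) with hG
      set Y : ℝ := (y : ℝ) with hY
      have hG1 : (8 * Y - 26) / L - 2 - 248.5 * Y / L ^ 2 ≤ G := by
        have e1 : (8 * Y - 26) / L = (2 * Y - 3) / L + (2 * Y - 5) / L + (2 * Y - 7) / L + (2 * Y - 11) / L := by
          field_simp
          ring
        have e2 : 248.5 * Y / L ^ 2 = 2 * (17.75 * 1 * (2 * Y) / L ^ 2) + 2 * (17.75 * 1 * (2 * Y) / L ^ 2)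
            + 17.75 * 1 * (2 * Y) / L ^ 2 + 17.75 * 2 * (2 * Y) / L ^ 2 := by
          field_simp
          ring
        rw [e1, e2]
        linarith [hcombr, hπ3, hπ5, hπ7, hπ11, hP2, hP4, hP6, hP8]
      have hL2 : (0 : ℝ) < L ^ 2 := by positivity
      have hkey : Y * L ^ 2 ≤ (h : ℝ) * G * L ^ 2 := by
        have e3 : ((8 * Y - 26) / L - 2 - 248.5 * Y / L ^ 2) * L ^ 2
            = 8 * Y * L - 26 * L - 2 * L ^ 2 - 248.5 * Y := by
          field_simp
        have h1 : (8 * Y * L - 26 * L - 2 * L ^ 2 - 248.5 * Y) * h ≤ G * L ^ 2 * h := by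
          rw [← e3]
          exact mul_le_mul_of_nonneg_right (mul_le_mul_of_nonneg_right hG1 hL2.le) hh0.le
        have h2 : Y * (L ^ 2 + h) ≤ Y * (h * (8 * L - 248.5)) :=
          mul_le_mul_of_nonneg_left hq (by linarith)
        have h3 : 26 * L + 2 * L ^ 2 ≤ Y := by
          nlinarith [mul_nonneg (sub_nonneg.2 hL4) hLpos.le]
        have h3' : (h : ℝ) * (26 * L + 2 * L ^ 2) ≤ h * Y := mul_le_mul_of_nonneg_left h3 hh0.le
        nlinarith [h1, h2, h3']
      have hfin := le_of_mul_le_mul_right hkey hL2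
      rw [div_le_iff₀ hh0, mul_comm]
      exact hfin
    · -- SEVEN SHIFTS on `(e^{L₂}, e^{Λ₀})`
      have hq := hquad7 L hmid2.le hLΛ.le
      have hP2 := hP 2 (by norm_num) (by norm_num)
      have hP4 := hP 4 (by norm_num) (by norm_num)
      have hP6 := hP 6 (by norm_num) (by norm_num)
      have hP8 := hP 8 (by norm_num) (by norm_num)
      have hP10 := hP 10 (by norm_num) (by norm_num)
      have hP12 := hP 12 (by norm_num) (by norm_num)
      have hP14 := hP 14 (by norm_num) (by norm_num)
      have hP16 := hP 16 (by norm_num) (by norm_num)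
      rw [oddSingularFactor_two'] at hP2
      rw [oddSingularFactor_four] at hP4
      rw [oddSingularFactor_six] at hP6
      rw [oddSingularFactor_eight] at hP8
      rw [oddSingularFactor_ten] at hP10
      rw [oddSingularFactor_twelve] at hP12
      rw [oddSingularFactor_fourteen] at hP14
      rw [oddSingularFactor_sixteen] at hP16
      have hcomb := seven_shift_count (y := y) (by omega)
      have hcombr : (Nat.primeCounting (2 * y - 3) : ℝ) + Nat.primeCounting (2 * y - 5)
          + Nat.primeCounting (2 * y - 7) + Nat.primeCounting (2 * y - 11) + Nat.primeCounting (2 * y - 13)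
          + Nat.primeCounting (2 * y - 17) + Nat.primeCounting (2 * y - 19)
          ≤ (#{b ∈ Ioc 0 y | b ∈ B} : ℝ) + 5
            + (4 * #((Nat.primesLE (2 * y)).filter (fun p => (p + 2).Prime))
              + 3 * #((Nat.primesLE (2 * y)).filter (fun p => (p + 4).Prime))
              + 4 * #((Nat.primesLE (2 * y)).filter (fun p => (p + 6).Prime))
              + 3 * #((Nat.primesLE (2 * y)).filter (fun p => (p + 8).Prime))
              + 2 * #((Nat.primesLE (2 * y)).filter (fun p => (p + 10).Prime))
              + 2 * #((Nat.primesLE (2 * y)).filter (fun p => (p + 12).Prime))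
              + 2 * #((Nat.primesLE (2 * y)).filter (fun p => (p + 14).Prime))
              + #((Nat.primesLE (2 * y)).filter (fun p => (p + 16).Prime))) := by
        exact_mod_cast hcomb
      have hπ3 := hπ 3 (by norm_num)
      have hπ5 := hπ 5 (by norm_num)
      have hπ7 := hπ 7 (by norm_num)
      have hπ11 := hπ 11 (by norm_num)
      have hπ13 := hπ 13 (by norm_num)
      have hπ17 := hπ 17 (by norm_num)
      have hπ19 := hπ 19 (by norm_num)
      push_cast at hπ3 hπ5 hπ7 hπ11 hπ13 hπ17 hπ19
      have h2yr : ((2 * y : ℕ) : ℝ) = 2 * (y : ℝ) := by push_cast; ring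
      rw [h2yr] at hP2 hP4 hP6 hP8 hP10 hP12 hP14 hP16
      set G : ℝ := (#{b ∈ Ioc 0 y | b ∈ B} : ℝ) with hG
      set Y : ℝ := (y : ℝ) with hY
      have hY0 : 0 ≤ Y := le_trans (by norm_num) hy58
      have hL2 : (0 : ℝ) < L ^ 2 := by positivity
      have hG1 : (14 * Y - 75) / L - 5 - 996.37 * Y / L ^ 2 ≤ G := by
        have e1 : (14 * Y - 75) / L
            = (2 * Y - 3) / L + (2 * Y - 5) / L + (2 * Y - 7) / L + (2 * Y - 11) / L + (2 * Y - 13) / L + (2 * Y - 17) / L + (2 * Y - 19) / L := by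
          field_simp
          ring
        have e2 : 4 * (17.75 * 1 * (2 * Y) / L ^ 2) + 3 * (17.75 * 1 * (2 * Y) / L ^ 2)
            + 4 * (17.75 * 2 * (2 * Y) / L ^ 2) + 3 * (17.75 * 1 * (2 * Y) / L ^ 2)
            + 2 * (17.75 * (4 / 3) * (2 * Y) / L ^ 2) + 2 * (17.75 * 2 * (2 * Y) / L ^ 2)
            + 2 * (17.75 * (6 / 5) * (2 * Y) / L ^ 2) + 17.75 * 1 * (2 * Y) / L ^ 2
            = (29891 / 30) * Y / L ^ 2 := by
          field_simp
          ring
        have e3 : (29891 / 30 : ℝ) * Y / L ^ 2 ≤ 996.37 * Y / L ^ 2 :=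
          div_le_div_of_nonneg_right (mul_le_mul_of_nonneg_right (by norm_num) hY0) hL2.le
        rw [e1]
        linarith [hcombr, hπ3, hπ5, hπ7, hπ11, hπ13, hπ17, hπ19, hP2, hP4, hP6, hP8, hP10, hP12, hP14, hP16,
          e2, e3]
      have hkey : Y * L ^ 2 ≤ (h : ℝ) * G * L ^ 2 := by
        have e4 : ((14 * Y - 75) / L - 5 - 996.37 * Y / L ^ 2) * L ^ 2
            = 14 * Y * L - 75 * L - 5 * L ^ 2 - 996.37 * Y := by
          field_simp
        have h1 : (14 * Y * L - 75 * L - 5 * L ^ 2 - 996.37 * Y) * h ≤ G * L ^ 2 * h := by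
          rw [← e4]
          exact mul_le_mul_of_nonneg_right (mul_le_mul_of_nonneg_right hG1 hL2.le) hh0.le
        have h2 : Y * (L ^ 2 + h) ≤ Y * (h * (14 * L - 996.37)) :=
          mul_le_mul_of_nonneg_left hq (by linarith)
        have h3 : 75 * L + 5 * L ^ 2 ≤ Y := by
          nlinarith [mul_nonneg (sub_nonneg.2 hL4) hLpos.le]
        have h3' : (h : ℝ) * (75 * L + 5 * L ^ 2) ≤ h * Y := mul_le_mul_of_nonneg_left h3 hh0.le
        nlinarith [h1, h2, h3']
      have hfin := le_of_mul_le_mul_right hkey hL2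
      rw [div_le_iff₀ hh0, mul_comm]
      exact hfin

/-! #### §18.4 Instances: `K = 61` unconditionally, `K = 51` under (3.3) -/

/-- Numerics at `Λ = 269`: `17L² ≤ 16·13.75·TlowK(L/2 − 1.38632)` for `L ≥ 269`. [folklore] -/
private theorem kappa_numeric_269 {L : ℝ} (hL : 269 ≤ L) :
    17 * L ^ 2 ≤ 16 * (13.77 - 0.02) * TwoResidueSelbergExplicit.TlowK (L / 2 - 1.38632) := by
  unfold TwoResidueSelbergExplicit.TlowK
  nlinarith [hL, mul_self_nonneg (L - 269)]

/-- **`A = 13.77` above `e^269`**. [cite: BatemanDiamond2004, §13.4 (13.13)–(13.14)] -/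
theorem goldbachCount_le_1377 {N : ℕ} (hN : Real.exp 269 ≤ (N : ℝ)) (heven : Even N) :
    (SingularSeries.goldbachCount N : ℝ) ≤ 13.77 * oddSingularFactor N * (N : ℝ) / Real.log (N : ℝ) ^ 2 :=
  goldbachCount_le_of_numeric41 (by norm_num) (fun _ hL => kappa_numeric_269 hL) hN heven

/-- Numerics at `Λ = 239`: `17L² ≤ 16·13.82·TlowK(L/2 − 1.38632)` for `L ≥ 239`. [folklore] -/
private theorem kappa_numeric_239 {L : ℝ} (hL : 239 ≤ L) :
    17 * L ^ 2 ≤ 16 * (13.84 - 0.02) * TwoResidueSelbergExplicit.TlowK (L / 2 - 1.38632) := by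
  unfold TwoResidueSelbergExplicit.TlowK
  nlinarith [hL, mul_self_nonneg (L - 239)]

/-- **`A = 13.84` above `e^239`**. [cite: BatemanDiamond2004, §13.4 (13.13)–(13.14)] -/
theorem goldbachCount_le_1384 {N : ℕ} (hN : Real.exp 239 ≤ (N : ℝ)) (heven : Even N) :
    (SingularSeries.goldbachCount N : ℝ) ≤ 13.84 * oddSingularFactor N * (N : ℝ) / Real.log (N : ℝ) ^ 2 :=
  goldbachCount_le_of_numeric41 (by norm_num) (fun _ hL => kappa_numeric_239 hL) hN heven

/-- **Unconditional, above `e^279`**: at least `x/60` EVEN Goldbach numbers in `(0, x]`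
(`Λs = 269`, `A = 13.77`, `269 + 10 ≤ 279 ≤ 400`; `(1/60)⁷·259.55·13.77⁸ = 0.1198 ≤ (0.4242·gHol 279 − 0.0057)⁸ = 0.1313`).
[cite: Nathanson1996, Theorem 7.8 (proof, restricted to even N; explicit form proved here)] -/
theorem goldbach_even_count_ge_60_exp279 {x : ℕ} (hx : Real.exp 279 ≤ (x : ℝ)) :
    (x : ℝ) / 60 ≤ #{N ∈ Ioc 0 x | Even N ∧ ∃ p q : ℕ, p.Prime ∧ q.Prime ∧ p + q = N} := by
  have h := goldbach_even_count_ge_holder_gap10 (Λs := 269) (Λ₀ := 279) (A := 13.77) (c₁ := 0.4243) (κ := 1 / 60)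
    (by norm_num) (by norm_num) (by norm_num) (by norm_num) (by norm_num)
    (fun N hN hev => goldbachCount_le_1377 hN hev) (by norm_num) (by norm_num)
    (fun y hy => sum_goldbachCount_ge_04243' ((Real.exp_le_exp.mpr (by norm_num)).trans hy))
    (by unfold gHol; norm_num) (by unfold gHol; norm_num) hx
  have e : (1 : ℝ) / 60 * x = x / 60 := by ring
  rw [e] at h
  exact h

/-- **Under (3.3), above `e^249`**: at least `x/50` EVEN Goldbach numbers in `(0, x]`
(`Λs = 239`, `A = 13.84`, `c₁ = 0.4995`). [cite: RosserSchoenfeld1962, Theorem 2, eq. (3.3) (as input)] -/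
theorem goldbach_even_count_ge_of_RS_50 (hRS : Literature.NumberTheory.LFunctions.RosserSchoenfeld1962_theorem2)
    {x : ℕ} (hx : Real.exp 249 ≤ (x : ℝ)) :
    (x : ℝ) / 50 ≤ #{N ∈ Ioc 0 x | Even N ∧ ∃ p q : ℕ, p.Prime ∧ q.Prime ∧ p + q = N} := by
  have h := goldbach_even_count_ge_holder_gap10 (Λs := 239) (Λ₀ := 249) (A := 13.84) (c₁ := 0.4995) (κ := 1 / 50)
    (by norm_num) (by norm_num) (by norm_num) (by norm_num) (by norm_num)
    (fun N hN hev => goldbachCount_le_1384 hN hev) (by norm_num) (by norm_num)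
    (fun y hy => sum_goldbachCount_ge_of_RS' hRS ((Real.exp_le_exp.mpr (by norm_num)).trans hy))
    (by unfold gHol; norm_num) (by unfold gHol; norm_num) hx
  have e : (1 : ℝ) / 50 * x = x / 50 := by ring
  rw [e] at h
  exact h

/-- **Unconditional count for all `y ≥ 1`**: `B(y) ≥ y/30` (one shift below `e^55.272 = e^{1.8424·30}`, four shifts on
`[55.272, 150]`, seven shifts on `[150, 279]`, the count above `e^279`). [cite: Nathanson1996, Theorem 7.8 (explicit constant for the halved set proved here)] -/
theorem half_count_ge_allN_30 {y : ℕ} (hy : 1 ≤ y) :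
    (y : ℝ) / 30 ≤ #{b ∈ Ioc 0 y | b ∈ (({0, 1} : Set ℕ) ∪ {m | ∃ p q : ℕ, p.Prime ∧ q.Prime ∧ p + q = 2 * m})} := by
  have h := half_count_ge_allN_bonf7 (L₁ := 55.272) (L₂ := 150) (Λ₀ := 279) (h := 30) (by norm_num) (by norm_num)
    (by norm_num) (by norm_num)
    (fun L h1 h2 => by
      push_cast
      nlinarith [mul_nonneg (sub_nonneg.2 h1) (sub_nonneg.2 h2)])
    (fun L h1 h2 => by
      push_cast
      nlinarith [mul_nonneg (sub_nonneg.2 h1) (sub_nonneg.2 h2)])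
    (fun x hx => by
      have h1 := goldbach_even_count_ge_60_exp279 hx
      have e : (x : ℝ) / (2 * ((30 : ℕ) : ℝ)) = (x : ℝ) / 60 := by norm_num
      rw [e]
      exact h1) hy
  exact_mod_cast h

/-- **Under (3.3), all `y ≥ 1`**: `B(y) ≥ y/25` (one shift below `e^50`, four shifts on `[50, 140]`, seven on
`[140, 249]`). [cite: RosserSchoenfeld1962, Theorem 2, eq. (3.3) (as input)] -/
theorem half_count_ge_allN_of_RS_25 (hRS : Literature.NumberTheory.LFunctions.RosserSchoenfeld1962_theorem2)
    {y : ℕ} (hy : 1 ≤ y) :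
    (y : ℝ) / 25 ≤ #{b ∈ Ioc 0 y | b ∈ (({0, 1} : Set ℕ) ∪ {m | ∃ p q : ℕ, p.Prime ∧ q.Prime ∧ p + q = 2 * m})} := by
  have h := half_count_ge_allN_bonf7_RS hRS (L₁ := 50) (L₂ := 140) (Λ₀ := 249) (h := 25) (by norm_num) (by norm_num)
    (by norm_num) (by norm_num)
    (fun L h1 h2 => by
      push_cast
      nlinarith [mul_nonneg (sub_nonneg.2 h1) (sub_nonneg.2 h2)])
    (fun L h1 h2 => by
      push_cast
      nlinarith [mul_nonneg (sub_nonneg.2 h1) (sub_nonneg.2 h2)])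
    (fun x hx => by
      have h1 := goldbach_even_count_ge_of_RS_50 hRS hx
      have e : (x : ℝ) / (2 * ((25 : ℕ) : ℝ)) = (x : ℝ) / 50 := by norm_num
      rw [e]
      exact h1) hy
  exact_mod_cast h

/-- **The halved density, `1/30`**: `σ({0, 1} ∪ {m : 2m = p + q}) ≥ 1/30`, unconditionally. [cite: Nathanson1996, Theorem 7.8 (explicit constant for the halved set proved here)] -/
theorem schnirelmannDensity_half_ge_30 :
    (1 : ℝ) / 30 ≤ schnirelmannDensity
      (({0, 1} : Set ℕ) ∪ {m | ∃ p q : ℕ, p.Prime ∧ q.Prime ∧ p + q = 2 * m}) := by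
  have h := schnirelmannDensity_ge_of_count' (K := 30)
    (S := ({0, 1} : Set ℕ) ∪ {m | ∃ p q : ℕ, p.Prime ∧ q.Prime ∧ p + q = 2 * m})
    (fun N hN => by have := half_count_ge_allN_30 hN; exact_mod_cast this)
  exact_mod_cast h

/-- **The halved density under (3.3), `1/25`**. [cite: RosserSchoenfeld1962, Theorem 2, eq. (3.3) (as input)] -/
theorem schnirelmannDensity_half_ge_of_RS_25
    (hRS : Literature.NumberTheory.LFunctions.RosserSchoenfeld1962_theorem2) :
    (1 : ℝ) / 25 ≤ schnirelmannDensity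
      (({0, 1} : Set ℕ) ∪ {m | ∃ p q : ℕ, p.Prime ∧ q.Prime ∧ p + q = 2 * m}) := by
  have h := schnirelmannDensity_ge_of_count' (K := 25)
    (S := ({0, 1} : Set ℕ) ∪ {m | ∃ p q : ℕ, p.Prime ∧ q.Prime ∧ p + q = 2 * m})
    (fun N hN => by have := half_count_ge_allN_of_RS_25 hRS hN; exact_mod_cast this)
  exact_mod_cast h

/-- ★★★★★★★★★★ **Explicit and unconditional, §18 (Chebyshev's constant `0.9212` throughout): every integer `N ≥ 2` is
a sum of at most `61` primes** (three-regime glue with one / four / seven shifted copies of the primes below `e^279`,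
`B(y) ≥ y/30`; sieve at `e^269` (`A = 13.77`), count at `e^279` (`|T| ≥ x/60`); halving, Mann: `30 • B = ℕ`,
`2·30 + 1`; superseded by §19's `59`).  No hypotheses, no named facts.
[cite: Nathanson1996, Thm 7.9 (explicit constant proved here)] -/
theorem schnirelmann_goldbach_le_61 (N : ℕ) (hN : 2 ≤ N) :
    ∃ M : Multiset ℕ, (∀ p ∈ M, p.Prime) ∧ Multiset.card M ≤ 61 ∧ M.sum = N := by
  have hσ : (1 : ℝ) / ((30 : ℕ) : ℝ) ≤ schnirelmannDensity
      (({0, 1} : Set ℕ) ∪ {m | ∃ p q : ℕ, p.Prime ∧ q.Prime ∧ p + q = 2 * m}) := by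
    have := schnirelmannDensity_half_ge_30
    exact_mod_cast this
  exact sum_of_primes_of_half_density_mann (h := 30) (by norm_num) hσ N hN

/-- ★★ **Under Rosser–Schoenfeld (3.3): every integer `N ≥ 2` is a sum of at most `51` primes** (`σ(B) ≥ 1/25`).
[cite: RosserSchoenfeld1962, Theorem 2, eq. (3.3) (as input)] -/
theorem schnirelmann_goldbach_of_RS_le_51 (hRS : Literature.NumberTheory.LFunctions.RosserSchoenfeld1962_theorem2)
    (N : ℕ) (hN : 2 ≤ N) :
    ∃ M : Multiset ℕ, (∀ p ∈ M, p.Prime) ∧ Multiset.card M ≤ 51 ∧ M.sum = N := by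
  have hσ : (1 : ℝ) / ((25 : ℕ) : ℝ) ≤ schnirelmannDensity
      (({0, 1} : Set ℕ) ∪ {m | ∃ p q : ℕ, p.Prime ∧ q.Prime ∧ p + q = 2 * m}) := by
    have := schnirelmannDensity_half_ge_of_RS_25 hRS
    exact_mod_cast this
  exact sum_of_primes_of_half_density_mann (h := 25) (by norm_num) hσ N hN

/-! ## §19 ROUND-34 «SYLVESTER»: the tree's Sylvester constant `0.9392` in place of Chebyshev's `0.9212` above `10¹²` —
`K = 59`

The near-miss of §18 at `h = 29` (`κ = 1/58`) is the HÖLDER LINE: it needs `A ≤ 13.52`, i.e. `Λs ≳ 480`, beyond every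
shift window.  ONE INPUT VARIED: the Chebyshev constant `c₀`.  It enters the count TWICE — in the first moment
`Σ_{N≤x} r(N) ≥ c₁·x²/log²x` with `c₁ = c₀²/2` (`0.9212²/2 = 0.4243`) and in the glue main terms `1.8424k` — and the tree
PROVES (zero facts) Sylvester's `ψ(x) ≥ 0.9392x − 9√x` (`ChebyshevSylvesterPsi.sylvester_le_psi`), whence
`π(n) ≥ 0.93919·n/log n` for `n ≥ 10¹²` (`primeCountingLowerMul_sylvester`), `c₁ = 0.441` above `e^41`
(`sum_goldbachCount_ge_0441`) and main terms `7.51352` / `13.14866` (`half_count_ge_allN_bonf7S`).  With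
`F = 0.4409·gHol(275) − 0.0057 = 0.80655` (`F⁸ = 0.1791`, ×1.353 over §18) the Hölder line holds at `κ = 1/58`,
`A = 13.78` (`Λs = 265`): `(1/58)⁷·259.55·13.78⁸ = 0.1528`; the seven-shift window at `h = 29` is `[104.5, 276.8]`
(`Λ₀ = 275`, `L₂ = 150`, one shift below `e^53.4296 = e^{1.8424·29}` with the old constant), so `σ(B) ≥ 1/29` and
**`schnirelmann_goldbach_le_59`**.  The conditional column (`c₀ = 1`) is unaffected (`51`, §18). -/

/-! #### §19.1 The prime-counting input `c₀ = 0.93919` from `10¹²` and the first moment `0.441` -/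

/-- `0.93919·n/log n ≤ π(n)` for every `n ≥ 10¹²`, from the tree's Sylvester bound `0.9392x − 9√x ≤ ψ(x)` and Mathlib's
`ψ(n) ≤ π(n)·log n` (`9√n ≤ 9·10⁻⁶·n`). [cite: Sylvester1892, pp. 87–120 (via the tree's `sylvester_le_psi`)] -/
theorem primeCountingLowerMul_sylvester : PrimeCountingLowerMul 0.93919 (10 ^ 12) := by
  intro n hn
  have hn0 : (10 : ℝ) ^ 12 ≤ n := by exact_mod_cast hn
  have hn1 : (1 : ℝ) < n := by linarith
  have hlogn : 0 < Real.log n := Real.log_pos hn1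
  have hψ := Literature.NumberTheory.LFunctions.sylvester_le_psi (x := (n : ℝ)) (by positivity)
  have hπ := Chebyshev.psi_le_primeCounting_mul_log n
  have h6 : (10 : ℝ) ^ 6 ≤ Real.sqrt n := by
    have e : (10 : ℝ) ^ 6 = Real.sqrt ((10 : ℝ) ^ 12) := by
      rw [show (10 : ℝ) ^ 12 = ((10 : ℝ) ^ 6) ^ 2 by norm_num, Real.sqrt_sq (by norm_num)]
    rw [e]
    exact Real.sqrt_le_sqrt hn0
  have hss : Real.sqrt n * Real.sqrt n = n := Real.mul_self_sqrt (by positivity)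
  have h9 : 9 * Real.sqrt n ≤ 0.00001 * n := by nlinarith [h6, hss, Real.sqrt_nonneg (n : ℝ)]
  rw [div_le_iff₀ hlogn]
  linarith

/-- **First moment, `0.441`, from `e^41`** (`0.93919²/2 = 0.44104`; `x₁ = 10¹²`). [cite: Nathanson1996, Theorem 7.8 (proof, the first moment with Sylvester's constant; explicit form proved here)] -/
theorem sum_goldbachCount_ge_0441 {x : ℕ} (hx : Real.exp 41 ≤ (x : ℝ)) :
    0.441 * ((x : ℝ) ^ 2 / Real.log x ^ 2) ≤ ∑ N ∈ range (x + 1), (SingularSeries.goldbachCount N : ℝ) := by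
  have hbig : (2 : ℝ) ^ 59 ≤ x := two_pow_59_le_exp_41.trans hx
  have h59 : (2000000000000 : ℝ) ≤ (2 : ℝ) ^ 59 := by norm_num
  have hx2 : 2 * 10 ^ 12 ≤ x := by
    have : ((2 * 10 ^ 12 : ℕ) : ℝ) ≤ x := by push_cast; linarith
    exact_mod_cast this
  have h := sum_goldbachCount_ge_of_lower (by norm_num) (by norm_num) primeCountingLowerMul_sylvester hx2
  have e : ((10 ^ 12 : ℕ) : ℝ) = (10 : ℝ) ^ 12 := by norm_num
  rw [e] at h
  refine le_trans ?_ h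
  have hx1 : (1 : ℝ) < x := by linarith
  have hL : 0 < Real.log x := Real.log_pos hx1
  have hL2 : 0 < 2 * Real.log x ^ 2 := by positivity
  have hxn : (0 : ℝ) ≤ x := by linarith
  have key : 0.441 * (x : ℝ) ^ 2 * 2 ≤ 0.93919 ^ 2 * (((x : ℝ) - (10 : ℝ) ^ 12) ^ 2 - ((10 : ℝ) ^ 12) ^ 2) := by
    nlinarith [mul_le_mul_of_nonneg_right hbig hxn]
  calc 0.441 * ((x : ℝ) ^ 2 / Real.log x ^ 2) = (0.441 * (x : ℝ) ^ 2 * 2) / (2 * Real.log x ^ 2) := by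
        field_simp
    _ ≤ 0.93919 ^ 2 * (((x : ℝ) - (10 : ℝ) ^ 12) ^ 2 - ((10 : ℝ) ^ 12) ^ 2) / (2 * Real.log x ^ 2) :=
        div_le_div_of_nonneg_right key hL2.le
    _ = 0.93919 ^ 2 * ((((x : ℝ) - (10 : ℝ) ^ 12) ^ 2 - ((10 : ℝ) ^ 12) ^ 2) / (2 * Real.log x ^ 2)) := by ring

/-! #### §19.2 The three-regime glue with Sylvester's constant -/

set_option maxHeartbeats 1600000 in
/-- **All `y ≥ 1` for the halved set, THREE-REGIME glue with SYLVESTER's constant above `e^{L₁}`**: as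
`half_count_ge_allN_bonf7` (one shift with `c₀ = 0.9212` below `e^{L₁}`, `L₁ ≤ 1.8424h`), but the four- and seven-shift
regimes use `π(n) ≥ 0.93919·n/log n` (`n ≥ 10¹²`, from the tree's Sylvester bound `ψ(x) ≥ 0.9392x − 9√x`): main terms
`8·0.93919 = 7.51352` and `14·0.93919 = 13.14866`, i.e. `L² + h ≤ h·(7.51352·L − 248.5)` on `[L₁, L₂]` and
`L² + h ≤ h·(13.14866·L − 996.37)` on `[L₂, Λ₀]`.
[cite: Nathanson1996, Thm 7.7 (all-`x` form); Sylvester1892, pp. 87–120 (the constant, via the tree)] -/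
theorem half_count_ge_allN_bonf7S {L₁ L₂ Λ₀ : ℝ} {h : ℕ} (h28 : 28 ≤ h) (h41 : 41 ≤ L₁) (hL₁h : L₁ ≤ 1.8424 * h)
    (hΛ4 : Λ₀ ≤ 10000)
    (hquad : ∀ L : ℝ, L₁ ≤ L → L ≤ L₂ → L ^ 2 + h ≤ h * (7.51352 * L - 248.5))
    (hquad7 : ∀ L : ℝ, L₂ ≤ L → L ≤ Λ₀ → L ^ 2 + h ≤ h * (13.14866 * L - 996.37))
    (hlarge : ∀ x : ℕ, Real.exp Λ₀ ≤ (x : ℝ) →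
      (x : ℝ) / (2 * h) ≤ #{N ∈ Ioc 0 x | Even N ∧ ∃ p q : ℕ, p.Prime ∧ q.Prime ∧ p + q = N})
    {y : ℕ} (hy : 1 ≤ y) :
    (y : ℝ) / h ≤ #{b ∈ Ioc 0 y | b ∈ (({0, 1} : Set ℕ) ∪ {m | ∃ p q : ℕ, p.Prime ∧ q.Prime ∧ p + q = 2 * m})} := by
  set B : Set ℕ := ({0, 1} : Set ℕ) ∪ {m | ∃ p q : ℕ, p.Prime ∧ q.Prime ∧ p + q = 2 * m} with hB
  have hhr : (28 : ℝ) ≤ h := by exact_mod_cast h28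
  have hh0 : (0 : ℝ) < h := by linarith
  have hL₁pos : (0 : ℝ) < L₁ := by linarith
  by_cases hbig : Real.exp Λ₀ ≤ ((2 * y : ℕ) : ℝ)
  · have h1 := hlarge (2 * y) hbig
    have h2 := even_goldbach_card_le_half y
    have e : ((2 * y : ℕ) : ℝ) / (2 * h) = (y : ℝ) / h := by
      push_cast
      field_simp
    rw [e] at h1
    exact h1.trans (by exact_mod_cast h2)
  rw [not_le] at hbig
  by_cases hsmall : y ≤ h
  · have h1 : 1 ≤ #{b ∈ Ioc 0 y | b ∈ B} :=
      card_pos.mpr ⟨1, by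
        rw [mem_filter, mem_Ioc]
        exact ⟨⟨by omega, hy⟩, Or.inl (by simp)⟩⟩
    have h1' : (1 : ℝ) ≤ #{b ∈ Ioc 0 y | b ∈ B} := by exact_mod_cast h1
    have h2 : (y : ℝ) / h ≤ 1 := by
      rw [div_le_one hh0]
      exact_mod_cast hsmall
    linarith
  rw [not_le] at hsmall
  have hy29 : 29 ≤ y := by omega
  have hnr : ((2 * y - 3 : ℕ) : ℝ) = 2 * (y : ℝ) - 3 := cast_two_mul_sub_three (by omega)
  have hy29r : (29 : ℝ) ≤ y := by exact_mod_cast hy29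
  have hy0 : (0 : ℝ) < y := by linarith
  have hn55 : 55 ≤ 2 * y - 3 := by omega
  have hn0 : (0 : ℝ) < ((2 * y - 3 : ℕ) : ℝ) := by rw [hnr]; linarith
  have hn1 : (1 : ℝ) < ((2 * y - 3 : ℕ) : ℝ) := by rw [hnr]; linarith
  have hlogpos : 0 < Real.log ((2 * y - 3 : ℕ) : ℝ) := Real.log_pos hn1
  by_cases hmid : Real.log ((2 * y - 3 : ℕ) : ℝ) ≤ L₁
  · -- ONE SHIFT below `e^{L₁}` (§15)
    have hemb := primeCounting_shift_le_half_count (y := y) (by omega)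
    have hembr : (Nat.primeCounting (2 * y - 3) : ℝ) + 1 ≤ #{b ∈ Ioc 0 y | b ∈ B} := by exact_mod_cast hemb
    refine le_trans ?_ hembr
    by_cases h6 : 10 ^ 6 ≤ 2 * y - 3
    · have hπ : 0.9212 * ((2 * y - 3 : ℕ) : ℝ) / Real.log ((2 * y - 3 : ℕ) : ℝ)
          ≤ (Nat.primeCounting (2 * y - 3) : ℝ) := by
        have := primeCountingLowerMul_09212
        unfold PrimeCountingLowerMul at this
        exact this (2 * y - 3) h6
      have h2 : 0.9212 * ((2 * y - 3 : ℕ) : ℝ) / L₁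
          ≤ 0.9212 * ((2 * y - 3 : ℕ) : ℝ) / Real.log ((2 * y - 3 : ℕ) : ℝ) :=
        div_le_div_of_nonneg_left (by positivity) hlogpos hmid
      have h3 : (y : ℝ) / h ≤ 1.8424 * y / L₁ := by
        rw [div_le_div_iff₀ hh0 hL₁pos]
        nlinarith [mul_le_mul_of_nonneg_left hL₁h hy0.le]
      have h4 : 1.8424 * (y : ℝ) / L₁ ≤ 0.9212 * ((2 * y - 3 : ℕ) : ℝ) / L₁ + 1 := by
        rw [hnr]
        have e : 0.9212 * (2 * (y : ℝ) - 3) / L₁ = 1.8424 * y / L₁ - 2.7636 / L₁ := by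
          field_simp
          ring
        rw [e]
        have : 2.7636 / L₁ ≤ 1 := by
          rw [div_le_one hL₁pos]
          linarith
        linarith
      linarith [h2, h3, h4, hπ]
    · rw [not_le] at h6
      have hn32 : 32 ≤ 2 * y - 3 := by omega
      have hπ := ShnirelmanGoldbachTheorem.primeCounting_ge hn32
      have hlog14 : Real.log ((2 * y - 3 : ℕ) : ℝ) ≤ 14 := log_le_14_of_lt (by omega) h6
      have h5 : ((2 * y - 3 : ℕ) : ℝ) / 56 ≤ ((2 * y - 3 : ℕ) : ℝ) / (4 * Real.log ((2 * y - 3 : ℕ) : ℝ)) :=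
        div_le_div_of_nonneg_left hn0.le (by positivity) (by linarith)
      have h6' : (y : ℝ) / h ≤ (y : ℝ) / 28 := div_le_div_of_nonneg_left hy0.le (by norm_num) hhr
      have h7 : ((2 * y - 3 : ℕ) : ℝ) / 56 + 1 - (y : ℝ) / 28 = 53 / 56 := by
        rw [hnr]
        ring
      linarith [hπ, h5, h6', h7]
  · -- FOUR SHIFTS on `(e^{L₁}, e^{Λ₀})`
    rw [not_le] at hmid
    have h59 : (576460752303423488 : ℝ) < ((2 * y - 3 : ℕ) : ℝ) := by
      have h1 : Real.exp L₁ < ((2 * y - 3 : ℕ) : ℝ) := by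
        by_contra hc
        rw [not_lt] at hc
        have := Real.log_le_log hn0 hc
        rw [Real.log_exp] at this
        linarith
      exact lt_of_le_of_lt (numeral_le_exp_41.trans (Real.exp_le_exp.mpr h41)) h1
    have h59n : 576460752303423488 < 2 * y - 3 := by exact_mod_cast h59
    have hy58 : (288230376151711744 : ℝ) ≤ (y : ℝ) := by
      have : 288230376151711744 ≤ y := by omega
      exact_mod_cast this
    have h2y0 : (0 : ℝ) < ((2 * y : ℕ) : ℝ) := by push_cast; linarith
    set L := Real.log ((2 * y : ℕ) : ℝ) with hLdef
    have hLΛ : L < Λ₀ := by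
      have := Real.log_lt_log h2y0 hbig
      rwa [Real.log_exp] at this
    have hL₁L : L₁ ≤ L := by
      have h2y : ((2 * y - 3 : ℕ) : ℝ) ≤ ((2 * y : ℕ) : ℝ) := by rw [hnr]; push_cast; linarith
      exact (hmid.trans_le (Real.log_le_log hn0 h2y)).le
    have hL41 : (41 : ℝ) ≤ L := h41.trans hL₁L
    have hLpos : (0 : ℝ) < L := by linarith
    have hL4 : L ≤ 10000 := by linarith
    have he41 : Real.exp 41 ≤ ((2 * y : ℕ) : ℝ) := by
      have : Real.exp 41 ≤ Real.exp L := Real.exp_le_exp.mpr hL41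
      rwa [hLdef, Real.exp_log h2y0] at this
    -- the prime counts, Sylvester's constant
    have hπ : ∀ q : ℕ, q ≤ 19 → 0.93919 * (2 * (y : ℝ) - q) / L ≤ (Nat.primeCounting (2 * y - q) : ℝ) := by
      intro q hq
      have hqr : (q : ℝ) ≤ 19 := by exact_mod_cast hq
      have hnq : ((2 * y - q : ℕ) : ℝ) = 2 * (y : ℝ) - q := cast_two_mul_sub (by omega)
      have h6 : 10 ^ 12 ≤ 2 * y - q := by omega
      have hnq0 : (0 : ℝ) < ((2 * y - q : ℕ) : ℝ) := by rw [hnq]; linarith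
      have hnq1 : (1 : ℝ) < ((2 * y - q : ℕ) : ℝ) := by rw [hnq]; linarith
      have h1 : 0.93919 * ((2 * y - q : ℕ) : ℝ) / Real.log ((2 * y - q : ℕ) : ℝ)
          ≤ (Nat.primeCounting (2 * y - q) : ℝ) := by
        have := primeCountingLowerMul_sylvester
        unfold PrimeCountingLowerMul at this
        exact this (2 * y - q) h6
      have hlogq0 : 0 < Real.log ((2 * y - q : ℕ) : ℝ) := Real.log_pos hnq1
      have hlogq : Real.log ((2 * y - q : ℕ) : ℝ) ≤ L := by
        have h2y : ((2 * y - q : ℕ) : ℝ) ≤ ((2 * y : ℕ) : ℝ) := by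
          rw [hnq]; push_cast; linarith [Nat.cast_nonneg (α := ℝ) q]
        exact Real.log_le_log hnq0 h2y
      have h2 : 0.93919 * (2 * (y : ℝ) - q) / L
          ≤ 0.93919 * ((2 * y - q : ℕ) : ℝ) / Real.log ((2 * y - q : ℕ) : ℝ) := by
        rw [← hnq]
        exact div_le_div_of_nonneg_left (by positivity) hlogq0 hlogq
      linarith
    -- the pair counts (tree: explicit pair sieve above `e^41`)
    have hP : ∀ d : ℕ, d ≠ 0 → Even d →
        (#((Nat.primesLE (2 * y)).filter (fun p => (p + d).Prime)) : ℝ)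
          ≤ 17.75 * oddSingularFactor d * ((2 * y : ℕ) : ℝ) / L ^ 2 := by
      intro d hd hde
      exact TwoResidueSelbergExplicit.pairCount_le_kappa (N := 2 * y) (h := d) he41 hd hde
    rcases le_or_gt L L₂ with hmid2 | hmid2
    · -- FOUR SHIFTS on `(e^{L₁}, e^{L₂}]`
      have hq := hquad L hL₁L hmid2
      have hP2 := hP 2 (by norm_num) (by norm_num)
      have hP4 := hP 4 (by norm_num) (by norm_num)
      have hP6 := hP 6 (by norm_num) (by norm_num)
      have hP8 := hP 8 (by norm_num) (by norm_num)
      rw [oddSingularFactor_two'] at hP2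
      rw [oddSingularFactor_four] at hP4
      rw [oddSingularFactor_six] at hP6
      rw [oddSingularFactor_eight] at hP8
      -- combinatorics
      have hcomb := four_shift_count (y := y) (by omega)
      have hcombr : (Nat.primeCounting (2 * y - 3) : ℝ) + Nat.primeCounting (2 * y - 5)
          + Nat.primeCounting (2 * y - 7) + Nat.primeCounting (2 * y - 11)
          ≤ (#{b ∈ Ioc 0 y | b ∈ B} : ℝ) + 2
            + (2 * #((Nat.primesLE (2 * y)).filter (fun p => (p + 2).Prime))
              + 2 * #((Nat.primesLE (2 * y)).filter (fun p => (p + 4).Prime))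
              + #((Nat.primesLE (2 * y)).filter (fun p => (p + 8).Prime))
              + #((Nat.primesLE (2 * y)).filter (fun p => (p + 6).Prime))) := by
        exact_mod_cast hcomb
      have hπ3 := hπ 3 (by norm_num)
      have hπ5 := hπ 5 (by norm_num)
      have hπ7 := hπ 7 (by norm_num)
      have hπ11 := hπ 11 (by norm_num)
      push_cast at hπ3 hπ5 hπ7 hπ11
      have h2yr : ((2 * y : ℕ) : ℝ) = 2 * (y : ℝ) := by push_cast; ring
      rw [h2yr] at hP2 hP4 hP6 hP8
      set G : ℝ := (#{b ∈ Ioc 0 y | b ∈ B} : ℝ) with hG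
      set Y : ℝ := (y : ℝ) with hY
      -- `G ≥ (7.51352 Y − 24.41894)/L − 2 − 248.5 Y/L²`
      have hG1 : (7.51352 * Y - 24.41894) / L - 2 - 248.5 * Y / L ^ 2 ≤ G := by
        have e1 : (7.51352 * Y - 24.41894) / L = 0.93919 * (2 * Y - 3) / L + 0.93919 * (2 * Y - 5) / L
            + 0.93919 * (2 * Y - 7) / L + 0.93919 * (2 * Y - 11) / L := by
          field_simp
          ring
        have e2 : 248.5 * Y / L ^ 2 = 2 * (17.75 * 1 * (2 * Y) / L ^ 2) + 2 * (17.75 * 1 * (2 * Y) / L ^ 2)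
            + 17.75 * 1 * (2 * Y) / L ^ 2 + 17.75 * 2 * (2 * Y) / L ^ 2 := by
          field_simp
          ring
        rw [e1, e2]
        linarith [hcombr, hπ3, hπ5, hπ7, hπ11, hP2, hP4, hP6, hP8]
      have hL2 : (0 : ℝ) < L ^ 2 := by positivity
      have hkey : Y * L ^ 2 ≤ (h : ℝ) * G * L ^ 2 := by
        have e3 : ((7.51352 * Y - 24.41894) / L - 2 - 248.5 * Y / L ^ 2) * L ^ 2
            = 7.51352 * Y * L - 24.41894 * L - 2 * L ^ 2 - 248.5 * Y := by
          field_simp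
        have h1 : (7.51352 * Y * L - 24.41894 * L - 2 * L ^ 2 - 248.5 * Y) * h ≤ G * L ^ 2 * h := by
          rw [← e3]
          exact mul_le_mul_of_nonneg_right (mul_le_mul_of_nonneg_right hG1 hL2.le) hh0.le
        have h2 : Y * (L ^ 2 + h) ≤ Y * (h * (7.51352 * L - 248.5)) :=
          mul_le_mul_of_nonneg_left hq (by linarith)
        have h3 : 24.41894 * L + 2 * L ^ 2 ≤ Y := by
          nlinarith [mul_nonneg (sub_nonneg.2 hL4) hLpos.le]
        have h3' : (h : ℝ) * (24.41894 * L + 2 * L ^ 2) ≤ h * Y := mul_le_mul_of_nonneg_left h3 hh0.le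
        nlinarith [h1, h2, h3']
      have hfin := le_of_mul_le_mul_right hkey hL2
      rw [div_le_iff₀ hh0, mul_comm]
      exact hfin
    · -- SEVEN SHIFTS on `(e^{L₂}, e^{Λ₀})`
      have hq := hquad7 L hmid2.le hLΛ.le
      have hP2 := hP 2 (by norm_num) (by norm_num)
      have hP4 := hP 4 (by norm_num) (by norm_num)
      have hP6 := hP 6 (by norm_num) (by norm_num)
      have hP8 := hP 8 (by norm_num) (by norm_num)
      have hP10 := hP 10 (by norm_num) (by norm_num)
      have hP12 := hP 12 (by norm_num) (by norm_num)
      have hP14 := hP 14 (by norm_num) (by norm_num)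
      have hP16 := hP 16 (by norm_num) (by norm_num)
      rw [oddSingularFactor_two'] at hP2
      rw [oddSingularFactor_four] at hP4
      rw [oddSingularFactor_six] at hP6
      rw [oddSingularFactor_eight] at hP8
      rw [oddSingularFactor_ten] at hP10
      rw [oddSingularFactor_twelve] at hP12
      rw [oddSingularFactor_fourteen] at hP14
      rw [oddSingularFactor_sixteen] at hP16
      have hcomb := seven_shift_count (y := y) (by omega)
      have hcombr : (Nat.primeCounting (2 * y - 3) : ℝ) + Nat.primeCounting (2 * y - 5)
          + Nat.primeCounting (2 * y - 7) + Nat.primeCounting (2 * y - 11) + Nat.primeCounting (2 * y - 13)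
          + Nat.primeCounting (2 * y - 17) + Nat.primeCounting (2 * y - 19)
          ≤ (#{b ∈ Ioc 0 y | b ∈ B} : ℝ) + 5
            + (4 * #((Nat.primesLE (2 * y)).filter (fun p => (p + 2).Prime))
              + 3 * #((Nat.primesLE (2 * y)).filter (fun p => (p + 4).Prime))
              + 4 * #((Nat.primesLE (2 * y)).filter (fun p => (p + 6).Prime))
              + 3 * #((Nat.primesLE (2 * y)).filter (fun p => (p + 8).Prime))
              + 2 * #((Nat.primesLE (2 * y)).filter (fun p => (p + 10).Prime))
              + 2 * #((Nat.primesLE (2 * y)).filter (fun p => (p + 12).Prime))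
              + 2 * #((Nat.primesLE (2 * y)).filter (fun p => (p + 14).Prime))
              + #((Nat.primesLE (2 * y)).filter (fun p => (p + 16).Prime))) := by
        exact_mod_cast hcomb
      have hπ3 := hπ 3 (by norm_num)
      have hπ5 := hπ 5 (by norm_num)
      have hπ7 := hπ 7 (by norm_num)
      have hπ11 := hπ 11 (by norm_num)
      have hπ13 := hπ 13 (by norm_num)
      have hπ17 := hπ 17 (by norm_num)
      have hπ19 := hπ 19 (by norm_num)
      push_cast at hπ3 hπ5 hπ7 hπ11 hπ13 hπ17 hπ19
      have h2yr : ((2 * y : ℕ) : ℝ) = 2 * (y : ℝ) := by push_cast; ring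
      rw [h2yr] at hP2 hP4 hP6 hP8 hP10 hP12 hP14 hP16
      set G : ℝ := (#{b ∈ Ioc 0 y | b ∈ B} : ℝ) with hG
      set Y : ℝ := (y : ℝ) with hY
      have hY0 : 0 ≤ Y := le_trans (by norm_num) hy58
      have hL2 : (0 : ℝ) < L ^ 2 := by positivity
      have hG1 : (13.14866 * Y - 70.43925) / L - 5 - 996.37 * Y / L ^ 2 ≤ G := by
        have e1 : (13.14866 * Y - 70.43925) / L
            = 0.93919 * (2 * Y - 3) / L + 0.93919 * (2 * Y - 5) / L + 0.93919 * (2 * Y - 7) / L + 0.93919 * (2 * Y - 11) / L + 0.93919 * (2 * Y - 13) / L + 0.93919 * (2 * Y - 17) / L + 0.93919 * (2 * Y - 19) / L := by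
          field_simp
          ring
        have e2 : 4 * (17.75 * 1 * (2 * Y) / L ^ 2) + 3 * (17.75 * 1 * (2 * Y) / L ^ 2)
            + 4 * (17.75 * 2 * (2 * Y) / L ^ 2) + 3 * (17.75 * 1 * (2 * Y) / L ^ 2)
            + 2 * (17.75 * (4 / 3) * (2 * Y) / L ^ 2) + 2 * (17.75 * 2 * (2 * Y) / L ^ 2)
            + 2 * (17.75 * (6 / 5) * (2 * Y) / L ^ 2) + 17.75 * 1 * (2 * Y) / L ^ 2
            = (29891 / 30) * Y / L ^ 2 := by
          field_simp
          ring
        have e3 : (29891 / 30 : ℝ) * Y / L ^ 2 ≤ 996.37 * Y / L ^ 2 :=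
          div_le_div_of_nonneg_right (mul_le_mul_of_nonneg_right (by norm_num) hY0) hL2.le
        rw [e1]
        linarith [hcombr, hπ3, hπ5, hπ7, hπ11, hπ13, hπ17, hπ19, hP2, hP4, hP6, hP8, hP10, hP12, hP14, hP16,
          e2, e3]
      have hkey : Y * L ^ 2 ≤ (h : ℝ) * G * L ^ 2 := by
        have e4 : ((13.14866 * Y - 70.43925) / L - 5 - 996.37 * Y / L ^ 2) * L ^ 2
            = 13.14866 * Y * L - 70.43925 * L - 5 * L ^ 2 - 996.37 * Y := by
          field_simp
        have h1 : (13.14866 * Y * L - 70.43925 * L - 5 * L ^ 2 - 996.37 * Y) * h ≤ G * L ^ 2 * h := by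
          rw [← e4]
          exact mul_le_mul_of_nonneg_right (mul_le_mul_of_nonneg_right hG1 hL2.le) hh0.le
        have h2 : Y * (L ^ 2 + h) ≤ Y * (h * (13.14866 * L - 996.37)) :=
          mul_le_mul_of_nonneg_left hq (by linarith)
        have h3 : 70.43925 * L + 5 * L ^ 2 ≤ Y := by
          nlinarith [mul_nonneg (sub_nonneg.2 hL4) hLpos.le]
        have h3' : (h : ℝ) * (70.43925 * L + 5 * L ^ 2) ≤ h * Y := mul_le_mul_of_nonneg_left h3 hh0.le
        nlinarith [h1, h2, h3']
      have hfin := le_of_mul_le_mul_right hkey hL2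
      rw [div_le_iff₀ hh0, mul_comm]
      exact hfin

/-! #### §19.3 Instances: `K = 59` unconditionally -/

/-- Numerics at `Λ = 265`: `17L² ≤ 16·13.76·TlowK(L/2 − 1.38632)` for `L ≥ 265`. [folklore] -/
private theorem kappa_numeric_265 {L : ℝ} (hL : 265 ≤ L) :
    17 * L ^ 2 ≤ 16 * (13.78 - 0.02) * TwoResidueSelbergExplicit.TlowK (L / 2 - 1.38632) := by
  unfold TwoResidueSelbergExplicit.TlowK
  nlinarith [hL, mul_self_nonneg (L - 265)]

/-- **`A = 13.78` above `e^265`**. [cite: BatemanDiamond2004, §13.4 (13.13)–(13.14)] -/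
theorem goldbachCount_le_1378 {N : ℕ} (hN : Real.exp 265 ≤ (N : ℝ)) (heven : Even N) :
    (SingularSeries.goldbachCount N : ℝ) ≤ 13.78 * oddSingularFactor N * (N : ℝ) / Real.log (N : ℝ) ^ 2 :=
  goldbachCount_le_of_numeric41 (by norm_num) (fun _ hL => kappa_numeric_265 hL) hN heven

/-- **Unconditional, above `e^275`**: at least `x/58` EVEN Goldbach numbers in `(0, x]`
(`Λs = 265`, `A = 13.78`, `c₁ = 0.441`; `(1/58)⁷·259.55·13.78⁸ = 0.1528 ≤ (0.4409·gHol 275 − 0.0057)⁸ = 0.1791`).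
[cite: Nathanson1996, Theorem 7.8 (proof, restricted to even N; explicit form proved here)] -/
theorem goldbach_even_count_ge_58_exp275 {x : ℕ} (hx : Real.exp 275 ≤ (x : ℝ)) :
    (x : ℝ) / 58 ≤ #{N ∈ Ioc 0 x | Even N ∧ ∃ p q : ℕ, p.Prime ∧ q.Prime ∧ p + q = N} := by
  have h := goldbach_even_count_ge_holder_gap10 (Λs := 265) (Λ₀ := 275) (A := 13.78) (c₁ := 0.441) (κ := 1 / 58)
    (by norm_num) (by norm_num) (by norm_num) (by norm_num) (by norm_num)
    (fun N hN hev => goldbachCount_le_1378 hN hev) (by norm_num) (by norm_num)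
    (fun y hy => sum_goldbachCount_ge_0441 ((Real.exp_le_exp.mpr (by norm_num)).trans hy))
    (by unfold gHol; norm_num) (by unfold gHol; norm_num) hx
  have e : (1 : ℝ) / 58 * x = x / 58 := by ring
  rw [e] at h
  exact h

/-- **Unconditional count for all `y ≥ 1`**: `B(y) ≥ y/29` (one shift below `e^53.4296 = e^{1.8424·29}`, four shifts with
Sylvester's constant on `[53.4296, 150]`, seven on `[150, 275]`, the count above `e^275`). [cite: Nathanson1996, Theorem 7.8 (explicit constant for the halved set proved here)] -/
theorem half_count_ge_allN_29 {y : ℕ} (hy : 1 ≤ y) :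
    (y : ℝ) / 29 ≤ #{b ∈ Ioc 0 y | b ∈ (({0, 1} : Set ℕ) ∪ {m | ∃ p q : ℕ, p.Prime ∧ q.Prime ∧ p + q = 2 * m})} := by
  have h := half_count_ge_allN_bonf7S (L₁ := 53.4296) (L₂ := 150) (Λ₀ := 275) (h := 29) (by norm_num) (by norm_num)
    (by norm_num) (by norm_num)
    (fun L h1 h2 => by
      push_cast
      nlinarith [mul_nonneg (sub_nonneg.2 h1) (sub_nonneg.2 h2)])
    (fun L h1 h2 => by
      push_cast
      nlinarith [mul_nonneg (sub_nonneg.2 h1) (sub_nonneg.2 h2)])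
    (fun x hx => by
      have h1 := goldbach_even_count_ge_58_exp275 hx
      have e : (x : ℝ) / (2 * ((29 : ℕ) : ℝ)) = (x : ℝ) / 58 := by norm_num
      rw [e]
      exact h1) hy
  exact_mod_cast h

/-- **The halved density, `1/29`**: `σ({0, 1} ∪ {m : 2m = p + q}) ≥ 1/29`, unconditionally. [cite: Nathanson1996, Theorem 7.8 (explicit constant for the halved set proved here)] -/
theorem schnirelmannDensity_half_ge_29 :
    (1 : ℝ) / 29 ≤ schnirelmannDensity
      (({0, 1} : Set ℕ) ∪ {m | ∃ p q : ℕ, p.Prime ∧ q.Prime ∧ p + q = 2 * m}) := by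
  have h := schnirelmannDensity_ge_of_count' (K := 29)
    (S := ({0, 1} : Set ℕ) ∪ {m | ∃ p q : ℕ, p.Prime ∧ q.Prime ∧ p + q = 2 * m})
    (fun N hN => by have := half_count_ge_allN_29 hN; exact_mod_cast this)
  exact_mod_cast h

/-- ★★★★★★★★★★★ **The Shnirel'man–Goldbach theorem, explicit and unconditional — the best constant of this file: every
integer `N ≥ 2` is a sum of at most `59` primes** (Sylvester's constant `0.9392` (tree, proved) in the first moment
(`c₁ = 0.441`) and in the four/seven-shift glue; sieve at `e^265` (`A = 13.78`), count at `e^275` (`|T| ≥ x/58`);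
`B(y) ≥ y/29`; halving, Mann: `29 • B = ℕ`, `2·29 + 1`).  No hypotheses, no named facts.
[cite: Nathanson1996, Thm 7.9 (explicit constant proved here)] -/
theorem schnirelmann_goldbach_le_59 (N : ℕ) (hN : 2 ≤ N) :
    ∃ M : Multiset ℕ, (∀ p ∈ M, p.Prime) ∧ Multiset.card M ≤ 59 ∧ M.sum = N := by
  have hσ : (1 : ℝ) / ((29 : ℕ) : ℝ) ≤ schnirelmannDensity
      (({0, 1} : Set ℕ) ∪ {m | ∃ p q : ℕ, p.Prime ∧ q.Prime ∧ p + q = 2 * m}) := by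
    have := schnirelmannDensity_half_ge_29
    exact_mod_cast this
  exact sum_of_primes_of_half_density_mann (h := 29) (by norm_num) hσ N hN

end Literature.NumberTheory.Sieve.ShnirelmanGoldbachExplicit
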